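import Summits.NavierStokesRegularity.NavierStokesRegularity.Theses.LerayQuarterDissipation
import Summits.NavierStokesRegularity.NavierStokesRegularity.Theorems.LerayQuarterDissipationFiniteDissipationLiouvilleStubSmallDissipationGap
import Summits.NavierStokesRegularity.NavierStokesRegularity.Theorems.LerayQuarterDissipationRecurrentReductionD
import Summits.NavierStokesRegularity.NavierStokesRegularity.Theorems.LerayQuarterDissipationFiniteDissipationLiouvillePastDss
import Summits.NavierStokesRegularity.NavierStokesRegularity.Theorems.LerayQuarterDissipationFiniteDissipationLiouvilleFinalTrace
import Summits.NavierStokesRegularity.NavierStokesRegularity.Theorems.LerayQuarterDissipationRecurrentDissipativeLiouvilleCriticalRecurrent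
import Summits.NavierStokesRegularity.NavierStokesRegularity.Theorems.LerayQuarterDissipationFiniteDissipationLiouvilleTraceWeighted
import Summits.NavierStokesRegularity.NavierStokesRegularity.Theorems.LerayQuarterDissipationFiniteDissipationLiouvilleTraceVorticityFloor
import Summits.NavierStokesRegularity.NavierStokesRegularity.Theorems.LerayQuarterDissipationFiniteDissipationLiouvilleCriticalPoint
import Summits.NavierStokesRegularity.NavierStokesRegularity.Theorems.LerayQuarterDissipationFiniteDissipationLiouvilleEnvelopePV
import Summits.NavierStokesRegularity.NavierStokesRegularity.Theorems.LerayQuarterDissipationFiniteDissipationLiouvilleAbsoluteFloors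
import Summits.NavierStokesRegularity.NavierStokesRegularity.Theorems.LerayQuarterDissipationFiniteDissipationLiouvilleDssUniformThreshold
import Summits.NavierStokesRegularity.NavierStokesRegularity.Theorems.LerayQuarterDissipationFiniteDissipationLiouvilleDssFactors
import Summits.NavierStokesRegularity.NavierStokesRegularity.Theorems.LerayQuarterDissipationFiniteDissipationLiouvilleLyapunov
import Summits.NavierStokesRegularity.NavierStokesRegularity.Theorems.LerayQuarterDissipationFiniteDissipationLiouvilleFinalDatumProfile
import Summits.NavierStokesRegularity.NavierStokesRegularity.Theorems.LerayQuarterDissipationFiniteDissipationLiouvilleVorticityAlignmentRegime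
import Summits.NavierStokesRegularity.NavierStokesRegularity.Theorems.LerayQuarterDissipationFiniteDissipationLiouvillePlanarityFloor
import Summits.NavierStokesRegularity.NavierStokesRegularity.Theorems.LerayQuarterDissipationFiniteDissipationLiouvilleUnidirectionalFloor
import Summits.NavierStokesRegularity.NavierStokesRegularity.Theorems.LerayQuarterDissipationFiniteDissipationLiouvilleVorticityAlignmentLocal
import Summits.NavierStokesRegularity.NavierStokesRegularity.Theorems.LerayQuarterDissipationFiniteDissipationLiouvillePlanarityLocal
import Summits.NavierStokesRegularity.NavierStokesRegularity.Theorems.LerayQuarterDissipationFiniteDissipationLiouvilleUnidirectionalLocal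
import Summits.NavierStokesRegularity.NavierStokesRegularity.Theorems.LerayQuarterDissipationFiniteDissipationLiouvilleAlignmentConcentrating
import Summits.NavierStokesRegularity.NavierStokesRegularity.Theorems.LerayQuarterDissipationFiniteDissipationLiouvilleTraceMorrey
import Summits.NavierStokesRegularity.NavierStokesRegularity.Theorems.LerayQuarterDissipationFiniteDissipationLiouvilleEnergyFloor
import Summits.NavierStokesRegularity.NavierStokesRegularity.Theorems.LerayQuarterDissipationFiniteDissipationLiouvilleEnergyRemainder
import Summits.NavierStokesRegularity.NavierStokesRegularity.Theorems.LerayQuarterDissipationFiniteDissipationLiouvilleEnergyTraceDatum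
import Summits.NavierStokesRegularity.NavierStokesRegularity.Theorems.LerayQuarterDissipationFiniteDissipationLiouvilleFinalDatumVorticityMinimal
import Summits.NavierStokesRegularity.NavierStokesRegularity.Theorems.LerayQuarterDissipationFiniteDissipationLiouvilleEnergyReturn
import Summits.NavierStokesRegularity.NavierStokesRegularity.Theorems.LerayQuarterDissipationFiniteDissipationLiouvilleFinalDatumSaturation
import Summits.NavierStokesRegularity.NavierStokesRegularity.Theorems.LerayQuarterDissipationFiniteDissipationLiouvillePointGroup
import Summits.NavierStokesRegularity.NavierStokesRegularity.Theorems.LerayQuarterDissipationFiniteDissipationLiouvilleHullCategoryCritical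
import Summits.NavierStokesRegularity.NavierStokesRegularity.Theorems.LerayQuarterDissipationFiniteDissipationLiouvilleErgodicHullObservables
import Summits.NavierStokesRegularity.NavierStokesRegularity.Theorems.LerayQuarterDissipationFiniteDissipationLiouvilleExtremal
import Summits.NavierStokesRegularity.NavierStokesRegularity.Theorems.LerayQuarterDissipationFiniteDissipationLiouvilleReturnTimesSharp
import Summits.NavierStokesRegularity.NavierStokesRegularity.Theorems.LerayQuarterDissipationFiniteDissipationLiouvilleLocalSelfSimilarity
import Summits.NavierStokesRegularity.NavierStokesRegularity.Theorems.LerayQuarterDissipationFiniteDissipationLiouvilleCalmVorticityIdentity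
import Summits.NavierStokesRegularity.NavierStokesRegularity.Theorems.LerayQuarterDissipationFiniteDissipationLiouvilleCalmSliceMean
import Summits.NavierStokesRegularity.NavierStokesRegularity.Theorems.LerayQuarterDissipationFiniteDissipationLiouvilleFlickerEnvelope
import Summits.NavierStokesRegularity.NavierStokesRegularity.Theorems.LerayQuarterDissipationFiniteDissipationLiouvilleThresholdOne
import Summits.NavierStokesRegularity.NavierStokesRegularity.Theorems.LerayQuarterDissipationFiniteDissipationLiouvilleThresholdSaturation
import Summits.NavierStokesRegularity.NavierStokesRegularity.Theorems.LerayQuarterDissipationFiniteDissipationLiouvilleSmallDissipationGapSharper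
import Summits.NavierStokesRegularity.NavierStokesRegularity.Theorems.LerayQuarterDissipationFiniteDissipationLiouvilleThresholdK
import Summits.NavierStokesRegularity.NavierStokesRegularity.Theorems.LerayQuarterDissipationFiniteDissipationLiouvilleVorticityAmplitudeWindows
import Summits.NavierStokesRegularity.NavierStokesRegularity.Theorems.LerayQuarterDissipationFiniteDissipationLiouvilleVorticityAmplitudeJoint
import Summits.NavierStokesRegularity.NavierStokesRegularity.Theorems.LerayQuarterDissipationFiniteDissipationLiouvilleVorticityLThree
import Summits.NavierStokesRegularity.NavierStokesRegularity.Theorems.LerayQuarterDissipationFiniteDissipationLiouvilleVelocityLSix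
import Summits.NavierStokesRegularity.NavierStokesRegularity.Theorems.LerayQuarterDissipationFiniteDissipationLiouvilleAveragedVelocity
import Summits.NavierStokesRegularity.NavierStokesRegularity.Theorems.LerayQuarterDissipationFiniteDissipationLiouvilleMixedRegion
import Summits.NavierStokesRegularity.NavierStokesRegularity.Theorems.LerayQuarterDissipationFiniteDissipationLiouvilleEveryInstant
import Summits.NavierStokesRegularity.NavierStokesRegularity.Theorems.LerayQuarterDissipationFiniteDissipationLiouvilleEveryInstantMixed
import Summits.NavierStokesRegularity.NavierStokesRegularity.Theorems.LerayQuarterDissipationFiniteDissipationLiouvilleCrossFlowThreshold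
import Summits.NavierStokesRegularity.NavierStokesRegularity.Theorems.LerayQuarterDissipationFiniteDissipationLiouvilleLambProductCollar
import Summits.NavierStokesRegularity.NavierStokesRegularity.Theorems.LerayQuarterDissipationFiniteDissipationLiouvilleMicroscaleWindowEnvelope
import Summits.NavierStokesRegularity.NavierStokesRegularity.Theorems.LerayQuarterDissipationFiniteDissipationLiouvilleLocalBalanceStretching
import Summits.NavierStokesRegularity.NavierStokesRegularity.Theorems.LerayQuarterDissipationFiniteDissipationLiouvilleLocalBalanceCore
import Summits.NavierStokesRegularity.NavierStokesRegularity.Theorems.LerayQuarterDissipationFiniteDissipationLiouvilleMicroscaleWindowPalinstrophy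
import Summits.NavierStokesRegularity.NavierStokesRegularity.Theorems.LerayQuarterDissipationFiniteDissipationLiouvilleLocalBalanceApex
import Summits.NavierStokesRegularity.NavierStokesRegularity.Theorems.LerayQuarterDissipationFiniteDissipationLiouvilleLocalBalanceFarPast
import Summits.NavierStokesRegularity.NavierStokesRegularity.Theorems.LerayQuarterDissipationFiniteDissipationLiouvilleCriticalProductionLawFarPast
import Summits.NavierStokesRegularity.NavierStokesRegularity.Theorems.LerayQuarterDissipationFiniteDissipationLiouvilleWindowRecurrenceProduction
import Summits.NavierStokesRegularity.NavierStokesRegularity.Theorems.LerayQuarterDissipationFiniteDissipationLiouvilleWindowCollar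
import Summits.NavierStokesRegularity.NavierStokesRegularity.Theorems.LerayQuarterDissipationFiniteDissipationLiouvilleWindowGradientCore
import Summits.NavierStokesRegularity.NavierStokesRegularity.Theorems.LerayQuarterDissipationFiniteDissipationLiouvilleWindowFastBlob
import Summits.NavierStokesRegularity.NavierStokesRegularity.Theorems.LerayQuarterDissipationFiniteDissipationLiouvilleWindowStratum
import Summits.NavierStokesRegularity.NavierStokesRegularity.Theorems.LerayQuarterDissipationFiniteDissipationLiouvilleWindowBlobProduction
import Summits.NavierStokesRegularity.NavierStokesRegularity.Theorems.LerayQuarterDissipationFiniteDissipationLiouvilleWindowStretchingMargin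
import Summits.NavierStokesRegularity.NavierStokesRegularity.Theorems.LerayQuarterDissipationFiniteDissipationLiouvilleCaloricDefectWindows
import Summits.NavierStokesRegularity.NavierStokesRegularity.Theorems.LerayQuarterDissipationFiniteDissipationLiouvilleVorticityGradientFloor
import Summits.NavierStokesRegularity.NavierStokesRegularity.Theorems.LerayQuarterDissipationFiniteDissipationLiouvilleDenseFloors
import Summits.NavierStokesRegularity.NavierStokesRegularity.Theorems.LerayQuarterDissipationFiniteDissipationLiouvilleFrozenDefect
import HarnessLib.Audit

/-!
# Birth skeleton (BC3, reshaped by the lead prover, v20) of the crux `FiniteDissipationLiouville`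
# (route LerayQuarterDissipation, crux #2, rank 2; item `stmt-NavierStokesRegularity-22144`)

Tree path `Cruxes/FiniteDissipationLiouville/Lines/birth.lean`. v48 (lead g20, 2026-08-29): + clauses (v68)/(v69) THE
CALORIC DEFECT OF THE VORTICITY (`…CaloricDefect`, `…CaloricDefectWindows`): the curl of the Lamb vector
`(W·∇)ω − (ω·∇)W = −(∂ₜ − Δ)ω` of the critical element — jointly real-analytic, and a member on which it vanishes
on any open space–time set is zero (the tree's generalised-Beltrami rigidity `…LocalLambTubeDoor…eq_zero_of_convect_comm`
+ Lemarié-Rieusset analyticity) — exceeds `δ/t²` on a parabolic cylinder of relative size `ρ` in EVERY window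
(blob socket) and somewhere in EVERY parabolic cylinder `(−c²−(rc)², −c²) × B(x₀, rc)`, `‖x₀‖ ≤ ρc`, of the core
at every scale (dense floor, direct compactness); + clauses (v70)/(v71) THE VORTICITY-GRADIENT FLOOR
(`…VorticityGradientFloor`): a locally constant vorticity slice forces `W ≡ 0` (tree `…VorticityTranslate`, one
slice), hence `(−t)^{3/2}‖∇ω‖ > δ` somewhere in EVERY parabolic ball of the core at EVERY instant, and on a whole
cylinder of relative size `ρ` in every window; + clauses (v72)/(v73) the DENSE EVERY-INSTANT vorticity and
planarity floors (`…DenseFloors`: irrotational / flat open patch of one slice ⇒ `W ≡ 0`): `(−t)‖ω‖ > δ` and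
`(−t)‖∂ₑW‖ > δ` for every unit `e` somewhere in EVERY sub-ball `B(x₀, r√(−t))`, `‖x₀‖ ≤ ρ√(−t)`, at every instant
(g8/g9's floors were on the balls centred on the axis only); + clause (v74) THE FROZEN-LAW DEFECT (`…FrozenDefect`:
locally harmonic vorticity slice ⇒ `W ≡ 0`, tree `…VorticityTranslate`; tool: ALL spatial derivatives of the slices
converge along KNSS sequences): `t²‖Δω‖ > δ` somewhere in every sub-ball of the core at every instant — with (v69)
neither half of the vorticity equation `(∂ₜ + W·∇ − ω·∇)ω = Δω` vanishes locally anywhere. v47 (lead g19): + (v67) the stretching excess BY A FACTOR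
`1+δ` on a cylinder in every window (`…WindowStretchingMargin`). v46 (lead g19, 2026-08-29): + clauses (v64)–(v66)
BLOBS for the 2-jet read-outs (`…CompactnessJets` uniform 2-jet convergence ⇒ `…WindowBlobSocket` ⇒
`…WindowBlobJets/…WindowBlobProduction`): the Lamb-form excess by a factor `1+δ`, the stretching excess and
the super-caloricity with an extra palinstrophy credit `1+δ` each hold on a whole parabolic cylinder of
relative size `ρ` inside every window. v45 (lead g19, 2026-08-29T14:45Z):
+ clauses (v61)/(v62) temporal densities of the stretching excess and of the super-caloricity of `t²|ω|²`
(`…WindowGradientCore`: gradient core + Cavalieri), (v63) a FAST BLOB — a parabolic cylinder of relative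
size `ρ` with speed `> 1+δ` — inside every window (`…WindowFastBlob`: uniform convergence of values gives
interior, not only volume). Side results of the generation not entering the stub (they concern other
frames): threshold one recurs on the WHOLE STRATUM `𝒟_{C,K}` without envelope (`…WindowStratum`, modulo
g14's threshold one) and THE BARE BORDERLINE `a = 1` OF THE CRITICAL-PRODUCTION ROW ⟺ NO CONSTANT-MODULUS
VORTICITY PROFILE in the KNSS class (`…CriticalProductionBorderline(Iff)`: hot spot + strong maximum
principle + time analyticity). v44 (lead g19, 2026-08-29T14:10Z):
+ RECURRENCE AND VOLUME OF THE EXCESS (`…WindowSocket/…WindowSocketCollar/…WindowRecurrence/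
…WindowRecurrenceStretching/…WindowRecurrenceProduction/…WindowVolumeScaling/…WindowFastTimes/
…WindowCollar`): one more compactness step on g18's apex criteria — clauses (v52)/(v53) g18's
super-caloricity of `t²|ω|²` accumulating at the apex / receding to `−∞` (`…CriticalProductionLawApex/
FarPast`, accepted after g18's close); (v54)–(v57) the super-self-similar speed, the Lamb-form and
stretching-form production excesses and the super-caloricity recur WITH BOUNDED GAPS — one
`ε ∈ (0,1)` such that EVERY window `[−c², −εc²]`, `c > 0`, contains a violation point; (v58) the
fast set `√(−t)|W| > 1` lies in the self-similar core `‖x‖ < (max C A − 1)√(−t)` and has space–time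
volume `≥ η c⁵` in every window; (v59) the instants carrying a fast point have Lebesgue measure
`≥ κ c²` in every window (Cavalieri); (v60) speed `> 1 + δ` on volume `≥ η c⁵` in every window
(collared socket). The stub is unchanged in content (these are hypotheses on the hypothetical
critical element, each DISCHARGED in `FiniteDissipationLiouville_of`); `maxHeartbeats` raised for
the two long signatures only. v43 (lead g18, 2026-08-29T10:30Z):
+ THE LOCAL ENSTROPHY-BALANCE THRESHOLDS ARE NOT ATTAINED, BY A DEFINITE AMOUNT (`…LocalBalance/
…LocalBalanceStretchingTools/…LocalBalanceStretching/…LocalBalanceCore`, law-free): the MAXIMAL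
hypotheses of the enstrophy-budget family — pointwise nonnegativity of the balance density in Lamb form
`‖curl Ω‖² + ¼‖Ω‖² − ⟪U, Ω×curl Ω⟫` (g17's budget) and in stretching form `|∇Ω|²_F + ¼‖Ω‖² − ⟪Ω, ∇U Ω⟫`
(pub-ns-dss's identity) — each force `V ≡ 0` on the enveloped class (endpoint scheme + analytic
rigidity; far-field smallness of `‖U‖` resp. of `‖∇U‖ ≤ K₁(1+‖y‖)⁻²`), with collars `1+ε(C)`; and the
tree's closed Hardy-weighted stretching row T38 gains the collar `¼+ε(C)`. New clauses: (v45) a point of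
Lamb-form local production EXCESS by `1+ε` which is FAST (`√(−t)‖W‖ > 1+ε`) and CENTRAL
(`(1+ε)(‖x‖+√(−t)) < (max C A)√(−t)`); (v46) a point where vortex stretching beats local dissipation +
scaling by `1+ε`; (v47) a point where the Hardy-weighted stretching exceeds `(¼+ε)‖ω‖²`.
+ THE EXTREMAL SLICE (`…MicroscaleWindowExtremal`, p711773): the hull of the critical element contains a
singular member of the same class whose dimensionless enstrophy is globally MAXIMAL at `t = −1`, where the
Taylor-microscale window holds EXACTLY — clause (v48) deferred (the check farm has no olean for that
module yet); (v49) a RECURRENT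
EXPLICIT PALINSTROPHY FLOOR (`…MicroscaleWindowPalinstrophy`): in every log-time window an instant with
`√D ≥ ½C√Z − √(¼(C²−1)Z + ‖curlCLM‖²max K_c 0/(2L))` and the every-instant enstrophy floor — positive for
long windows: Leray's `Ḣ²`-rate in ancient, scale-invariant, recurrent, explicit form.
+ THE APEX AND FAR-PAST SCHEMES (`…EndpointSchemeApex/…LocalBalanceApex`, `…EndpointSchemeFarPast/
…LocalBalanceFarPast`): the Lamb-form local balance (hence the product bound, cross-flow `≤ 1`, speed
`≤ 1`) on a FINAL interval `[τ,0)` already forbids the apex singularity (zoom-in), and on a PAST half-line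
`(−∞,τ]` already forces `V ≡ 0` (zoom-out + forward uniqueness). New clauses: (v50) for every `τ < 0` a
Lamb-form excess point with `t ∈ [τ, 0)` (excess ACCUMULATES at the apex); (v51) for every `τ < 0` a point
with `t ≤ τ` and `√(−t)‖W‖ > 1` (the super-self-similar speed RECEDES to `−∞`).
v42 (lead g18, 2026-08-29T09:10Z):
+ THE PRODUCT THRESHOLD ONE IS NOT ATTAINED, BY A DEFINITE AMOUNT (`…LambProductRigidity/
…EndpointScheme/…EndpointSchemeSlack/…LambProductThreshold/…LambProductCollar`, law-free): the tree's
PRODUCT row T49′ (`⟪U, Ω × curl Ω⟫ ≤ θ‖Ω‖‖curl Ω‖`, `θ < 1 ⇒ V ≡ 0`, pub-ns-dss), which contains the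
Λ-directional row, the cross-flow row (v41) AND the time-constant row (`C ≤ θ`), is extended to its
endpoint `θ = 1` for EVERY KNSS-gauge Type-I field with a Type-I envelope, by g17's zoom-out argument
ABSTRACTED into the «antitone-enstrophy endpoint scheme» (rescaling-invariant + KNSS-closed hypothesis
with pointwise nonnegative slack `σ = (‖curl Ω‖ − ½‖Ω‖)² + (‖Ω‖‖curl Ω‖ − ⟪U, Ω × curl Ω⟫)` and a slice
rigidity ⇒ Liouville); the rigidity is now BY ANALYTICITY (in the equality case the vorticity vanishes
wherever `‖U‖ < 1`, i.e. outside the envelope's core, hence identically by the identity theorem for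
the real-analytic slice); the hypothesis is KNSS-closed because SECOND vorticity derivatives converge
at every `t < 0` along KNSS limits (g14's slice lemma transported by rescaling). Corollaries: the
Λ-directional threshold one is not attained; LAW-FREE THRESHOLD ONE on the enveloped class (`C ≤ 1` +
any envelope ⇒ `V ≡ 0`); and by a compactness COLLAR LEMMA for closed rows (one law `K(C)` for the
enveloped class ⇒ persistence) the product / Λ / cross-flow (g17's open collar) / time-constant rows
are exceeded by `ε(C) > 0` and the space-constant row (`‖x‖‖V‖ ≤ ½`, Hardy) by `ε'(C)`. New clauses:
(v42) `(1+ε)‖ω‖‖curl ω‖ < √(−t)⟪W, ω × curl ω⟫` somewhere (`…LambProduct.lambProduct_exceeds_gap_of_singular`),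
(v43) `½ + ε' < ‖x‖‖W(t,x)‖` somewhere (`…LambProduct.spaceConstant_exceeds_gap_of_singular`).
+ THE TAYLOR-MICROSCALE WINDOW (`…MicroscaleWindow/…MicroscaleWindowEnvelope`): a LENGTH-SCALE clause —
the global budget priced by the Type-I constant alone reads `Z' ≤ ½(C²−1)Z − 2(√D − ½C√Z)²`
(`Z = ∫‖Ω‖²`, `D = ∫‖curl Ω‖²`, `D/Z = (−t)/λ(t)²`, `λ = ‖ω‖₂/‖∇ω‖₂` the vorticity Taylor microscale),
so at every non-decreasing instant of the dimensionless enstrophy `(4D+Z)² ≤ 16C²ZD`, i.e.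
`2(C−√(C²−1))√(−t) ≤ λ(t) ≤ 2(C+√(C²−1))√(−t)`; new clause (v44): in EVERY similarity-time window of
length `L` some instant has `2(√D − ½C√Z)² ≤ ½(C²−1)Z + ‖curlCLM‖²·max K_c 0/L` (mean value theorem
+ the law's ceiling), discharged by `…MicroscaleWindow.exists_near_window_of_law`.
v41 (lead g17, 2026-08-29T09:30Z):
+ THE CROSS-FLOW THRESHOLD ONE IS NOT ATTAINED (`…CrossFlowRigidity/…CrossFlowDss/…CrossFlowScaling/
…CrossFlowThreshold`, law-free): the tree's cross-flow row (`√(−t)‖ω × u‖ ≤ θ‖ω‖`, `θ < 1 ⇒ V ≡ 0`,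
pub-ns-dss) is extended to its endpoint `θ = 1` for EVERY KNSS-gauge Type-I field with a Type-I
envelope: at the threshold the similarity-enstrophy budget is the slack
`σ = ‖curl Ω − ½U×Ω‖² + ¼(‖Ω‖² − ‖U×Ω‖²) ≥ 0`, so `Z` is antitone; the zoom-out KNSS limit carries the
supremal, hence constant, enstrophy, so its slack vanishes identically — the «half-Beltrami» system
`curl Ω = ½U×Ω`, `‖U×Ω‖ = ‖Ω‖`, whose enveloped solutions have compactly supported, hence (cutoff
curl-integration by parts) zero, vorticity; the limit vanishes, the supremum is `0`, `V ≡ 0`. New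
clause (v41): the critical element has, somewhere, velocity across the vorticity STRICTLY FASTER than
the self-similar speed, `‖curl W(t,x)‖ < √(−t)‖curl W(t,x) × W(t,x)‖`, discharged by
`…CrossFlow.crossFlow_exceeds_of_singular` (constants equalised to `max C A`).
v40 (lead g17, 2026-08-29T07:50Z):
+ TRAPPING INSIDE THE LENS (`…TrappingMixedSlice/…TrappingMixed/…EveryInstantMixed/…EveryInstantWall`):
the slice-wise budget priced by the MIXED bound is trapped in the lens-shaped region, so the
every-instant floor takes the shape of the lens: a singular member has, at every instant and for all
admissible weights, `λC²/μ + (1−λ)κ³·max(K_S⁶(√(−t)∫‖ω‖²)², 1) ≥ 1`; in particular for `C ≤ 1` the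
dimensionless enstrophy is `≥ 2K_S⁻³` (`K_S⁶Z² ≥ 4`) at EVERY instant (pure floor: `64/27`);
law-free / DSS-wall forms: Bradshaw–Tsai OP 5.1 holds for every Type-I DSS profile (any factor) whose
dimensionless enstrophy dips below the threshold at one instant of its period. New clause (v40) the
lens-shaped every-instant floor, discharged by `…EveryInstantMixed.vorticity_lens_floor_of_singular`.
v39 (lead g17, 2026-08-29T07:00Z):
+ FORWARD TRAPPING AND THE EVERY-INSTANT ENSTROPHY FLOOR (`…TrappingTools/…Trapping/…EveryInstant`,
a NEW MECHANISM for the line — forward invariance instead of backward rigidity): pricing each slice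
by its OWN dissipation makes the Ladyzhenskaya budget self-improving (`Z' ≤ −½Z + (27/128)K_S⁶Z³`
formally, `Z(s) = ∫‖Ω(s)‖² = √(−t)∫‖ω(t)‖²dx`), so the sub-threshold region `{K_S⁶Z² < 64/27}` (the
all-time rung's number) is forward invariant with exponential decay (`…Trapping.trapping_exp`; the
scaling term is the damping that Poincaré supplies on bounded domains, Robinson–Rodrigo–Sadowski
Thm 6.12); with ns-lqd-p1's orbit-limit/persistence leaf and g14's explicit rung, ONE sub-threshold
instant forces regularity (`…EveryInstant.not_singular_of_subthreshold_instant`). New clause (v39)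
the every-instant floor `∀ t < 0, 64/27 ≤ (√(√(−t)∫‖curl W(t)‖²)·(√K_S)³)⁴`, discharged by
`…EveryInstant.vorticity_floor_of_singular` — the dimensionless enstrophy of the critical element
never dips below the explicit threshold, not even momentarily.
v38 (lead g17, 2026-08-29T06:40Z):
+ THE MIXED `(C, K)` LENS (`…MixedRegion/…MixedRegionExplicit`): the two stretching pricings behind
the explicit strips `{C < 1}` (T31⁗, quadratic Young weight) and `{θ(K)⁴ < 64/27}` (g14,
Ladyzhenskaya, QUARTIC Young weight) are homogeneous of different degrees in their weights, so a
convex combination with separately optimised weights beats the union: a member of `𝒟_{C,K}` with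
`2λμ + (1−λ)·3(1+δ)/(2κ) ≤ 2` and `λC²/μ + (1−λ)κ³θ(K)⁴ < 1` for some `0 ≤ λ ≤ 1`, `μ, κ, δ > 0`
VANISHES (`…MixedRegion.eq_zero_of_mixed`); numerically an explicit LENS `1 ≤ C < 2/√3`,
`64/27 ≤ θ⁴ < 4` of the crux's own parameter plane — the FIRST EXPLICIT piece of the proved region
with `C > 1` (closed form `C ≤ 1 ∧ θ⁴ < 4 ⇒ V ≡ 0`: at threshold one the dissipation threshold is
`4`, not `64/27`; sample points `C ≤ 21/20 ∧ θ⁴ ≤ 5/2`, `C ≤ 11/10 ∧ θ⁴ ≤ 12/5`). New clause (v38)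
the mixed-lens floor — for all admissible weights `1 ≤ λC²/μ + (1−λ)κ³θ(K_c)⁴` — discharged by
`…MixedRegion.mixed_ge_one_of_singular`.
v37 (lead g16, 2026-08-29T05:10Z):
+ INTERMITTENCY-TOLERANT THRESHOLDS (`…Averaged/…AveragedRungs/…AveragedVelocity/…AveragedPhysical/
…AveragedPeriodic/…AveragedWall`): the backward ODE bound behind every rung needs only the
exponentially weighted backward AVERAGE of the stretching coefficient, so all explicit rungs hold
with the supremum over time replaced by the parabolic backward average (weight `e^{−(s−σ)/2}dσ` =
physical `√(−t)(−τ)^{−3/2}dτ`): THRESHOLD ONE ON AVERAGE (`‖U(σ,·)‖_∞ ≤ γ(σ)`,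
`∫_a^s e^{−(s−σ)/2}γ² ≤ Γ₂ < 2 ⇒ V ≡ 0`; physical-time and law-free forms), the averaged `C_ω`,
`V₃`, `V₆` rungs, and PERIOD-MEAN forms for periodic (DSS, `T = 2 log λ`) majorants (period mean
square of the Type-I amplitude `< (1 − λ⁻¹)/log λ` kills a `λ`-DSS member). New clause (v37) the
averaged velocity floor — every continuous majorant of the similarity velocity of the critical
element has backward mean square `≥ 2·(threshold)` somewhere — discharged by the contrapositive of
`…Averaged.not_singular_of_velocity_avg_lt`.
v36 (lead g16, 2026-08-29T04:10Z):
+ THE `L⁶`-VELOCITY THRESHOLD (`…VelocityLSixTools/…Stretching/…VelocityLSix`): a fifth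
scale-invariant parameter, the `L⁶`-velocity constant `V₆ = sup (−t)^{1/4}‖V(t)‖_{L⁶}` (similarity
variables `sup_s‖U(s)‖₆`). Explicit rung `KS²V₆⁴ < 64/27 ⇒ V ≡ 0` (the stretching term priced
`L⁶ × L³ × L²` after moving the derivative onto `Ω`: Cauchy–Schwarz, Hölder `(3,3/2)`, the `L³`
Gagliardo–Nirenberg inequality on `φ_RΩ`, quartic Young cancelling the dissipation exactly — lead
g14's sharper Ladyzhenskaya chain with `√K·KS` replaced by `‖U‖₆`); STRUCTURAL: by Sobolev
`KS²V₆⁴ ≤ KS⁶K² = θ(K)⁴`, so the small-dissipation rung is the Sobolev shadow of this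
velocity-integrability rung (made formal in `…VelocityLSixSobolev` via the new Literature lemma
`Literature.Analysis.FluidPDE.eLpNorm_six_le_eLpNorm_fderiv_two_of_eLpNorm_six_lt_top`, GNS for
`L⁶` fields); intermittency-tolerant (time-averaged) forms of the `L³`, `C_ω` and `L⁶` rungs in
`…Averaged/…AveragedRungs`. New clause (v36) the `L⁶`-velocity floor
`sup_t (−t)^{1/4}‖u(t)‖₆ ≥ (64/27)^{1/4}/√KS`, discharged by `…VelocityLSix.velocityLSix_exceeds_of_singular`.
v35 (lead g16, 2026-08-29T03:40Z):
+ THE `L³`-VORTICITY THRESHOLD AND THE `(K, C_ω)` HYPERBOLA (`…VorticityLThreeTools/…Stretching/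
…VorticityLThree/…Wall`): a fourth scale-invariant parameter of the stratum, the `L³`-vorticity
constant `V₃ = sup √(−t)‖curl V(t)‖_{L³}` (similarity variables `sup_s‖Ω(s)‖₃`; the Hölder pairing
`(3,6)` of the stretching density, between Ladyzhenskaya's `(4,4)` = `K` and `(∞,2)` = `C_ω`).
Explicit rung: `KS²V₃² < 3 ⇒ V ≡ 0` (`KS` = Mathlib's Gagliardo–Nirenberg–Sobolev constant; the
stretching term priced `L²×L³×L⁶` — trace-free kinematics, Cauchy–Schwarz, `∫|S|²_F = ½Z_∞`,
Hölder `(3/2,3)`, whole-space Sobolev on `φ_RΩ`, the dissipation consumed EXACTLY — then the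
sup-iteration with ratio `2KS²V₃²/(3+KS²V₃²)`); by the interpolation `‖Ω‖₃³ ≤ ‖Ω‖_∞‖Ω‖₂²` it
contains THE HYPERBOLA `KS⁶(C_ω‖curlCLM‖²K)² < 27 ⇒ V ≡ 0`, a region of the `(K, C_ω)` plane inside
neither strip `{θ(K)⁴ < 64/27}`, `{C_ω < √3/4}`; law-free: enveloped Type-I ancient fields with
`KS²V₃² < 3` vanish (Bradshaw–Tsai OP 5.1 on that sub-class, every factor). New clauses (v35a) the
`L³`-vorticity floor `sup_t √(−t)‖ω(t)‖₃ ≥ √3/KS` and (v35b) the hyperbola floor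
`KS⁶(C_ω‖curlCLM‖²max K_c 0)² ≥ 27` for every vorticity bound `C_ω`, discharged by
`…VorticityLThree.vorticityLThree_exceeds_of_singular` / `…vorticity_mul_dissipation_ge_of_singular`.
v34 (lead g15, 2026-08-29T01:30Z):
+ THE VORTICITY-AMPLITUDE THRESHOLD (`…VorticityAmplitudeTools/…Stretching/…VorticityAmplitude/…Slack/
…Threshold/…Windows/…JointBudget/…Joint`): a third scale-invariant parameter of the stratum, the
vorticity amplitude `C_ω = sup (−t)‖curl V‖`. Explicit rung: `C_ω < √3/4 ⇒ V ≡ 0` (enstrophy budget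
with the stretching priced by `sup‖Ω‖` through the trace-free inequality `3⟪DUΩ,Ω⟫² ≤
(2|DU|²_F − ‖curl U‖²)‖Ω‖⁴` and the whole-space `div`–`curl` identity for the `L⁶` slices of `𝒟`,
closed by a sup-iteration); the threshold is NOT attained (`C_ω ≤ √3/4` excluded on singular
members: the dissipation is the slack; singular KNSS limit with constant, hence zero, vorticity
slice) and is exceeded by `ε(C,K)` (compactness), in every long log-window; JOINT region
`λ²C² + (1−λ)(4/√3)C_ω < 1 ⇒ V ≡ 0` (corner: `C ≤ 1`, `C_ω < √3/2 ⇒ V ≡ 0`). New clauses (v34a) the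
window floor `√3/4 + ε(C,K_c)` and (v34b) the joint floor, discharged by
`…VorticityAmplitude.vorticity_exceeds_windows_of_singular` / `…vorticity_exceeds_joint_of_singular`.
v33 (lead g14, 2026-08-29T00:30Z):
+ THE DISSIPATION THRESHOLD (`…ThresholdKStretching/…KBudget/…KSlack/…KDefect/…KLimit/…ThresholdK`,
the `K`-direction analogue of THRESHOLD ONE): the explicit rung `θ(K)⁴ < 64/27` is NOT attained — no
singular member of the stratum has `θ(K_c)⁴ ≤ 64/27` (Hölder-defect slack of the weighted budget at
the threshold; KNSS limit in the equality case of Hölder has two-valued vorticity modulus, hence zero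
vorticity; curl-free Liouville + envelope) — and by compactness in `K` the crux HOLDS for
`θ(K)⁴ ≤ 64/27 + ε'(C)`; new clause `64/27 + ε'(C) < θ(K_c)⁴`, discharged by
`…ThresholdK.exists_dissipation_gap`. v32 (lead g14, 2026-08-28T23:30Z):
+ SHARPER EXPLICIT SMALL-DISSIPATION RUNG (`…SmallDissipationGapSharperStretching/…SharperBudget/
…Sharper`): the Ladyzhenskaya pricing of the stretching term with optimal Young and product-rule
weights cancels the dissipation exactly and kills every member of `𝒟_{C,K}` with
`(√(max K 0)·(√K_S)³)⁴ < 64/27` (any `C`; was `≤ 2/3`, admissible `K` larger by `2√3`) — new clause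
`64/27 ≤ (√(max K_c 0)·(√K_S)³)⁴`, discharged by `…SmallDissipationGap.not_singular_of_small_dissipation_sharper`.
v31 (lead g14, 2026-08-28T23:10Z):
+ STRETCHING SATURATION (`…ThresholdSaturation`, the general-`C` form of the threshold chain): some
singular member of `𝒟_{C,K_c}`, a pointwise limit of rescalings of the critical element, is a
near-extremal of the stretching step with defect `2∫φ_R(C−‖U‖)‖DΩ Ω‖ ≤ ½(C²−1)⁺‖curlCLM‖²K_c` for every
`R` (new clause, discharged by `…ThresholdOne.exists_singular_limit_slack_le`); and the DSS wall on
`𝒟` below the gap, any factor (`…ThresholdOneDss`, no clause). v30 (lead g14, 2026-08-28T22:20Z):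
+ THRESHOLD ONE (`…ThresholdBudget`, `…ThresholdVortexLines`, `…ThresholdSecondDerivatives`,
`…ThresholdLimit`, `…ThresholdOne`, lead g14) — THE CRUX IS PROVED IN A NEW REGION OF ITS PARAMETER
PLANE: no singular member of the finite-dissipation stratum has Type-I constant `C ≤ 1` (the law-free
threshold `C < 1` of T31⁗ is not attained: keeping the SLACK `2∫φ(1−‖U‖)‖DΩ Ω‖` of the stretching step
of the similarity enstrophy budget, at `C = 1` the budget reads `Z_R' ≤ η/R − slack`, so the slack is
somewhere small; rescaling + KNSS compactness + vorticity-gradient convergence give a SINGULAR limit in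
the equality case `(1−‖U‖)‖DΩ Ω‖ ≡ 0`; then either `‖U‖ ≡ 1` (analyticity; contradicts the envelope)
or `DΩ Ω ≡ 0` (a decaying field constant along itself vanishes; curl-free Liouville; zero slice ⇒
not singular)); by compactness the Type-I constant of every singular member of `𝒟_{C,K}` exceeds
`1 + ε(K)`, i.e. `FiniteDissipationLiouville` HOLDS for `C ≤ 1 + ε(K)` — new clause `1 + ε(K_c) < C`,
discharged by `…ThresholdOne.exists_typeI_gap`. v29 (lead g14, 2026-08-28T22:10Z):
+ MEAN FLICKER (`…CalmSliceMean`): ONE parabolic sub-ball calm ON AVERAGE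
(`∫_{B(x₀,r√(−t))}‖∂ₛU‖ ≤ δ(√(−t))³`) at one instant already forces regularity, so the critical
element's flicker carries definite `L¹`-mass `> δ(C,K_c,ρ,r)(√(−t))³` in every sub-ball at every
instant (new clause, discharged by `…CalmSliceLocal.meanFlicker_floor_of_singular`); and the
FLICKER ENVELOPE (`…FlickerEnvelope`): `‖∂ₛU‖ ≤ c√(−t)/(‖x‖+√(−t))` from the envelope + package —
the flicker is confined to the parabolic core (new clause, discharged by
`…CalmSliceLocal.flickerEnvelope_of_minimal`). v28 (lead g14, 2026-08-28T21:30Z):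
+ DENSE FLICKER (`…CalmSliceLocal`, `…CalmSliceLocalLeaf`, lead g14): the unsteadiness field of a
slice is REAL-ANALYTIC in space (slice of g13's analytic scaling generator), so weak steadiness on
ONE ball — or curl-free / pointwise steadiness on ONE non-empty open set — of ONE slice already
kills a member of `𝒟` on the whole past (local de Rham + identity theorem + Leray's profile system
+ Tsai + forward uniqueness + g13's open-set generator Liouville); by KNSS compactness across
members ONE calm parabolic sub-ball `B(x₀, r√(−t))`, `‖x₀‖ ≤ ρ√(−t)`, with unsteadiness
`≤ δ(C,K_c,ρ,r)` at ONE instant forces regularity; the critical element therefore flickers in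
EVERY parabolic sub-ball of the similarity region at EVERY instant (new clause, discharged by
`…CalmSliceLocal.localFlicker_floor_of_singular`; the tree's K1 `calmSlice_leaf` had the ball
`B(0, R(C,K)√(−t))` chosen by the theorem, Pineau–Vicol the unit ball); and the same AT THE
VORTICITY LEVEL (`…CalmVorticity`, `…CalmVorticityIdentity`): `curl` of the unsteadiness
(`= ∂ₛΩ = (−t)((−t)∂ₜω − ω − ½(x·∇)ω)`, `ω = curl W`) vanishing on one open set
of one slice kills, one vorticity-calm sub-ball forces regularity, so the critical element's
VORTICITY flickers in every parabolic sub-ball at every instant (second new clause, discharged by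
`…CalmSliceLocal.vorticityFlicker_floor_of_singular'`). v27 (lead g13, 2026-08-28T20:20Z):
+ RETURN TIMES OF THE SCALING ORBIT (`…ReturnTimes`, `…ReturnTimesSharp`, `…LocalSelfSimilarity`,
lead g13): discrete self-similarity is a UNIQUE-CONTINUATION property of the class (local `μ`-DSS
near one point of the open past ⇒ past-`μ`-DSS, by joint real-analyticity), so ONE `δ`-close
return of the scaling orbit at any factor `μ ∈ [μ₁, μ₂] ⊂ (1, λ₀(C,K_c))` observed on ONE window
forces regularity (KNSS compactness + the uniform exact-DSS threshold); the critical element —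
which IS uniformly recurrent — therefore (a) never returns `δ(C,K_c,μ₁,μ₂,R)`-close to itself at a
short lag on any window and (b) has scaling displacement `> κ(C,K_c,μ₂,R) · log μ` on the window
`[−(μ₂R)², −(μ₂R)⁻²] × B̄(0, μ₂R)` for every `1 < μ ≤ μ₂` (the displacement grows at least
linearly in the lag: the integrated, every-window form of the Pineau–Vicol floor); both clauses are
discharged by `…ReturnTimes.returnTime_floor_of_singular` / `…displacement_floor_of_singular`.
Law-free companion (not a clause): the scaling generator of a nonzero class member vanishes on no
open subset of the past (`…eq_zero_of_scalingGenerator_eq_zero_nhds`). v26 (lead g12, 2026-08-28T19:40Z):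
+ THE LAW IS ATTAINED (extremal critical element, `…Extremal.exists_extremal_of_minimal`, repairing
CENSUS-g7's dead-end): some scaling limit of the critical element in `𝒟_{C,K_c}` — again SINGULAR,
UNIFORMLY RECURRENT, with the gradient envelope — SATURATES Leray's law exactly at `t = −1`,
`∫‖∇W'(−1)‖² = K_c`, i.e. `t ↦ √(−t)∫‖∇W'(t)‖²` attains its supremum (the gradient envelope is
scale invariant and closed under KNSS limits, so it is uniform along one hull; dominated
convergence). v25 (lead g12, 2026-08-28T19:20Z): the
quasi-regularity clause is now stated in the BLOW-UP direction (step `½`: Cesàro means along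
`W_{2^{−k}}`, i.e. along the times `t_k = −4^{−k} t`), and + MEAN CORE ENERGY: for every similarity
radius `r > 0` the scaled core energies `(−t_k)^{−1/2}∫_{B(0,r√(−t_k))}‖W(t_k)‖²` along
`t_k = −4^{−k}` have a Cesàro MEAN `ℓ_r ≥ δ(C,K_c,r) > 0` (`…ErgodicHullObservables`: the
slice-ball energy is a tame observable; lead g9's every-instant floor); the flow form
(continuous-time means, `…ErgodicHullFlow.exists_quasiRegular_flow`, p658715) and Oxtoby's
quasi-regular points (`Literature.Dynamics.Ergodic.QuasiRegularPoints`, p658153) are landed but not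
used by the composition. v24 (lead g12, 2026-08-28T18:40Z):
+ QUASI-REGULARITY (invariant measures on the scaling hull — the third classical dynamical tool
after the Lyapunov and closing reductions: Kryloff–Bogoliouboff + Birkhoff's pointwise ergodic
theorem on the compact minimal hull, `…ErgodicHull.exists_quasiRegular`, lead g12) — the critical
element may be taken GENERIC for a scaling-stationary law on critical elements: every observable
of fields continuous along `𝒟_{C,K_c}` for uniform convergence on the slab pieces is bounded on
its scaling orbit and has CONVERGENT Cesàro means along `W_{2^k}`; hence every `source = flux`
identity along scaling orbits holds on average with zero flux on the wandering stratum exactly as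
over a DSS period (`…ErgodicHullPortrait.tendsto_cesaro_flux`); packaged for the composition as
`…ErgodicHullPortrait.exists_quasiRegular_criticalElement`; bookkeeping
`…finiteDissipationLiouville_iff_no_quasiRegular`. v23 (lead g11, 2026-08-28T18:40Z):
+ CATEGORY AND MINIMALITY ON THE SCALING HULL (Baire + Birkhoff, a clause of a new kind —
category instead of compactness) — unless the critical element is past-DSS (then with least factor
`λ_* ≥ λ₀(C,K_c)`, v11/v12, inside the catalogued wall), for EVERY sequence of fields `V i`
continuous on the open past some scaling limit of it — again a CRITICAL ELEMENT of `𝒟_{C,K_c}`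
(SINGULAR at the origin and UNIFORMLY RECURRENT with the same window clause) — agrees on the past
with no rescaling of any `V i`: the scaling hull of a wandering critical element is a compact
minimal set of critical elements not covered by countably many scaling orbits, so the residue of
the crux beyond the wall is EMPTY OR UNCOUNTABLE modulo scaling — no isolated counterexample
(`…HullCategoryCritical.exists_criticalElement_off_orbits`, lead g11; Baire core
`…HullCategoryTools.exists_lt_apply_eq_of_countable_cover`, main theorem
`…HullCategory.exists_orbitLimit_off_orbits`, minimality `…HullCategoryMinimal.recurrent_of_orbitLimit`;
conversely a past-DSS member's scaling orbit is closed, `…HullCategoryTools.orbitLimit_eq_rescaling_of_pastDss`,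
dichotomy `…HullCategoryPortrait.pastDss_iff_orbitLimits_rescalings`; v22 = the same clause without
the recurrence of the limit). v21 (lead g10, 2026-08-28T17:10Z):
+ THE POINT GROUP (crystallographic restriction) — at no instant is a slice of the critical element
symmetric on the similarity ball `B(0, R√(−t))` under a rotation by a small angle `0 < α ≤ α₀(C,K_c)`
about any apex axis, and every `O(3)`-symmetry `S` of a slice on that ball has finite order,
`S^k = 1` with `k ≤ N(C,K_c)` (`…PointGroup.smallRotation_defect_of_singular`,
`…PointGroup.isometrySymmetry_finiteOrder_of_singular`, lead g10, on top of `OneSymmetricSlice` 24452 and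
its cyclic form `OneSymmetricSlice.Quantised`). v20 (lead g9, 2026-08-28T15:15Z):
+ POINTWISE SATURATION of the final datum — `θ < ‖x‖‖u₀(x)‖ ≤ A` along sequences `x → 0` and
`‖x‖ → ∞` (`…FinalDatumSaturation`, lead g9: the weighted floors of lead g6 transferred to the
function `u₀`). v19 (lead g9):
+ NO EARLY ARRIVAL — the remainder energy FLOOR `δ² √(−t) < ∫ ‖W(t) − u₀‖²` at every instant
(`…EnergyReturn.remainderEnergy_floor`, lead g9: a member whose slice at ONE instant is
`δ(C,K_c)`-close to its final datum in the dual-`L²` sense is regular), so the singular part's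
energy is `≍ √(−t)` from both sides. v18 (lead g9):
+ NO VORTICITY CONCENTRATION AT THE SINGULAR POINT — the final datum `u₀` is weakly
divergence-free on `ℝ³` across the apex; `∇W(t) → Du₀` and `curl W(t) → ω₀ := curlCLM ∘ Du₀` in
`L¹(ℝ³)` at the rate `√(−t)`; `ω₀ ∈ L¹_loc` with `∫_{B(0,ρ)}‖ω₀‖ ≤ L_ω ρ` (Morrey scaling of
`‖x‖⁻²`, no atom); and the distributional vorticity of the trace IS `ω₀` for every test field
(`…FinalDatumVorticity`, `…FinalDatumVorticityMinimal`, lead g9). v17 (lead g9):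
+ the FINAL DATUM ACROSS THE APEX — the distributional trace of the element IS the profile `u₀`
for EVERY test field (`…EnergyTraceDatum.tendsto_pairing_of_energy`, from the finite-energy
remainder: strong `L²` convergence), and `u₀` obeys the TWO-SIDED apex energy law
`ε₀² ρ < ∫_{B(0,ρ)} ‖u₀‖² ≤ 3|B₁| A² ρ` at every scale (`…EnergyTrace.exists_trace_energy_epsilon_apex`:
one-scale Morrey-`L²` smallness of the final datum at the apex forces regularity;
`…EnergyTraceDatum.lintegral_ball_finalDatum_sq_floor / _le`). v16 (lead g9, 2026-08-28T15:00Z):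
+ the ENERGY PORTRAIT — (a) the TWO-SIDED CORE ENERGY LAW: for every similarity radius `r > 0`
constants `δ(C,K_c,r) > 0` and `Λ(K_c)` with `δ √(−t) < ∫_{B(0,r√(−t))} ‖W(t)‖² ≤ Λ r √(−t)` at
every instant (`…EnergyFloor.coreEnergy_floor_of_singular`, lead g9: ONE similarity ball with
kinetic energy `≤ δ √(−t)` at ONE instant forces regularity — the `L²` currency of the quiet-core
leaves; ceiling `…TraceMorrey.lintegral_ball_sq_le_unif`, lead g5); (b) the FINITE-ENERGY
REMAINDER: the singular part `W(t) − u₀` lies in `L²(ℝ³)` GLOBALLY with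
`∫ ‖W(t) − u₀‖² ≤ M √(−t)` (`…EnergyRemainder.exists_finalDatum_profile_energy`, lead g9; the
v12 final-datum existential now carries `M` and this clause). v15 (lead g8, 2026-08-28T13:40Z):
+ the LOCAL coherence floors — for EVERY similarity radius `r > 0` a tolerance `δ(C,K_c,r) > 0`
such that at every instant the similarity ball `B(0, r√(−t))` contains two `δ`-large-vorticity
points with vorticity directions `δ`-apart mod sign (`…directionOscillation_floor_local`, p633505),
for every unit `e` a point with `(−t)‖∂ₑW‖ > δ` (`…planarity_floor_local`, p633790), and two
`δ`-fast points with velocity directions `δ`-apart mod sign (`…unidirectionality_floor_local`,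
p634041) — alignment / planarity / unidirectionality on ANY open set at ONE instant kills a member
(space analyticity of the slices); + the finite-dissipation SIGN-BLIND form of Barker–Prange 2020
Thm 3 — no alignment on concentrating balls `B(0, a√(−tₙ))` along ANY sequence `tₙ → 0⁻`
(`…not_alignment_concentrating_of_singular`). v14 (lead g8, 2026-08-28T13:05Z):
+ the UNIDIRECTIONALITY FLOOR — at every instant two `δ`-fast points (`√(−t)‖W‖ > δ(C,K_c)`) of
`B(0, δ⁻¹√(−t))` whose VELOCITY directions are `δ`-apart modulo sign
(`…Unidirectional.unidirectionality_floor_of_singular`, p633061: a member whose velocity at ONE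
instant is everywhere parallel to one line — a parallel shear flow — vanishes, `div w = ∂ₑc = 0`
making the slice planar); + the PRINTED shape of Giga–Miura's hypothesis (D) excluded
(`…not_gigaMiuraAlignment_of_singular`, p632702). The LOCAL versions (tolerance `δ(C,K_c,r)` in
EVERY similarity ball `B(0, r√(−t))`, by the space analyticity of the slices:
`…VorticityAlignmentLocal` p633505, `…PlanarityLocal` p633790, `…UnidirectionalLocal` p634041) are
landed and enter the stub in v15.
v13 (lead g8, 2026-08-28T12:00Z):
+ the VORTICITY-DIRECTION clauses — every singular member of the stratum carries, at EVERY
instant, two points of the parabolic ball `B(0, δ⁻¹√(−t))` (`δ = δ(C,K_c) > 0`) with scaled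
vorticity `> δ` whose vorticity directions are `δ`-apart MODULO SIGN
(`…VorticityAlignment.directionOscillation_floor_of_singular`, p631120), and the sign-blind
continuous-alignment hypothesis of Giga–Miura 2011 (Thm 2.10) fails for it at every level and
modulus (`…VorticityAlignment.not_continuousAlignment_of_singular`); mechanism: a member of
`𝒟_{C,K}` with ONE slice whose vorticity is everywhere parallel to one line VANISHES
(`…VorticityAlignment.slice_eq_zero_of_curl_parallel`, p630496: `⟪w,e⟫` harmonic in `L⁶`, then
`∂ₑw = 0`, then `L⁶` kills translation-invariant slices) + KNSS compactness / persistence. So the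
Giga–Miura / Constantin–Fefferman direction-coherence regime joins the excluded regimes; + the PLANARITY
FLOOR — at every instant and in EVERY unit direction `e` the scaled directional derivative
`(−t)‖∂ₑW‖` exceeds `δ(C,K_c)` somewhere in `B(0, δ⁻¹√(−t))` (`…Planarity.planarity_floor_of_singular`:
a member with ONE two-dimensional slice vanishes; KNSS compactness; the two-dimensional Liouville
regime excluded quantitatively, uniformly in the direction). v12 (lead g7, 2026-08-28T11:00Z):
+ the FACTOR-STRUCTURE clause — every past-DSS factor `c ≠ 1` of the element, if any, is an
integer power of a LEAST factor `λ_* > 1` (`…DssFactors.exists_least_factor_of_pastDss`,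
p624423: the log-factors of a Type-I ancient mild field form a closed subgroup of `ℝ`, dense ⇒
scale invariant ⇒ zero), so with v11 the DSS sub-case concerns `λ_* ≥ λ₀(C,K_c)` and its powers
only; + the FINAL-DATUM PROFILE clause — off the apex the final datum is a `C¹` divergence-free
field `u₀` with `‖u₀‖ ≤ A/‖x‖`, `‖∇u₀‖ ≤ L₁/‖x‖²`, attained with gradients at the rate `(−t)`, and
equal to the distributional trace there (`…FinalDatumProfile`, p626816); and the LYAPUNOV
REDUCTION is on record (`…Lyapunov.fdl_of_lyapunov`, p625794 —
`fdl_iff_exists_lyapunov`: the stub below, equivalently the crux, holds iff every singular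
recurrent envelope class `𝒮(C,A,K)` admits a functional antitone along the scaling flow, lower
semicontinuous along recurrence sequences and rigid; none is known). v11 (lead g6): + the UNIFORM NEAR-ONE
DSS clause — the element is not `c`-DSS on the past for any `1 < c < λ₀(C,K_c)` (`…DssUniformThreshold`,
p621067). v10 (lead g6, 2026-08-28T09:10Z):
the one stub of v9 now also carries the FINAL-DATUM clauses landed this generation — the weighted
`‖x‖⁻¹` floors of the trace at the apex and at infinity (`…TraceWeighted`, p617206), the
ROTATIONAL trace in every open half-space and at the apex (`…TraceRotational`, p619382, via the
vorticity-level Escauriaza–Seregin–Šverák step `farField_curl_eq_zero_halfSpace_of_vorticity_top`,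
Literature p618070) and the weighted `‖x‖⁻²` floors of the trace's vorticity at the apex and at
infinity (`…TraceVorticityFloor`, p619772); all discharged in the composition, so the stub stays
equivalent to the crux. RESHAPED v9 by the lead prover g6 (2026-08-28T08:40Z): **ONE registered
open stub, in the ENVELOPE vocabulary.** Since v8 the kernel
holds `Theorems.FiniteDissipationLiouville.Envelope.finiteDissipationLiouville_iff_envelopeLiouville`
(p613275, seat ns-lqd-p2 g7): the crux IS the Liouville problem for Type-I ancient mild fields with
the space-time envelope `‖W(t,x)‖ ≤ A/(‖x‖ + √(−t))` (Koch–Nadirashvili–Seregin–Šverák 2009 /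
Seregin–Šverák 2009 class) — the dissipation law carries no extra difficulty and no extra help.
The v4–v8 cut (past-DSS ∨ past-wandering) is RETIRED: its DSS half was closed only modulo the
catalogued wall `∀ c > 1, Literature.Analysis.FluidPDE.TypeIDSSLiouville c` (Bradshaw–Tsai 2017
OP 5.1), which is NECESSARY for the crux (ns-lqd-p1, `…Hardness`, p588754) and is therefore not a
reduction; the single stub below contains the past-DSS members as a sub-case. The theorem
`stub_pastDssExclusion_of_wall` (DSS half from the wall, g2) is kept as a closed theorem of the
line for the record, no longer used in the composition.

THE ONE OPEN STUB `stub_envelopeCriticalLiouville` (XL; open problem — critics of record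
idea-crit-3 / idea-crit-7, 2026-08-28T08:00Z: «FRONTIER-bank», no tool in tree or print bites
beyond the known regimes: small constant, axisymmetric, (discretely) self-similar with factor near
1 / one calm slice): a Type-I ancient mild field `W` (KNSS gauge, constant `C`) WITH THE SPACE-TIME
ENVELOPE (`HasTypeIDecay A W`) and the quarter-rate dissipation law with constant `K_c` is regular
at the apex PROVIDED it carries the whole kernel-checked portrait of the minimal counterexample —
every clause below is a THEOREM about singular critical elements, discharged in
`FiniteDissipationLiouville_of` by the named landed file:
* minimality of `K_c` among singular members with constant `C` (ns-lqd-p1 `…CriticalElement`,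
  p592183) and uniform scaling-recurrence + near-saturation (`…CriticalRecurrent`, p592568);
* the envelope itself (`…Envelope.envelope_of_minimal`, p612818);
* a classical pressure `Q` with the full scale-invariant package
  `Theorems.RellichScarScarRigidity.ScaleInvariantBounds W Q` (`…EnvelopePackage`, p613658) and
  TIGHT core dissipation `∫_{‖x‖ ≥ R√(−t)} ‖∇W(t)‖² ≤ K_g/(R√(−t))`;
* the Pineau–Vicol scale-critical UNSTEADINESS FLOOR `δ₀` on `B(0,1)` at every late time
  (`…EnvelopePV.pv_unsteadiness_floor_of_minimal`, p614121 — the certificate that the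
  self-similar-type levers cannot reach the element);
* the absolute sup-norm floor `sup_y √(−t)‖W(t,y)‖ > θ` at every instant
  (`…AbsoluteFloors.sup_floor_absolute`, p608181, ns-lqd-p2 g7);
* ONE-POINT blow-up: regular at every final-time point `x₁ ≠ 0`
  (`…CriticalPoint.not_singular_translate_of_minimal`, p609602);
* NONZERO distributional final datum `u₀ = W(0⁻)` (`…Birth.Apex.exists_trace_ne_zero_of_singular`,
  p595244, lead g3), concentrating `L³` at the apex at every scale and `L³`-nontrivial outside
  every ball (`…trace_L3_concentration_of_singular`, `…_atInfinity_of_singular`, lead g5).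
A refutation of the stub must exhibit all of it at once; by `…EnvelopeIff` + `…Hardness` the stub
is logically EQUIVALENT to the crux (and implies the catalogued DSS wall). No summit is proved by
this line; Navier–Stokes regularity is NOT proved by anything here.

History: registered by the route's planner (ns-idea-3, 2026-08-27T21:42Z); reshaped by lead g0
(v1–v3: tree vocabulary, small-`K` rung closed p579719, DSS stub modulo the wall), lead g2 (v4:
`stub_recurrentReduction` = child 22507 closed by ns-lqd-p1; past-DSS repair of the disprover's
`stub-misstated`), lead g3 (v5–v6: nonzero trace; composition via the recurrent critical element),
lead g5 (v7–v8: `L³`-concentration clauses; one-point clause), lead g6 (v9–v11: one envelope-class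
stub; weighted/rotational trace clauses; uniform DSS threshold), lead g7 (v12: factor structure; final-datum profile;
Lyapunov reduction on record), lead g8 (v13: direction-oscillation floor; Giga–Miura regime excluded; planarity floor; v14: unidirectionality floor;
printed Giga–Miura shape; v15: local floors in every similarity ball; Barker–Prange Thm 3 form), lead g9 (v16: two-sided
core energy law; finite-energy remainder; v17: trace = `u₀` across the apex; two-sided apex energy law of `u₀`; v18: no vorticity
concentration — `u₀` weakly divergence-free, gradient/vorticity converge in `L¹(ℝ³)`, distributional vorticity = `ω₀ ∈ L¹_loc`;
v19: no early arrival — remainder energy floor `δ²√(−t)`; v20: pointwise saturation of `‖x‖⁻¹` by `u₀` at both ends), lead g10 (v21: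
the point group — crystallographic restriction), lead g11 (v22/v23: category and minimality on the scaling hull — no isolated / countable wandering residue), lead g12 (v24: quasi-regularity — invariant measures / Birkhoff on the hull; v25: blow-up direction + mean core energy; v26: the extremal critical element — the law is attained on the hull), …, lead g17 (v38: the mixed `(C,K)` lens; v39: forward trapping — the every-instant enstrophy floor; v40: the lens-shaped every-instant floor; v41: the cross-flow threshold one is not attained).

THE CRUX (FDL). For all `C K` and every Type-I ancient mild field `ū` in the KNSS gauge
(`IsTypeIAncientMild C ū`) whose slices obey the global quarter-rate dissipation law
`∫ ‖∇ū(s)‖² ≤ K/√(−s)` (`s < 0`), `ū` is bounded on some backward parabolic cylinder at the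
space-time origin.

COMPOSITION (real, this file): `FiniteDissipationLiouville_of` concludes the crux BY NAME: small
`K` by the gap (closed); otherwise the recurrent CRITICAL element (ns-lqd-p1) produces a singular,
uniformly recurrent, critical, near-saturating member `w ∈ 𝒟_{C,K_c}`; the landed portrait
theorems supply the envelope, the package, the tight dissipation, the PV floor, the sup floor, the
one-point clause and the trace clauses; the stub returns `¬ singular`, contradiction.
-/

namespace Summit.NavierStokesRegularity.NavierStokesRegularity.Cruxes.FiniteDissipationLiouville.Birth

-- the problem-side namespace duplicates `NavierStokesRegularity` by design (summit = problem)
set_option linter.dupNamespace false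

open MeasureTheory Set Filter Topology
open scoped RealInnerProductSpace InnerProductSpace Laplacian

/-- **Stub (BC5 rung, M): the small-dissipation gap — CLOSED** (lead g0, p579719,
`…Theorems.FiniteDissipationLiouville.Birth.stub_smallDissipationGap`). There is an absolute
`K₀ > 0` such that every Type-I ancient mild field (any Type-I constant `C`) whose slices obey the
quarter-rate dissipation law with constant `K ≤ K₀` vanishes identically on `t < 0`. -/
theorem stub_smallDissipationGap :
    ∃ K₀ : ℝ, 0 < K₀ ∧ ∀ (C K : ℝ)
      (w : ℝ → EuclideanSpace ℝ (Fin 3) → EuclideanSpace ℝ (Fin 3)), K ≤ K₀ →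
      Literature.Analysis.FluidPDE.IsTypeIAncientMild C w →
      (∀ s : ℝ, s < 0 → ∫⁻ x, ‖fderiv ℝ (w s) x‖ₑ ^ 2 ≤ ENNReal.ofReal (K / Real.sqrt (-s))) →
      ∀ t < 0, ∀ x, w t x = 0 :=
  Theorems.FiniteDissipationLiouville.Birth.stub_smallDissipationGap

/-- **Stub (support) — CLOSED: recurrent reduction inside the finite-dissipation stratum**, the
child item stmt-NavierStokesRegularity-22507 `RecurrentReductionD` by name, proved by seat
ns-lqd-p1 (`Theorems.recurrentReductionD_proof`, Birkhoff recurrence + energy ledger + persistence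
of singularities in the KNSS mild class). Kept as a closed theorem of the line (the composition
uses the stronger recurrent CRITICAL element). -/
theorem stub_recurrentReduction : Theses.LerayQuarterDissipation.RecurrentReductionD :=
  Theorems.recurrentReductionD_proof

/-- **Closed theorem of the line (record of the retired v4–v8 cut): the past-DSS half follows from
the catalogued wall.** If `Literature.Analysis.FluidPDE.TypeIDSSLiouville c` holds for every
`c > 1` (Bradshaw–Tsai 2017 OP 5.1 — an OPEN PROBLEM, necessary for the crux by `…Hardness`), then
every member of the stratum that is `c`-DSS on the past is bounded at the apex
(`Theorems.FiniteDissipationLiouville.Birth.pastDssExclusion_of_typeIDSSLiouville`, lead g2). Not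
used in the v9 composition. -/
theorem stub_pastDssExclusion_of_wall
    (hwall : ∀ c : ℝ, 1 < c → Literature.Analysis.FluidPDE.TypeIDSSLiouville c) :
    ∀ (C K c : ℝ) (w : ℝ → EuclideanSpace ℝ (Fin 3) → EuclideanSpace ℝ (Fin 3)), 1 < c →
      Literature.Analysis.FluidPDE.IsTypeIAncientMild C w →
      (∀ s : ℝ, s < 0 → ∫⁻ x, ‖fderiv ℝ (w s) x‖ₑ ^ 2 ≤ ENNReal.ofReal (K / Real.sqrt (-s))) →
      (∀ t : ℝ, t < 0 → ∀ x, c • w (c ^ 2 * t) (c • x) = w t x) →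
      ¬ (∀ r > 0, ∀ M : ℝ, ∃ t ∈ Set.Ioo (-(r ^ 2)) (0 : ℝ),
          ∃ x ∈ Metric.ball (0 : EuclideanSpace ℝ (Fin 3)) r, M < ‖w t x‖) :=
  Theorems.FiniteDissipationLiouville.Birth.pastDssExclusion_of_typeIDSSLiouville hwall

set_option maxHeartbeats 1000000 in
/-- **THE OPEN STUB (XL; v9): envelope-class Liouville for the critical element.** A Type-I
ancient mild field `W` (KNSS gauge, constant `C`) with the space-time envelope
`‖W(t,x)‖ ≤ A/(‖x‖ + √(−t))` and the dissipation law with constant `K_c`, which is CRITICAL (no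
singular member with the same `C` and a smaller dissipation constant), UNIFORMLY SCALING-RECURRENT,
NEAR-SATURATING, classical with a pressure `Q` obeying the scale-invariant package
`ScaleInvariantBounds W Q`, with TIGHT core dissipation, the Pineau–Vicol UNSTEADINESS FLOOR on
`B(0,1)` at all late times, the sup-norm floor at every instant, ONE-POINT blow-up (regular at every
`x₁ ≠ 0`), and a NONZERO final datum concentrating `L³` at the apex at every scale and outside
every ball, saturating the critical weighted scale `‖x‖⁻¹` at the apex and at infinity (v10),
ROTATIONAL in every open half-space in every direction with vorticity accumulating at the apex and
saturating `‖x‖⁻²` at the apex and at infinity (v10), and NOT discretely self-similar on the past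
with any factor below the stratum's uniform threshold `λ₀(C,K_c)` (v11), whose past-DSS factors
`≠ 1` (if any) are the integer powers of a least factor `λ_* > 1` (v12), and whose final datum off
the apex is a `C¹` divergence-free profile in the homogeneous symbol class attained with gradients
at the parabolic rate and equal to the trace there (v12), whose vorticity DIRECTION oscillates by a
definite amount modulo sign on the large-vorticity part of every parabolic ball `B(0, δ⁻¹√(−t))`
at every instant and for which the sign-blind Giga–Miura continuous-alignment hypothesis fails at
every level and modulus, and which is uniformly NON-PLANAR — `(−t)‖∂ₑW‖ > δ` somewhere in every
parabolic ball for every unit direction `e` at every instant (v13), whose velocity direction oscillates by a definite amount modulo sign on the fast part of every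
parabolic ball `B(0, δ⁻¹√(−t))` and for which the printed Giga–Miura hypothesis fails (v14), whose three coherence defects have
floors `δ(C,K_c,r)` in EVERY similarity ball `B(0, r√(−t))` at every instant and which admits no
sign-blind alignment on concentrating balls along any sequence of times (v15), whose kinetic energy
in every similarity ball obeys the two-sided law `δ √(−t) < ∫_{B(0,r√(−t))} ‖W(t)‖² ≤ Λ r √(−t)`
and whose singular part `W(t) − u₀` has finite total energy `≤ M √(−t)` (v16), whose trace is the
function `u₀` across the apex with `ε₀² ρ < ∫_{B(0,ρ)} ‖u₀‖² ≤ 3|B₁| A² ρ` at every scale (v17),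
`u₀` weakly divergence-free on `ℝ³` with vorticity `ω₀ = curlCLM ∘ Du₀ ∈ L¹_loc` attained in
`L¹(ℝ³)` and equal to the distributional vorticity of the trace across the apex (v18), whose
singular part never has energy below `δ² √(−t)` — no early arrival at the final state (v19), and
whose final datum satisfies `θ < ‖x‖‖u₀(x)‖` along sequences `x → 0` and `‖x‖ → ∞` (v20),
and whose slices admit no small-angle rotational symmetry about any apex axis and only
`O(3)`-symmetries of order `≤ N` on the similarity ball (v21), and which — unless it is past-DSS —
has, for every sequence of fields continuous on the open past, a scaling limit in `𝒟_{C,K_c}`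
which is again a critical element (SINGULAR, UNIFORMLY RECURRENT) on none of their scaling orbits
(v22/v23, Baire category and Birkhoff minimality on the scaling hull), and which is QUASI-REGULAR —
every observable continuous along `𝒟_{C,K_c}` for uniform convergence on the slab pieces is
bounded on its scaling orbit with convergent Cesàro means along the blow-up sequence `W_{2^{−k}}`
(v24/v25, invariant measures on the hull + Birkhoff), in particular with a MEAN scaled core energy
`ℓ_r ≥ δ(C,K_c,r)` along `t_k = −4^{−k}` for every similarity radius (v25), and whose scaling hull
contains a critical element ATTAINING the law, `∫‖∇W'(−1)‖² = K_c` (v26, the extremal element), and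
whose scaling orbit has NO SHORT ALMOST-RETURNS — for factors `μ ∈ [μ₁, μ₂] ⊂ (1, λ₀)` the
`μ`-displacement exceeds `δ(μ₁,μ₂,R)` somewhere on every window, and exceeds `κ(μ₂,R) · log μ` for
every `1 < μ ≤ μ₂ < λ₀` (v27, the return-time floor and its sharp small-lag form), and which
FLICKERS IN EVERY PARABOLIC SUB-BALL `B(x₀, r√(−t))`, `‖x₀‖ ≤ ρ√(−t)`, of the similarity region at
every instant, with unsteadiness `> δ(ρ,r)` somewhere, and likewise with VORTICITY unsteadiness
`(−t)‖curl Φₜ‖ > δ'(ρ,r)` somewhere (v28, the dense velocity- and vorticity-flicker floors), and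
with `∫_{B(x₀,r√(−t))}‖unsteadiness‖ > δ''(ρ,r)(√(−t))³` (v29, the mean-flicker floor), the
whole flicker being `≤ c√(−t)/(‖x‖+√(−t))` (v29, the flicker envelope), and whose Type-I
constant exceeds the law-free threshold by the gap, `1 + ε(K_c) < C` (v30, THRESHOLD ONE), and whose
dissipation constant is above the sharper explicit rung, `(√(max K_c 0)·(√K_S)³)⁴ ≥ 64/27` (v32), indeed
above it by the dissipation gap, `64/27 + ε'(C) < (√(max K_c 0)·(√K_S)³)⁴` (v33, THE DISSIPATION THRESHOLD), and whose
vorticity amplitude exceeds `√3/4 + ε` in every long log-window and the joint `(C,C_ω)` floor (v34), and whose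
`L³`-VORTICITY constant is at least `√3/K_S`, `sup_t (√(−t))³∫‖curl W(t)‖³ > v³` whenever `K_S²v² < 3` (v35a), with the
hyperbola floor `K_S⁶(C_ω‖curlCLM‖² max K_c 0)² ≥ 27` for every vorticity bound `(−t)‖curl W‖ ≤ C_ω` (v35b), and whose
`L⁶`-VELOCITY constant is at least `(64/27)^{1/4}/√K_S`, `sup_t (√(−t))³∫‖W(t)‖⁶ > w⁶` whenever `K_S²w⁴ < 64/27` (v36), and whose
similarity velocity has, for EVERY continuous majorant `γ ≥ ‖U(σ,·)‖_∞`, backward parabolic mean square `∫_a^s e^{−(s−σ)/2}γ² ≥ Γ₂`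
somewhere for every `Γ₂ < 2` (v37, THRESHOLD ONE ON AVERAGE), and whose pair `(C, θ(K_c)⁴)` lies OUTSIDE THE MIXED
LENS — `λC²/μ + (1−λ)κ³θ(K_c)⁴ ≥ 1` for all weights `0 ≤ λ ≤ 1`, `μ, κ, δ > 0` with
`2λμ + (1−λ)·3(1+δ)/(2κ) ≤ 2` (v38), and whose dimensionless enstrophy never dips below the explicit
threshold — `K_S⁶(√(−t)∫‖curl W(t)‖²dx)² ≥ 64/27` at EVERY instant `t < 0` (v39), indeed never into
the mixed lens — `λC²/μ + (1−λ)κ³·max(K_S⁶(√(−t)∫‖curl W(t)‖²)², 1) ≥ 1` for all admissible weights at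
every instant (v40), and whose velocity somewhere crosses the vorticity STRICTLY FASTER than the
self-similar speed, `‖curl W(t,x)‖ < √(−t)‖curl W(t,x) × W(t,x)‖` (v41, the cross-flow threshold
one is not attained), (v42–v67: the product / local-balance / critical-production excesses with their apex,
far-past, window, volume, temporal-density, margin and blob forms, leads g18–g19), and whose vorticity is
NOWHERE LOCALLY CALORIC — the curl of the Lamb vector `(W·∇)ω − (ω·∇)W = −(∂ₜ − Δ)ω` exceeds `δ/t²` on a
parabolic cylinder of relative size `ρ` in every window and somewhere in every parabolic cylinder of the
core at every scale (v68/v69, lead g20), and NOWHERE LOCALLY HOMOGENEOUS IN SPACE — `(−t)^{3/2}‖∇ω‖ > δ`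
somewhere in every parabolic ball of the core at every instant and on a cylinder in every window (v70/v71,
lead g20), ROTATIONAL and NON-PLANAR in every direction on every parabolic sub-ball of the core at every instant by
a definite amount (v72/v73, lead g20; dense forms of v13/v15), with vorticity NOWHERE LOCALLY HARMONIC —
`t²‖Δω‖ > δ` somewhere in every sub-ball of the core at every instant (v74, lead g20) — is
bounded on some backward cylinder at the origin. Equivalent to the crux
(`…EnvelopeIff`); contains Bradshaw–Tsai OP 5.1 (`…Hardness`). Open problem — no result in print
beyond the catalogued regimes (KNSS 2009, Seregin–Šverák 2009, Tsai 1998, Chae–Wolf 2017,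
Pineau–Vicol 2026). -/
theorem stub_envelopeCriticalLiouville :
    ∀ (C A Kc : ℝ) (W : ℝ → EuclideanSpace ℝ (Fin 3) → EuclideanSpace ℝ (Fin 3)),
      Literature.Analysis.FluidPDE.IsTypeIAncientMild C W →
      Literature.Analysis.FluidPDE.HasTypeIDecay A W →
      (∀ s : ℝ, s < 0 → ∫⁻ x, ‖fderiv ℝ (W s) x‖ₑ ^ 2 ≤ ENNReal.ofReal (Kc / Real.sqrt (-s))) →
      -- criticality: no singular member with constant `C` below `Kc`
      (∀ K' : ℝ, K' < Kc → ∀ v : ℝ → EuclideanSpace ℝ (Fin 3) → EuclideanSpace ℝ (Fin 3),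
        Literature.Analysis.FluidPDE.IsTypeIAncientMild C v →
        (∀ s : ℝ, s < 0 → ∫⁻ x, ‖fderiv ℝ (v s) x‖ₑ ^ 2 ≤ ENNReal.ofReal (K' / Real.sqrt (-s))) →
        ¬ (∀ r > 0, ∀ M : ℝ, ∃ t ∈ Set.Ioo (-(r ^ 2)) (0 : ℝ),
          ∃ x ∈ Metric.ball (0 : EuclideanSpace ℝ (Fin 3)) r, M < ‖v t x‖)) →
      -- uniform scaling-recurrence
      (∀ ε > 0, ∀ R > 1, ∃ L > 0, ∀ a : ℝ, ∃ σ ∈ Set.Icc a (a + L),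
        ∀ s ∈ Set.Icc (-(R ^ 2)) (-(R⁻¹) ^ 2),
        ∀ y ∈ Metric.closedBall (0 : EuclideanSpace ℝ (Fin 3)) R,
          ‖Real.exp σ • W (Real.exp (2 * σ) * s) (Real.exp σ • y) - W s y‖ ≤ ε) →
      -- near-saturation of the dissipation constant in every long backward log-window
      (∀ ε : ℝ, 0 < ε → ∃ Λ : ℝ, 1 < Λ ∧ ∀ τ : ℝ, τ < 0 →
        ∃ t ∈ Set.Icc (Λ ^ 2 * τ) (τ / Λ ^ 2),
          ENNReal.ofReal ((Kc - ε) / Real.sqrt (-t)) < ∫⁻ x, ‖fderiv ℝ (W t) x‖ₑ ^ 2) →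
      -- classical pressure with the scale-invariant package
      (∃ Q : ℝ → EuclideanSpace ℝ (Fin 3) → ℝ,
        Literature.Analysis.FluidPDE.IsClassicalNSSolutionOn (Set.Iio (0 : ℝ)) 1 0 W Q ∧
          Theorems.RellichScarScarRigidity.ScaleInvariantBounds W Q) →
      -- tight core dissipation (similarity variables)
      (∃ Kg : ℝ, 0 ≤ Kg ∧ ∀ t < 0, ∀ R > 0,
        ∫⁻ x in {x : EuclideanSpace ℝ (Fin 3) | R * Real.sqrt (-t) ≤ ‖x‖}, ‖fderiv ℝ (W t) x‖ₑ ^ 2 ≤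
          ENNReal.ofReal (Kg / (R * Real.sqrt (-t)))) →
      -- Pineau–Vicol scale-critical unsteadiness floor on `B(0,1)` at all late times
      (∃ δ₀ > 0, ∃ T₀ > 0, ∀ tbar ∈ Set.Ioo (-T₀) (0 : ℝ),
        ∃ x ∈ Metric.ball (0 : EuclideanSpace ℝ (Fin 3)) 1,
          δ₀ < ‖Real.sqrt (-tbar) • ((-tbar) • deriv (fun τ => W τ x) tbar - (1 / 2 : ℝ) • W tbar x -
            (1 / 2 : ℝ) • fderiv ℝ (W tbar) x x)‖) →
      -- sup-norm floor at every instant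
      (∃ θ > 0, ∀ t < 0, ∃ y, θ < Real.sqrt (-t) * ‖W t y‖) →
      -- one-point blow-up: regular at every final-time point `x₁ ≠ 0`
      (∀ x₁ : EuclideanSpace ℝ (Fin 3), x₁ ≠ 0 →
        ¬ (∀ r > 0, ∀ M : ℝ, ∃ t ∈ Set.Ioo (-(r ^ 2)) (0 : ℝ),
          ∃ x ∈ Metric.ball (0 : EuclideanSpace ℝ (Fin 3)) r, M < ‖W t (x₁ + x)‖)) →
      -- nonzero distributional final datum
      (∃ (φ : EuclideanSpace ℝ (Fin 3) → EuclideanSpace ℝ (Fin 3)) (L : ℝ),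
        Literature.Analysis.FunctionSpaces.IsTestFunctionOn
            (⊤ : TopologicalSpace.Opens (EuclideanSpace ℝ (Fin 3))) φ ∧ L ≠ 0 ∧
          Filter.Tendsto (fun t => ∫ x, ⟪W t x, φ x⟫) (𝓝[<] 0) (𝓝 L)) →
      -- the final datum concentrates `L³` at the apex at every scale …
      (∃ ε > 0, ∀ ρ > 0, ∃ (ψ : EuclideanSpace ℝ (Fin 3) → EuclideanSpace ℝ (Fin 3)) (T : ℝ),
        Literature.Analysis.FunctionSpaces.IsTestFunctionOn
            (⊤ : TopologicalSpace.Opens (EuclideanSpace ℝ (Fin 3))) ψ ∧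
          (∀ x, ψ x ≠ 0 → ‖x‖ < ρ) ∧
          Filter.Tendsto (fun t => ∫ x, ⟪W t x, ψ x⟫) (𝓝[<] 0) (𝓝 T) ∧
          ε * (∫ x, ‖ψ x‖ ^ (3 / 2 : ℝ)) ^ (2 / 3 : ℝ) < |T|) →
      -- … and is `L³`-nontrivial outside every ball
      (∃ ε > 0, ∀ R > 0, ∃ (ψ : EuclideanSpace ℝ (Fin 3) → EuclideanSpace ℝ (Fin 3)) (T : ℝ),
        Literature.Analysis.FunctionSpaces.IsTestFunctionOn
            (⊤ : TopologicalSpace.Opens (EuclideanSpace ℝ (Fin 3))) ψ ∧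
          (∀ x, ψ x ≠ 0 → R < ‖x‖) ∧
          Filter.Tendsto (fun t => ∫ x, ⟪W t x, ψ x⟫) (𝓝[<] 0) (𝓝 T) ∧
          ε * (∫ x, ‖ψ x‖ ^ (3 / 2 : ℝ)) ^ (2 / 3 : ℝ) < |T|) →
      -- (v10) the final datum saturates the critical weighted scale `‖x‖⁻¹` at the apex …
      (∃ θ > 0, ∀ ρ > 0, ∃ (ψ : EuclideanSpace ℝ (Fin 3) → EuclideanSpace ℝ (Fin 3)) (T : ℝ),
        Literature.Analysis.FunctionSpaces.IsTestFunctionOn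
            (⊤ : TopologicalSpace.Opens (EuclideanSpace ℝ (Fin 3))) ψ ∧
          (∀ x, ψ x ≠ 0 → ‖x‖ < ρ) ∧
          Filter.Tendsto (fun t => ∫ x, ⟪W t x, ψ x⟫) (𝓝[<] 0) (𝓝 T) ∧
          θ * (∫ x, ‖ψ x‖ / ‖x‖) < |T|) →
      -- … and at infinity
      (∃ θ > 0, ∀ R > 0, ∃ (ψ : EuclideanSpace ℝ (Fin 3) → EuclideanSpace ℝ (Fin 3)) (T : ℝ),
        Literature.Analysis.FunctionSpaces.IsTestFunctionOn
            (⊤ : TopologicalSpace.Opens (EuclideanSpace ℝ (Fin 3))) ψ ∧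
          (∀ x, ψ x ≠ 0 → R < ‖x‖) ∧
          Filter.Tendsto (fun t => ∫ x, ⟪W t x, ψ x⟫) (𝓝[<] 0) (𝓝 T) ∧
          θ * (∫ x, ‖ψ x‖ / ‖x‖) < |T|) →
      -- (v10) the final datum is ROTATIONAL in every open half-space, in every direction …
      (∀ e : EuclideanSpace ℝ (Fin 3), ‖e‖ = 1 → ∀ R₁ : ℝ,
        ∃ (ψ : EuclideanSpace ℝ (Fin 3) → EuclideanSpace ℝ (Fin 3)) (L : ℝ),
          Literature.Analysis.FunctionSpaces.IsTestFunctionOn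
              (⊤ : TopologicalSpace.Opens (EuclideanSpace ℝ (Fin 3))) ψ ∧
            (∀ x, ψ x ≠ 0 → R₁ < ⟪x, e⟫) ∧
            Filter.Tendsto (fun t => ∫ x, ⟪W t x, Literature.Analysis.FluidPDE.curl ψ x⟫)
              (𝓝[<] 0) (𝓝 L) ∧ L ≠ 0) →
      -- … and its vorticity accumulates at the apex (every punctured ball)
      (∀ r > 0, ∃ (ψ : EuclideanSpace ℝ (Fin 3) → EuclideanSpace ℝ (Fin 3)) (L : ℝ),
        Literature.Analysis.FunctionSpaces.IsTestFunctionOn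
            (⊤ : TopologicalSpace.Opens (EuclideanSpace ℝ (Fin 3))) ψ ∧
          (∀ x, ψ x ≠ 0 → x ≠ 0 ∧ ‖x‖ < r) ∧
          Filter.Tendsto (fun t => ∫ x, ⟪W t x, Literature.Analysis.FluidPDE.curl ψ x⟫)
            (𝓝[<] 0) (𝓝 L) ∧ L ≠ 0) →
      -- (v11) not DSS on the past with any factor below the uniform threshold `λ₀(C, K_c)`
      (∃ lam₀ > 1, ∀ c : ℝ, 1 < c → c < lam₀ →
        ¬ (∀ t : ℝ, t < 0 → ∀ x, c • W (c ^ 2 * t) (c • x) = W t x)) →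
      -- (v10) the final-time vorticity saturates the critical scale `‖x‖⁻²` at the apex …
      (∃ θ > 0, ∀ ρ > 0, ∃ (ψ : EuclideanSpace ℝ (Fin 3) → EuclideanSpace ℝ (Fin 3)) (T : ℝ),
        Literature.Analysis.FunctionSpaces.IsTestFunctionOn
            (⊤ : TopologicalSpace.Opens (EuclideanSpace ℝ (Fin 3))) ψ ∧
          (∀ x, ψ x ≠ 0 → ‖x‖ < ρ) ∧
          Filter.Tendsto (fun t => ∫ x, ⟪W t x, Literature.Analysis.FluidPDE.curl ψ x⟫)
            (𝓝[<] 0) (𝓝 T) ∧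
          θ * (∫ x, ‖ψ x‖ / ‖x‖ ^ 2) < |T|) →
      -- … and at infinity
      (∃ θ > 0, ∀ R > 0, ∃ (ψ : EuclideanSpace ℝ (Fin 3) → EuclideanSpace ℝ (Fin 3)) (T : ℝ),
        Literature.Analysis.FunctionSpaces.IsTestFunctionOn
            (⊤ : TopologicalSpace.Opens (EuclideanSpace ℝ (Fin 3))) ψ ∧
          (∀ x, ψ x ≠ 0 → R < ‖x‖) ∧
          Filter.Tendsto (fun t => ∫ x, ⟪W t x, Literature.Analysis.FluidPDE.curl ψ x⟫)
            (𝓝[<] 0) (𝓝 T) ∧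
          θ * (∫ x, ‖ψ x‖ / ‖x‖ ^ 2) < |T|) →
      -- (v12) factor structure: every past-DSS factor `c ≠ 1` is an integer power of a least one
      (∀ c : ℝ, 0 < c → c ≠ 1 → (∀ t : ℝ, t < 0 → ∀ x, c • W (c ^ 2 * t) (c • x) = W t x) →
        ∃ lam : ℝ, 1 < lam ∧ (∀ t : ℝ, t < 0 → ∀ x, lam • W (lam ^ 2 * t) (lam • x) = W t x) ∧
          ∀ c' : ℝ, 0 < c' →
            ((∀ t : ℝ, t < 0 → ∀ x, c' • W (c' ^ 2 * t) (c' • x) = W t x) ↔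
              ∃ k : ℤ, c' = lam ^ k)) →
      -- (v12) the final datum off the apex: a `C¹` divergence-free profile in the homogeneous
      -- symbol class, attained with gradients at the parabolic rate, equal to the trace there
      (∃ (L₀ L₁ M : ℝ) (u₀ : EuclideanSpace ℝ (Fin 3) → EuclideanSpace ℝ (Fin 3))
          (Du₀ : EuclideanSpace ℝ (Fin 3) →
            ((EuclideanSpace ℝ (Fin 3)) →L[ℝ] (EuclideanSpace ℝ (Fin 3)))),
        -- (v16) finite-energy remainder: the singular part `W(t) − u₀` lies in `L²(ℝ³)`
        (∀ t : ℝ, t < 0 → ∫⁻ x, ‖W t x - u₀ x‖ₑ ^ 2 ≤ ENNReal.ofReal (M * Real.sqrt (-t))) ∧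
        -- (v19) … with the matching FLOOR: no early arrival at the final datum
        (∃ δ > 0, ∀ t : ℝ, t < 0 →
          ENNReal.ofReal (δ ^ 2 * Real.sqrt (-t)) < ∫⁻ x, ‖W t x - u₀ x‖ₑ ^ 2) ∧
        -- (v20) pointwise saturation: `θ < ‖x‖‖u₀ x‖` along sequences `x → 0` and `‖x‖ → ∞`
        (∃ θ > 0, (∀ ρ > 0, ∃ x : EuclideanSpace ℝ (Fin 3), 0 < ‖x‖ ∧ ‖x‖ < ρ ∧ θ < ‖x‖ * ‖u₀ x‖) ∧
          (∀ R > 0, ∃ x : EuclideanSpace ℝ (Fin 3), R < ‖x‖ ∧ θ < ‖x‖ * ‖u₀ x‖)) ∧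
        -- (v17) the trace IS `u₀`, for EVERY test field (across the apex) …
        (∀ ψ : EuclideanSpace ℝ (Fin 3) → EuclideanSpace ℝ (Fin 3),
          Literature.Analysis.FunctionSpaces.IsTestFunctionOn
              (⊤ : TopologicalSpace.Opens (EuclideanSpace ℝ (Fin 3))) ψ →
          Filter.Tendsto (fun t => ∫ x, ⟪W t x, ψ x⟫) (𝓝[<] 0) (𝓝 (∫ x, ⟪u₀ x, ψ x⟫))) ∧
        -- (v17) … and `u₀` obeys the two-sided apex energy law `ε₀² ρ < ∫_{B_ρ}‖u₀‖² ≤ 3|B₁|A²ρ`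
        (∃ ε₀ > 0, ∀ ρ > 0, ENNReal.ofReal (ε₀ ^ 2 * ρ) <
          ∫⁻ x in Metric.ball (0 : EuclideanSpace ℝ (Fin 3)) ρ, ‖u₀ x‖ₑ ^ 2) ∧
        (∀ ρ > 0, ∫⁻ x in Metric.ball (0 : EuclideanSpace ℝ (Fin 3)) ρ, ‖u₀ x‖ₑ ^ 2 ≤
          ENNReal.ofReal (3 * (MeasureTheory.volume : MeasureTheory.Measure
            (EuclideanSpace ℝ (Fin 3))).real (Metric.ball 0 1) * A ^ 2 * ρ)) ∧
        -- (v18) `u₀` is weakly divergence-free on `ℝ³` (across the apex) …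
        Literature.Analysis.FluidPDE.IsWeaklyDivFree u₀ ∧
        -- (v18) … the gradient and the vorticity converge in `L¹(ℝ³)`, `ω₀ ∈ L¹_loc` (no atom) …
        (∃ Lω : ℝ, 0 ≤ Lω ∧
          (∀ t : ℝ, t < 0 → ∫⁻ x, ‖fderiv ℝ (W t) x - Du₀ x‖ₑ ≤ ENNReal.ofReal (Lω * Real.sqrt (-t))) ∧
          (∀ t : ℝ, t < 0 → ∫⁻ x, ‖Literature.Analysis.FluidPDE.curl (W t) x -
              Literature.Analysis.FluidPDE.curlCLM (Du₀ x)‖ₑ ≤ ENNReal.ofReal (Lω * Real.sqrt (-t))) ∧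
          (∀ ρ > 0, ∫⁻ x in Metric.ball (0 : EuclideanSpace ℝ (Fin 3)) ρ,
              ‖Literature.Analysis.FluidPDE.curlCLM (Du₀ x)‖ₑ ≤ ENNReal.ofReal (Lω * ρ))) ∧
        -- (v18) … and the distributional vorticity of the trace is `ω₀ = curlCLM ∘ Du₀`
        (∀ ψ : EuclideanSpace ℝ (Fin 3) → EuclideanSpace ℝ (Fin 3),
          Literature.Analysis.FunctionSpaces.IsTestFunctionOn
              (⊤ : TopologicalSpace.Opens (EuclideanSpace ℝ (Fin 3))) ψ →
          Filter.Tendsto (fun t => ∫ x, ⟪W t x, Literature.Analysis.FluidPDE.curl ψ x⟫) (𝓝[<] 0)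
            (𝓝 (∫ x, ⟪Literature.Analysis.FluidPDE.curlCLM (Du₀ x), ψ x⟫))) ∧
        (∀ x : EuclideanSpace ℝ (Fin 3), x ≠ 0 → ∀ t : ℝ, t < 0 →
          ‖W t x - u₀ x‖ ≤ L₀ * (-t) / ‖x‖ ^ 3) ∧
        (∀ x : EuclideanSpace ℝ (Fin 3), x ≠ 0 → ‖u₀ x‖ ≤ A / ‖x‖) ∧
        (∀ x : EuclideanSpace ℝ (Fin 3), x ≠ 0 → ∀ t : ℝ, t < 0 →
          ‖fderiv ℝ (W t) x - Du₀ x‖ ≤ L₁ * (-t) / ‖x‖ ^ 4) ∧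
        (∀ x : EuclideanSpace ℝ (Fin 3), x ≠ 0 → ‖Du₀ x‖ ≤ L₁ / ‖x‖ ^ 2) ∧
        (∀ x : EuclideanSpace ℝ (Fin 3), x ≠ 0 → HasFDerivAt u₀ (Du₀ x) x) ∧
        (∀ x : EuclideanSpace ℝ (Fin 3), x ≠ 0 →
          Literature.Analysis.FluidPDE.VectorCalculus.divergence u₀ x = 0) ∧
        (∀ (ψ : EuclideanSpace ℝ (Fin 3) → EuclideanSpace ℝ (Fin 3)) (r : ℝ), 0 < r →
          Literature.Analysis.FunctionSpaces.IsTestFunctionOn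
              (⊤ : TopologicalSpace.Opens (EuclideanSpace ℝ (Fin 3))) ψ →
          (∀ x, ψ x ≠ 0 → r < ‖x‖) →
          Filter.Tendsto (fun t => ∫ x, ⟪W t x, ψ x⟫) (𝓝[<] 0) (𝓝 (∫ x, ⟪u₀ x, ψ x⟫)))) →
      -- (v13) direction-oscillation floor: at every instant two points of `B(0, δ⁻¹√(−t))` with
      -- scaled vorticity `> δ` and vorticity directions `δ`-apart modulo sign
      (∃ δ > 0, ∀ t < 0,
        ∃ x ∈ Metric.ball (0 : EuclideanSpace ℝ (Fin 3)) (δ⁻¹ * Real.sqrt (-t)),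
        ∃ y ∈ Metric.ball (0 : EuclideanSpace ℝ (Fin 3)) (δ⁻¹ * Real.sqrt (-t)),
          δ < (-t) * ‖Literature.Analysis.FluidPDE.curl (W t) x‖ ∧
          δ < (-t) * ‖Literature.Analysis.FluidPDE.curl (W t) y‖ ∧
          δ < ‖Literature.Analysis.FluidPDE.vorticityDirection (Literature.Analysis.FluidPDE.curl (W t)) x -
              Literature.Analysis.FluidPDE.vorticityDirection (Literature.Analysis.FluidPDE.curl (W t)) y‖ ∧
          δ < ‖Literature.Analysis.FluidPDE.vorticityDirection (Literature.Analysis.FluidPDE.curl (W t)) x +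
              Literature.Analysis.FluidPDE.vorticityDirection (Literature.Analysis.FluidPDE.curl (W t)) y‖) →
      -- (v13) the sign-blind Giga–Miura continuous-alignment hypothesis fails (any level, modulus)
      ¬ (∃ d : ℝ, 0 ≤ d ∧ ∃ r₀ : ℝ, 0 < r₀ ∧ ∃ η : ℝ → ℝ, Filter.Tendsto η (𝓝[>] 0) (𝓝 0) ∧
          ∀ t ∈ Set.Ioo (-(r₀ ^ 2)) (0 : ℝ), ∀ x ∈ Metric.ball (0 : EuclideanSpace ℝ (Fin 3)) r₀,
            ∀ y ∈ Metric.ball (0 : EuclideanSpace ℝ (Fin 3)) r₀,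
              d < ‖Literature.Analysis.FluidPDE.curl (W t) x‖ →
              d < ‖Literature.Analysis.FluidPDE.curl (W t) y‖ →
              min ‖Literature.Analysis.FluidPDE.vorticityDirection (Literature.Analysis.FluidPDE.curl (W t)) x -
                    Literature.Analysis.FluidPDE.vorticityDirection (Literature.Analysis.FluidPDE.curl (W t)) y‖
                  ‖Literature.Analysis.FluidPDE.vorticityDirection (Literature.Analysis.FluidPDE.curl (W t)) x +
                    Literature.Analysis.FluidPDE.vorticityDirection (Literature.Analysis.FluidPDE.curl (W t)) y‖ ≤
                η ‖x - y‖) →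
      -- (v13) planarity floor: in every unit direction the scaled directional derivative exceeds
      -- `δ` somewhere in the parabolic ball `B(0, δ⁻¹√(−t))`, at every instant
      (∃ δ > 0, ∀ t < 0, ∀ e : EuclideanSpace ℝ (Fin 3), ‖e‖ = 1 →
        ∃ x ∈ Metric.ball (0 : EuclideanSpace ℝ (Fin 3)) (δ⁻¹ * Real.sqrt (-t)),
          δ < (-t) * ‖fderiv ℝ (W t) x e‖) →
      -- (v14) unidirectionality floor: two `δ`-fast points of `B(0, δ⁻¹√(−t))` with velocity
      -- directions `δ`-apart modulo sign, at every instant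
      (∃ δ > 0, ∀ t < 0,
        ∃ x ∈ Metric.ball (0 : EuclideanSpace ℝ (Fin 3)) (δ⁻¹ * Real.sqrt (-t)),
        ∃ y ∈ Metric.ball (0 : EuclideanSpace ℝ (Fin 3)) (δ⁻¹ * Real.sqrt (-t)),
          δ < Real.sqrt (-t) * ‖W t x‖ ∧ δ < Real.sqrt (-t) * ‖W t y‖ ∧
          δ < ‖‖W t x‖⁻¹ • W t x - ‖W t y‖⁻¹ • W t y‖ ∧
          δ < ‖‖W t x‖⁻¹ • W t x + ‖W t y‖⁻¹ • W t y‖) →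
      -- (v14) the PRINTED Giga–Miura hypothesis (D) fails (radius `r₀ ∈ (0,1)`, level `d > 0`,
      -- modulus non-decreasing and continuous on `[0,∞)` with `η 0 = 0`, times `t ∈ (−1,0)`)
      ¬ (∃ r₀ : ℝ, 0 < r₀ ∧ r₀ < 1 ∧ ∃ d : ℝ, 0 < d ∧ ∃ η : ℝ → ℝ,
          MonotoneOn η (Set.Ici 0) ∧ ContinuousOn η (Set.Ici 0) ∧ η 0 = 0 ∧
          ∀ t ∈ Set.Ioo (-1 : ℝ) 0, ∀ x ∈ Metric.ball (0 : EuclideanSpace ℝ (Fin 3)) r₀,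
            ∀ y ∈ Metric.ball (0 : EuclideanSpace ℝ (Fin 3)) r₀,
              d < ‖Literature.Analysis.FluidPDE.curl (W t) x‖ →
              d < ‖Literature.Analysis.FluidPDE.curl (W t) y‖ →
              ‖Literature.Analysis.FluidPDE.vorticityDirection (Literature.Analysis.FluidPDE.curl (W t)) x -
                  Literature.Analysis.FluidPDE.vorticityDirection (Literature.Analysis.FluidPDE.curl (W t)) y‖ ≤
                η ‖x - y‖) →
      -- (v15) LOCAL direction-oscillation floor: in every similarity ball `B(0, r√(−t))`
      (∀ r > 0, ∃ δ > 0, ∀ t < 0,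
        ∃ x ∈ Metric.ball (0 : EuclideanSpace ℝ (Fin 3)) (r * Real.sqrt (-t)),
        ∃ y ∈ Metric.ball (0 : EuclideanSpace ℝ (Fin 3)) (r * Real.sqrt (-t)),
          δ < (-t) * ‖Literature.Analysis.FluidPDE.curl (W t) x‖ ∧
          δ < (-t) * ‖Literature.Analysis.FluidPDE.curl (W t) y‖ ∧
          δ < ‖Literature.Analysis.FluidPDE.vorticityDirection (Literature.Analysis.FluidPDE.curl (W t)) x -
              Literature.Analysis.FluidPDE.vorticityDirection (Literature.Analysis.FluidPDE.curl (W t)) y‖ ∧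
          δ < ‖Literature.Analysis.FluidPDE.vorticityDirection (Literature.Analysis.FluidPDE.curl (W t)) x +
              Literature.Analysis.FluidPDE.vorticityDirection (Literature.Analysis.FluidPDE.curl (W t)) y‖) →
      -- (v15) LOCAL planarity floor: in every similarity ball and every unit direction
      (∀ r > 0, ∃ δ > 0, ∀ t < 0, ∀ e : EuclideanSpace ℝ (Fin 3), ‖e‖ = 1 →
        ∃ x ∈ Metric.ball (0 : EuclideanSpace ℝ (Fin 3)) (r * Real.sqrt (-t)),
          δ < (-t) * ‖fderiv ℝ (W t) x e‖) →
      -- (v15) LOCAL unidirectionality floor: two `δ`-fast points of every similarity ball with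
      -- velocity directions `δ`-apart modulo sign
      (∀ r > 0, ∃ δ > 0, ∀ t < 0,
        ∃ x ∈ Metric.ball (0 : EuclideanSpace ℝ (Fin 3)) (r * Real.sqrt (-t)),
        ∃ y ∈ Metric.ball (0 : EuclideanSpace ℝ (Fin 3)) (r * Real.sqrt (-t)),
          δ < Real.sqrt (-t) * ‖W t x‖ ∧ δ < Real.sqrt (-t) * ‖W t y‖ ∧
          δ < ‖‖W t x‖⁻¹ • W t x - ‖W t y‖⁻¹ • W t y‖ ∧
          δ < ‖‖W t x‖⁻¹ • W t x + ‖W t y‖⁻¹ • W t y‖) →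
      -- (v15) no sign-blind alignment on concentrating balls along any sequence of times
      -- (finite-dissipation form of Barker–Prange 2020, Thm 3)
      ¬ (∃ a : ℝ, 0 < a ∧ ∃ d : ℝ, 0 ≤ d ∧ ∃ η : ℝ → ℝ, Filter.Tendsto η (𝓝[>] 0) (𝓝 0) ∧
          ∃ tseq : ℕ → ℝ, (∀ n, tseq n < 0) ∧ Filter.Tendsto tseq Filter.atTop (𝓝 0) ∧
          ∀ n, ∀ x ∈ Metric.ball (0 : EuclideanSpace ℝ (Fin 3)) (a * Real.sqrt (-tseq n)),
            ∀ y ∈ Metric.ball (0 : EuclideanSpace ℝ (Fin 3)) (a * Real.sqrt (-tseq n)),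
              d < ‖Literature.Analysis.FluidPDE.curl (W (tseq n)) x‖ →
              d < ‖Literature.Analysis.FluidPDE.curl (W (tseq n)) y‖ →
              min ‖Literature.Analysis.FluidPDE.vorticityDirection
                      (Literature.Analysis.FluidPDE.curl (W (tseq n))) x -
                    Literature.Analysis.FluidPDE.vorticityDirection
                      (Literature.Analysis.FluidPDE.curl (W (tseq n))) y‖
                  ‖Literature.Analysis.FluidPDE.vorticityDirection
                      (Literature.Analysis.FluidPDE.curl (W (tseq n))) x +
                    Literature.Analysis.FluidPDE.vorticityDirection
                      (Literature.Analysis.FluidPDE.curl (W (tseq n))) y‖ ≤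
                η ‖x - y‖) →
      -- (v16) core energy FLOOR in every similarity ball `B(0, r√(−t))`, at every instant …
      (∀ r > 0, ∃ δ > 0, ∀ t < 0, ENNReal.ofReal (δ * Real.sqrt (-t)) <
        ∫⁻ x in Metric.ball (0 : EuclideanSpace ℝ (Fin 3)) (r * Real.sqrt (-t)), ‖W t x‖ₑ ^ 2) →
      -- … and core energy CEILING `≤ Λ r` on `(−r², 0)` around every centre (no concentration)
      (∃ Λ : NNReal, ∀ (x₀ : EuclideanSpace ℝ (Fin 3)) (r : ℝ), 0 < r →
        ∀ t ∈ Set.Ioo (-r ^ 2) 0,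
          ∫⁻ x in Metric.ball x₀ r, ‖W t x‖ₑ ^ 2 ≤ ENNReal.ofReal r * Λ) →
      -- (v21) the POINT GROUP: no small-angle rotational symmetry about any apex axis on the
      -- similarity ball, at any instant …
      (∃ α₀ > 0, ∃ R > 0, ∀ t < 0,
        ∀ g : EuclideanSpace ℝ (Fin 3) ≃ₗᵢ[ℝ] EuclideanSpace ℝ (Fin 3), ∀ α : ℝ, 0 < α → α ≤ α₀ →
          ∃ x ∈ Metric.ball (0 : EuclideanSpace ℝ (Fin 3)) (R * Real.sqrt (-t)),
            W t (g (Literature.Analysis.FluidPDE.rotZ α (g.symm x))) ≠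
              g (Literature.Analysis.FluidPDE.rotZ α (g.symm (W t x)))) →
      -- … and every `O(3)`-symmetry of a slice on the similarity ball has finite order `≤ N`
      (∃ N : ℕ, 0 < N ∧ ∃ R > 0, ∀ t < 0,
        ∀ S : EuclideanSpace ℝ (Fin 3) ≃ₗᵢ[ℝ] EuclideanSpace ℝ (Fin 3),
          (∀ x ∈ Metric.ball (0 : EuclideanSpace ℝ (Fin 3)) (R * Real.sqrt (-t)),
            W t (S x) = S (W t x)) →
          ∃ k : ℕ, 0 < k ∧ k ≤ N ∧ S ^ k = 1) →
      -- (v22/v23) CATEGORY + MINIMALITY on the scaling hull: unless `W` is past-DSS, for every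
      -- sequence of fields continuous on the open past some scaling limit of `W` in `𝒟_{C,K_c}`,
      -- again a critical element (SINGULAR, UNIFORMLY RECURRENT), lies on none of their scaling
      -- orbits (no isolated / countable wandering residue)
      ((∀ c : ℝ, 1 < c → ¬ (∀ t : ℝ, t < 0 → ∀ x, c • W (c ^ 2 * t) (c • x) = W t x)) →
        ∀ V : ℕ → ℝ → EuclideanSpace ℝ (Fin 3) → EuclideanSpace ℝ (Fin 3),
          (∀ i, ContinuousOn (Function.uncurry (V i)) (Set.Iio 0 ×ˢ Set.univ)) →
          ∃ W' : ℝ → EuclideanSpace ℝ (Fin 3) → EuclideanSpace ℝ (Fin 3),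
            Literature.Analysis.FluidPDE.IsTypeIAncientMild C W' ∧
            (∀ s : ℝ, s < 0 → ∫⁻ x, ‖fderiv ℝ (W' s) x‖ₑ ^ 2 ≤ ENNReal.ofReal (Kc / Real.sqrt (-s))) ∧
            (∀ r > 0, ∀ M : ℝ, ∃ t ∈ Set.Ioo (-(r ^ 2)) (0 : ℝ),
              ∃ x ∈ Metric.ball (0 : EuclideanSpace ℝ (Fin 3)) r, M < ‖W' t x‖) ∧
            (∀ ε > 0, ∀ R > 1, ∃ L > 0, ∀ a : ℝ, ∃ σ ∈ Set.Icc a (a + L),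
              ∀ s ∈ Set.Icc (-(R ^ 2)) (-(R⁻¹) ^ 2),
              ∀ y ∈ Metric.closedBall (0 : EuclideanSpace ℝ (Fin 3)) R,
                ‖Real.exp σ • W' (Real.exp (2 * σ) * s) (Real.exp σ • y) - W' s y‖ ≤ ε) ∧
            (∃ l : ℕ → ℝ, (∀ k, 0 < l k) ∧
              ∀ t < 0, ∀ x, Filter.Tendsto
                (fun k => Literature.Analysis.FluidPDE.nsRescale (l k) W t x) Filter.atTop
                (𝓝 (W' t x))) ∧
            ∀ i : ℕ, ∀ c : ℝ, 0 < c → ∃ t : ℝ, t < 0 ∧ ∃ x,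
              W' t x ≠ Literature.Analysis.FluidPDE.nsRescale c (V i) t x) →
      -- (v24/v25) QUASI-REGULARITY (invariant measures on the scaling hull + Birkhoff): every
      -- observable continuous along `𝒟_{C,K_c}` for uniform convergence on the slab pieces is
      -- bounded on the scaling orbit of `W` and has convergent Cesàro means along the blow-up
      -- sequence `W_{2^{−k}}`
      (∀ G : (ℝ → EuclideanSpace ℝ (Fin 3) → EuclideanSpace ℝ (Fin 3)) → ℝ,
        (∀ (v : ℕ → ℝ → EuclideanSpace ℝ (Fin 3) → EuclideanSpace ℝ (Fin 3))
            (w : ℝ → EuclideanSpace ℝ (Fin 3) → EuclideanSpace ℝ (Fin 3)),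
          (∀ j, Literature.Analysis.FluidPDE.IsTypeIAncientMild C (v j)) →
          (∀ j, ∀ s : ℝ, s < 0 →
            ∫⁻ x, ‖fderiv ℝ (v j s) x‖ₑ ^ 2 ≤ ENNReal.ofReal (Kc / Real.sqrt (-s))) →
          Literature.Analysis.FluidPDE.IsTypeIAncientMild C w →
          (∀ s : ℝ, s < 0 → ∫⁻ x, ‖fderiv ℝ (w s) x‖ₑ ^ 2 ≤ ENNReal.ofReal (Kc / Real.sqrt (-s))) →
          (∀ n : ℕ, TendstoUniformlyOn (fun j z => v j z.1 z.2) (fun z => w z.1 z.2) Filter.atTop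
            (Set.Icc (-((n : ℝ) + 2)) (-(1 / ((n : ℝ) + 2))) ×ˢ
              Metric.closedBall (0 : EuclideanSpace ℝ (Fin 3)) ((n : ℝ) + 2))) →
          Filter.Tendsto (fun j => G (v j)) Filter.atTop (𝓝 (G w))) →
        (∃ B : ℝ, ∀ c : ℝ, 0 < c → |G (Literature.Analysis.FluidPDE.nsRescale c W)| ≤ B) ∧
        ∃ ℓ : ℝ, Filter.Tendsto (fun N : ℕ => (N : ℝ)⁻¹ * ∑ k ∈ Finset.range N,
          G (Literature.Analysis.FluidPDE.nsRescale ((1 / 2 : ℝ) ^ k) W)) Filter.atTop (𝓝 ℓ)) →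
      -- (v25) MEAN CORE ENERGY: for every similarity radius the scaled core energies along the
      -- blow-up sequence `t_k = −4^{−k}` are `> δ` at every instant AND have a Cesàro mean `ℓ ≥ δ`
      (∀ r > 0, ∃ δ > 0, ∃ ℓ : ℝ, δ ≤ ℓ ∧
        (∀ t < 0, ENNReal.ofReal (δ * Real.sqrt (-t)) <
          ∫⁻ x in Metric.ball (0 : EuclideanSpace ℝ (Fin 3)) (r * Real.sqrt (-t)), ‖W t x‖ₑ ^ 2) ∧
        Filter.Tendsto (fun N : ℕ => (N : ℝ)⁻¹ * ∑ k ∈ Finset.range N,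
          (((1 / 2 : ℝ) ^ k)⁻¹ *
            (∫⁻ y in Metric.ball (0 : EuclideanSpace ℝ (Fin 3)) ((1 / 2 : ℝ) ^ k * r),
              ‖W (-(((1 / 2 : ℝ) ^ k) ^ 2)) y‖ₑ ^ 2).toReal)) Filter.atTop (𝓝 ℓ)) →
      -- (v26) THE LAW IS ATTAINED ON THE HULL (extremal critical element): some scaling limit of
      -- `W` in `𝒟_{C,K_c}` — SINGULAR, UNIFORMLY RECURRENT, with a gradient envelope — saturates
      -- Leray's law exactly at `t = −1`
      (∃ (W' : ℝ → EuclideanSpace ℝ (Fin 3) → EuclideanSpace ℝ (Fin 3)) (L' : ℝ),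
        Literature.Analysis.FluidPDE.IsTypeIAncientMild C W' ∧
        (∀ s : ℝ, s < 0 → ∫⁻ x, ‖fderiv ℝ (W' s) x‖ₑ ^ 2 ≤ ENNReal.ofReal (Kc / Real.sqrt (-s))) ∧
        (∀ r > 0, ∀ M : ℝ, ∃ t ∈ Set.Ioo (-(r ^ 2)) (0 : ℝ),
          ∃ x ∈ Metric.ball (0 : EuclideanSpace ℝ (Fin 3)) r, M < ‖W' t x‖) ∧
        (∀ ε > 0, ∀ R > 1, ∃ L > 0, ∀ a : ℝ, ∃ σ ∈ Set.Icc a (a + L),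
          ∀ s ∈ Set.Icc (-(R ^ 2)) (-(R⁻¹) ^ 2),
          ∀ y ∈ Metric.closedBall (0 : EuclideanSpace ℝ (Fin 3)) R,
            ‖Real.exp σ • W' (Real.exp (2 * σ) * s) (Real.exp σ • y) - W' s y‖ ≤ ε) ∧
        (∃ l : ℕ → ℝ, (∀ k, 0 < l k) ∧
          ∀ t < 0, ∀ x, Filter.Tendsto
            (fun k => Literature.Analysis.FluidPDE.nsRescale (l k) W t x) Filter.atTop (𝓝 (W' t x))) ∧
        (∀ t : ℝ, t < 0 → ∀ x, ‖fderiv ℝ (W' t) x‖ ≤ L' / (‖x‖ + Real.sqrt (-t)) ^ 2) ∧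
        ∫⁻ x, ‖fderiv ℝ (W' (-1)) x‖ₑ ^ 2 = ENNReal.ofReal Kc) →
      -- (v27) RETURN TIMES: no short almost-returns of the scaling orbit — for factors in every
      -- compact range below the stratum's threshold `λ₀` and every window, the `μ`-displacement
      -- exceeds `δ` somewhere on the window …
      (∃ lam₀ : ℝ, 1 < lam₀ ∧ ∀ μ₁ μ₂ : ℝ, 1 < μ₁ → μ₁ ≤ μ₂ → μ₂ < lam₀ → ∀ R : ℝ, 1 < R →
        ∃ δ : ℝ, 0 < δ ∧ ∀ μ ∈ Set.Icc μ₁ μ₂, ∃ s ∈ Set.Icc (-(R ^ 2)) (-(R⁻¹) ^ 2),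
          ∃ y ∈ Metric.closedBall (0 : EuclideanSpace ℝ (Fin 3)) R,
            δ < ‖μ • W (μ ^ 2 * s) (μ • y) - W s y‖) →
      -- … (v27) and grows at least linearly in the lag: `> κ log μ` for every `1 < μ ≤ μ₂ < λ₀`
      -- on the window `[−(μ₂R)², −(μ₂R)⁻²] × B̄(0, μ₂R)`
      (∃ lam₀ : ℝ, 1 < lam₀ ∧ ∀ μ₂ : ℝ, 1 < μ₂ → μ₂ < lam₀ → ∀ R : ℝ, 1 < R →
        ∃ κ : ℝ, 0 < κ ∧ ∀ μ : ℝ, 1 < μ → μ ≤ μ₂ →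
          ∃ s ∈ Set.Icc (-((μ₂ * R) ^ 2)) (-((μ₂ * R)⁻¹) ^ 2),
            ∃ y ∈ Metric.closedBall (0 : EuclideanSpace ℝ (Fin 3)) (μ₂ * R),
              κ * Real.log μ < ‖μ • W (μ ^ 2 * s) (μ • y) - W s y‖) →
      -- (v28) DENSE FLICKER: no calm parabolic sub-ball anywhere in the similarity region — for
      -- every similarity radius `ρ` and sub-ball radius `r > 0` the unsteadiness exceeds some
      -- `δ > 0` somewhere in EVERY ball `B(x₀, r√(−t))`, `‖x₀‖ ≤ ρ√(−t)`, at EVERY instant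
      (∀ ρ r : ℝ, 0 < r → ∃ δ > 0, ∀ t < 0, ∀ x₀ : EuclideanSpace ℝ (Fin 3),
        ‖x₀‖ ≤ ρ * Real.sqrt (-t) → ∃ x ∈ Metric.ball x₀ (r * Real.sqrt (-t)),
          δ < ‖Real.sqrt (-t) • ((-t) • deriv (fun τ => W τ x) t - (1 / 2 : ℝ) • W t x -
            (1 / 2 : ℝ) • fderiv ℝ (W t) x x)‖) →
      -- (v28) … and VORTICITY FLICKER: the vorticity unsteadiness `∂ₛΩ`, i.e.
      -- `(−t)((−t)∂ₜω − ω − ½(x·∇)ω)` with `ω = curl W`, likewise exceeds some `δ > 0` somewhere in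
      -- every such ball at every instant — `∂ₛU` is nowhere a gradient up to a small curl
      (∀ ρ r : ℝ, 0 < r → ∃ δ > 0, ∀ t < 0, ∀ x₀ : EuclideanSpace ℝ (Fin 3),
        ‖x₀‖ ≤ ρ * Real.sqrt (-t) → ∃ x ∈ Metric.ball x₀ (r * Real.sqrt (-t)),
          δ < ‖(-t) • ((-t) • deriv (fun τ => Literature.Analysis.FluidPDE.curl (W τ) x) t -
            Literature.Analysis.FluidPDE.curl (W t) x -
            (1 / 2 : ℝ) • fderiv ℝ (Literature.Analysis.FluidPDE.curl (W t)) x x)‖) →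
      -- (v29) … and the flicker carries DEFINITE `L¹`-MASS in every such ball:
      -- `∫_{B(x₀, r√(−t))} ‖unsteadiness‖ > δ (√(−t))³`, i.e. `∫_{B(c,r)} ‖∂ₛU‖ dy > δ`
      (∀ ρ r : ℝ, 0 < r → ∃ δ > 0, ∀ t < 0, ∀ x₀ : EuclideanSpace ℝ (Fin 3),
        ‖x₀‖ ≤ ρ * Real.sqrt (-t) →
          δ * Real.sqrt (-t) ^ 3 < ∫ x in Metric.ball x₀ (r * Real.sqrt (-t)),
            ‖Real.sqrt (-t) • ((-t) • deriv (fun τ => W τ x) t - (1 / 2 : ℝ) • W t x -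
              (1 / 2 : ℝ) • fderiv ℝ (W t) x x)‖) →
      -- (v29) … while the FLICKER ENVELOPE confines it to the parabolic core:
      -- `‖unsteadiness(t,x)‖ ≤ c √(−t)/(‖x‖ + √(−t))`, i.e. `‖∂ₛU(y)‖ ≤ c/(1 + ‖y‖)`
      (∃ c : ℝ, 0 ≤ c ∧ ∀ t : ℝ, t < 0 → ∀ x : EuclideanSpace ℝ (Fin 3),
        ‖Real.sqrt (-t) • ((-t) • deriv (fun τ => W τ x) t - (1 / 2 : ℝ) • W t x -
          (1 / 2 : ℝ) • fderiv ℝ (W t) x x)‖ ≤ c * (Real.sqrt (-t) / (‖x‖ + Real.sqrt (-t)))) →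
      -- (v30) THRESHOLD ONE (lead g14, `…ThresholdOne`): the crux HOLDS on `𝒟_{C',K_c}` for every
      -- Type-I constant `C' ≤ 1 + ε`, some `ε = ε(K_c) > 0` — the law-free Liouville threshold
      -- `C < 1` of T31⁗ is not attained under the law and is exceeded by a definite amount — so
      -- the critical element has `1 + ε < C`
      (∃ ε : ℝ, 0 < ε ∧
        (∀ C' : ℝ, C' ≤ 1 + ε → ∀ u : ℝ → EuclideanSpace ℝ (Fin 3) → EuclideanSpace ℝ (Fin 3),
          Literature.Analysis.FluidPDE.IsTypeIAncientMild C' u →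
          (∀ s : ℝ, s < 0 → ∫⁻ x, ‖fderiv ℝ (u s) x‖ₑ ^ 2 ≤ ENNReal.ofReal (Kc / Real.sqrt (-s))) →
          ¬ (∀ r > 0, ∀ M : ℝ, ∃ t ∈ Set.Ioo (-(r ^ 2)) (0 : ℝ),
            ∃ x ∈ Metric.ball (0 : EuclideanSpace ℝ (Fin 3)) r, M < ‖u t x‖)) ∧
        1 + ε < C) →
      -- (v31) STRETCHING SATURATION (lead g14, `…ThresholdSaturation`): some SINGULAR member of
      -- `𝒟_{C,K_c}`, a pointwise limit of rescalings of `W`, is a near-extremal of the stretching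
      -- step `|⟪U, DΩ Ω⟫| ≤ C‖DΩ Ω‖` of the similarity enstrophy budget: for every cutoff radius,
      -- `2∫φ_R(C − ‖V(−1)‖)‖D(curl V(−1))[curl V(−1)]‖ ≤ ½(C²−1)⁺·‖curlCLM‖²·K_c`
      (∃ V : ℝ → EuclideanSpace ℝ (Fin 3) → EuclideanSpace ℝ (Fin 3),
        Literature.Analysis.FluidPDE.IsTypeIAncientMild C V ∧
        (∀ s : ℝ, s < 0 → ∫⁻ x, ‖fderiv ℝ (V s) x‖ₑ ^ 2 ≤ ENNReal.ofReal (Kc / Real.sqrt (-s))) ∧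
        (∀ r > 0, ∀ M : ℝ, ∃ t ∈ Set.Ioo (-(r ^ 2)) (0 : ℝ),
          ∃ x ∈ Metric.ball (0 : EuclideanSpace ℝ (Fin 3)) r, M < ‖V t x‖) ∧
        (∃ l : ℕ → ℝ, (∀ k, 0 < l k) ∧ ∀ t < 0, ∀ x, Filter.Tendsto
          (fun k => Literature.Analysis.FluidPDE.nsRescale (l k) W t x) Filter.atTop (𝓝 (V t x))) ∧
        ∀ R : ℝ, 0 < R →
          2 * (∫ y, Real.smoothTransition (2 - ‖y‖ ^ 2 / R ^ 2) *
            ((C - ‖V (-1) y‖) *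
              ‖fderiv ℝ (Literature.Analysis.FluidPDE.curl (V (-1))) y
                (Literature.Analysis.FluidPDE.curl (V (-1)) y)‖)) ≤
            (1 / 2) * max (C ^ 2 - 1) 0 *
              (‖Literature.Analysis.FluidPDE.curlCLM‖ ^ 2 * max Kc 0)) →
      -- (v32) SHARPER EXPLICIT SMALL-DISSIPATION RUNG (lead g14, `…SmallDissipationGapSharper`): the
      -- weighted Ladyzhenskaya budget kills every member with `(√(max K_c 0)·(√K_S)³)⁴ < 64/27`, so
      (64 / 27 : ℝ) ≤ (Real.sqrt (max Kc 0) *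
          Real.sqrt (MeasureTheory.SNormLESNormFDerivOfEqConst (EuclideanSpace ℝ (Fin 3))
            (MeasureTheory.volume : MeasureTheory.Measure (EuclideanSpace ℝ (Fin 3))) 2 : ℝ) ^ 3) ^ 4 →
      -- (v33) THE DISSIPATION THRESHOLD (lead g14, `…ThresholdK`): the crux HOLDS on `𝒟_{C,K}` for every
      -- `K` with `θ(K)⁴ ≤ 64/27 + ε'`, some `ε' = ε'(C) > 0` — the explicit rung is not attained and is
      -- exceeded by a definite amount — so the critical constant has `64/27 + ε' < θ(K_c)⁴`
      (∃ ε' : ℝ, 0 < ε' ∧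
        (∀ K : ℝ, (Real.sqrt (max K 0) *
            Real.sqrt (MeasureTheory.SNormLESNormFDerivOfEqConst (EuclideanSpace ℝ (Fin 3))
              (MeasureTheory.volume : MeasureTheory.Measure (EuclideanSpace ℝ (Fin 3))) 2 : ℝ) ^ 3) ^ 4
              ≤ 64 / 27 + ε' →
          ∀ u : ℝ → EuclideanSpace ℝ (Fin 3) → EuclideanSpace ℝ (Fin 3),
            Literature.Analysis.FluidPDE.IsTypeIAncientMild C u →
            (∀ s : ℝ, s < 0 → ∫⁻ x, ‖fderiv ℝ (u s) x‖ₑ ^ 2 ≤ ENNReal.ofReal (K / Real.sqrt (-s))) →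
            ¬ (∀ r > 0, ∀ M : ℝ, ∃ t ∈ Set.Ioo (-(r ^ 2)) (0 : ℝ),
              ∃ x ∈ Metric.ball (0 : EuclideanSpace ℝ (Fin 3)) r, M < ‖u t x‖)) ∧
        64 / 27 + ε' < (Real.sqrt (max Kc 0) *
            Real.sqrt (MeasureTheory.SNormLESNormFDerivOfEqConst (EuclideanSpace ℝ (Fin 3))
              (MeasureTheory.volume : MeasureTheory.Measure (EuclideanSpace ℝ (Fin 3))) 2 : ℝ) ^ 3) ^ 4) →
      -- (v34a) THE VORTICITY-AMPLITUDE FLOOR ON LONG WINDOWS (lead g15, `…VorticityAmplitudeWindows`):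
      -- the scale-invariant vorticity amplitude exceeds `√3/4 + ε`, `ε = ε(C,K_c) > 0`, somewhere in
      -- every long backward log-window `[Λ²τ, τ/Λ²]`
      (∃ ε : ℝ, 0 < ε ∧ ∃ Λ : ℝ, 1 < Λ ∧ ∀ τ : ℝ, τ < 0 →
        ∃ t ∈ Set.Icc (Λ ^ 2 * τ) (τ / Λ ^ 2), ∃ x : EuclideanSpace ℝ (Fin 3),
          Real.sqrt 3 / 4 + ε < (-t) * ‖Literature.Analysis.FluidPDE.curl (W t) x‖) →
      -- (v34b) THE JOINT VELOCITY / VORTICITY-AMPLITUDE FLOOR (lead g15, `…VorticityAmplitudeJoint`): for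
      -- every `0 < λ ≤ 1` and `C_ω` with `λ²C² + (1−λ)(4/√3)C_ω < 1` the amplitude exceeds `C_ω` somewhere
      (∀ lam Cω : ℝ, 0 < lam → lam ≤ 1 →
        lam ^ 2 * C ^ 2 + (1 - lam) * (4 * Cω * Real.sqrt 3 / 3) < 1 →
        ∃ t : ℝ, t < 0 ∧ ∃ x : EuclideanSpace ℝ (Fin 3),
          Cω < (-t) * ‖Literature.Analysis.FluidPDE.curl (W t) x‖) →
      -- (v35a) THE `L³`-VORTICITY FLOOR (lead g16, `…VorticityLThree`): for every `v ≥ 0` with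
      -- `KS²v² < 3` (`KS` = Mathlib's Gagliardo–Nirenberg–Sobolev constant) some instant has
      -- `(√(−t))³ ∫‖curl W(t)‖³ > v³`, i.e. `sup_t √(−t)‖curl W(t)‖_{L³} ≥ √3/KS`
      (∀ v : ℝ, 0 ≤ v →
        (MeasureTheory.SNormLESNormFDerivOfEqConst (EuclideanSpace ℝ (Fin 3))
            (MeasureTheory.volume : MeasureTheory.Measure (EuclideanSpace ℝ (Fin 3))) 2 : ℝ) ^ 2 *
          v ^ 2 < 3 →
        ∃ t : ℝ, t < 0 ∧ ENNReal.ofReal (v ^ 3 / Real.sqrt (-t) ^ 3) <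
          ∫⁻ x, ‖Literature.Analysis.FluidPDE.curl (W t) x‖ₑ ^ 3) →
      -- (v35b) THE HYPERBOLA FLOOR (lead g16, `…VorticityLThree`): for every bound `C_ω` of the
      -- vorticity amplitude, `KS⁶·(C_ω·‖curlCLM‖²·max K_c 0)² ≥ 27` (product of dissipation constant
      -- and vorticity amplitude bounded below)
      (∀ Cω : ℝ, (∀ t : ℝ, t < 0 → ∀ x : EuclideanSpace ℝ (Fin 3),
          (-t) * ‖Literature.Analysis.FluidPDE.curl (W t) x‖ ≤ Cω) →
        (27 : ℝ) ≤ (MeasureTheory.SNormLESNormFDerivOfEqConst (EuclideanSpace ℝ (Fin 3))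
            (MeasureTheory.volume : MeasureTheory.Measure (EuclideanSpace ℝ (Fin 3))) 2 : ℝ) ^ 6 *
          (Cω * (‖Literature.Analysis.FluidPDE.curlCLM‖ ^ 2 * max Kc 0)) ^ 2) →
      -- (v36) THE `L⁶`-VELOCITY FLOOR (lead g16, `…VelocityLSix`): for every `w ≥ 0` with
      -- `KS²w⁴ < 64/27` some instant has `(√(−t))³ ∫‖W(t)‖⁶ > w⁶`, i.e.
      -- `sup_t (−t)^{1/4}‖W(t)‖_{L⁶} ≥ (64/27)^{1/4}/√KS` (by Sobolev this contains the dissipation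
      -- floor `θ(K_c)⁴ ≥ 64/27` of v32)
      (∀ w : ℝ, 0 ≤ w →
        (MeasureTheory.SNormLESNormFDerivOfEqConst (EuclideanSpace ℝ (Fin 3))
            (MeasureTheory.volume : MeasureTheory.Measure (EuclideanSpace ℝ (Fin 3))) 2 : ℝ) ^ 2 *
          w ^ 4 < 64 / 27 →
        ∃ t : ℝ, t < 0 ∧ ENNReal.ofReal (w ^ 6 / Real.sqrt (-t) ^ 3) < ∫⁻ x, ‖W t x‖ₑ ^ 6) →
      -- (v37) THRESHOLD ONE ON AVERAGE (lead g16, `…AveragedVelocity`): for every continuous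
      -- majorant `γ ≥ 0` of the similarity velocity (`‖lerayOrbit W σ y‖ ≤ γ σ`) and every `Γ₂ < 2`
      -- some backward parabolic mean square `∫_a^s e^{−(s−σ)/2} γ² dσ` exceeds `Γ₂`
      (∀ γ : ℝ → ℝ, Continuous γ → (∀ σ : ℝ, 0 ≤ γ σ) →
        (∀ (σ : ℝ) (y : EuclideanSpace ℝ (Fin 3)),
          ‖Literature.Analysis.FluidPDE.lerayOrbit W σ y‖ ≤ γ σ) →
        ∀ Γ₂ : ℝ, Γ₂ < 2 → ∃ a s : ℝ, a ≤ s ∧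
          Γ₂ < ∫ σ in a..s, Real.exp (-((1 / 2) * (s - σ))) * γ σ ^ 2) →
      -- (v38) THE MIXED-LENS FLOOR (lead g17, `…MixedRegion`): for all weights `0 ≤ λ ≤ 1`,
      -- `μ, κ, δ > 0` not overspending the dissipation, `2λμ + (1−λ)·3(1+δ)/(2κ) ≤ 2`, the contraction
      -- ratio is at least one: `λC²/μ + (1−λ)κ³θ(K_c)⁴ ≥ 1` (the pair `(C, θ(K_c)⁴)` lies outside the
      -- explicit lens `{C ≤ 1 ∧ θ⁴ < 4} ∪ … ⊃ {C < 1} ∪ {θ⁴ < 64/27}` of the proved region)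
      (∀ lam μ κ δ : ℝ, 0 ≤ lam → lam ≤ 1 → 0 < μ → 0 < κ → 0 < δ →
        2 * lam * μ + (1 - lam) * (3 * (1 + δ) / (2 * κ)) ≤ 2 →
        1 ≤ lam * C ^ 2 / μ + (1 - lam) * κ ^ 3 * (Real.sqrt (max Kc 0) *
            Real.sqrt (MeasureTheory.SNormLESNormFDerivOfEqConst (EuclideanSpace ℝ (Fin 3))
              (MeasureTheory.volume : MeasureTheory.Measure (EuclideanSpace ℝ (Fin 3))) 2 : ℝ) ^ 3) ^ 4) →
      -- (v39) THE EVERY-INSTANT ENSTROPHY FLOOR (lead g17, `…EveryInstant`): the dimensionless enstrophy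
      -- never dips below the explicit threshold of the all-time rung:
      -- `(√(√(−t)∫‖curl W(t)‖²dx)·(√K_S)³)⁴ ≥ 64/27` at EVERY instant `t < 0` (forward trapping of the
      -- sub-threshold similarity enstrophy + orbit limits / persistence at the apex)
      (∀ t : ℝ, t < 0 →
        (64 / 27 : ℝ) ≤ (Real.sqrt (Real.sqrt (-t) *
              ∫ x, ‖Literature.Analysis.FluidPDE.curl (W t) x‖ ^ 2) *
            Real.sqrt (MeasureTheory.SNormLESNormFDerivOfEqConst (EuclideanSpace ℝ (Fin 3))
              (MeasureTheory.volume : MeasureTheory.Measure (EuclideanSpace ℝ (Fin 3))) 2 : ℝ) ^ 3) ^ 4) →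
      -- (v40) THE LENS-SHAPED EVERY-INSTANT FLOOR (lead g17, `…EveryInstantMixed`): at every instant and
      -- for all admissible weights `λC²/μ + (1−λ)κ³·max((√(√(−t)∫‖curl W(t)‖²)·(√K_S)³)⁴, 1) ≥ 1`
      -- (trapping inside the mixed lens; for `C ≤ 1` the floor is `4`)
      (∀ t : ℝ, t < 0 → ∀ lam μ κ δ : ℝ, 0 ≤ lam → lam ≤ 1 → 0 < μ → 0 < κ → 0 < δ →
        2 * lam * μ + (1 - lam) * (3 * (1 + δ) / (2 * κ)) ≤ 2 →
        1 ≤ lam * C ^ 2 / μ + (1 - lam) * κ ^ 3 *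
          max ((Real.sqrt (Real.sqrt (-t) * ∫ x, ‖Literature.Analysis.FluidPDE.curl (W t) x‖ ^ 2) *
            Real.sqrt (MeasureTheory.SNormLESNormFDerivOfEqConst (EuclideanSpace ℝ (Fin 3))
              (MeasureTheory.volume : MeasureTheory.Measure (EuclideanSpace ℝ (Fin 3))) 2 : ℝ) ^ 3) ^ 4) 1) →
      -- (v41) THE CROSS-FLOW THRESHOLD ONE IS NOT ATTAINED (lead g17, `…CrossFlowThreshold`): somewhere
      -- the velocity crosses the vorticity strictly faster than the self-similar speed
      (∃ t : ℝ, t < 0 ∧ ∃ x : EuclideanSpace ℝ (Fin 3),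
        ‖Literature.Analysis.FluidPDE.curl (W t) x‖ <
          Real.sqrt (-t) * ‖Literature.Analysis.FluidPDE.cross
            (Literature.Analysis.FluidPDE.curl (W t) x) (W t x)‖) →
      -- (v42) THE PRODUCT THRESHOLD ONE IS EXCEEDED BY A DEFINITE AMOUNT (lead g18,
      -- `…LambProductThreshold/…LambProductCollar`): for some `ε > 0` depending only on the class
      -- constants, somewhere `(1+ε)‖ω‖‖curl ω‖ < √(−t)⟪W, ω × curl ω⟫` (`ω = curl W(t)`): the velocity
      -- component along the vortex-Lamb vector, weighted by `sin∠(ω, curl ω)`, beats the self-similar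
      -- speed by a definite factor (contains v41, the Λ-directional endpoint and threshold one)
      (∃ ε : ℝ, 0 < ε ∧ ∃ t : ℝ, t < 0 ∧ ∃ x : EuclideanSpace ℝ (Fin 3),
        (1 + ε) * (‖Literature.Analysis.FluidPDE.curl (W t) x‖ *
            ‖Literature.Analysis.FluidPDE.curl (Literature.Analysis.FluidPDE.curl (W t)) x‖) <
          Real.sqrt (-t) * ⟪W t x, Literature.Analysis.FluidPDE.cross
            (Literature.Analysis.FluidPDE.curl (W t) x)
            (Literature.Analysis.FluidPDE.curl (Literature.Analysis.FluidPDE.curl (W t)) x)⟫) →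
      -- (v43) THE SPACE CONSTANT EXCEEDS `½` BY A DEFINITE AMOUNT (lead g18, `…LambProductCollar`;
      -- the tree's Hardy row `‖x‖‖V‖ ≤ ½ ⇒ V ≡ 0` plus the collar lemma): somewhere
      -- `½ + ε' < ‖x‖·‖W(t,x)‖`
      (∃ ε : ℝ, 0 < ε ∧ ∃ t : ℝ, t < 0 ∧ ∃ x : EuclideanSpace ℝ (Fin 3), 1 / 2 + ε < ‖x‖ * ‖W t x‖) →
      -- (v44) THE TAYLOR-MICROSCALE WINDOW RECURS (lead g18, `…MicroscaleWindow(Envelope)`): in every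
      -- similarity-time window `[s₁, s₁ + L]` some instant `ξ` has
      -- `2(√D(ξ) − ½C√Z(ξ))² ≤ ½(C²−1)Z(ξ) + ‖curlCLM‖²·max K_c 0/L` (`Z = ∫‖Ω‖²`, `D = ∫‖curl Ω‖²` on
      -- the Leray orbit): up to `O(1/L)` the vorticity Taylor microscale `‖ω‖₂/‖∇ω‖₂` lies in
      -- `[2(C−√(C²−1))√(−t), 2(C+√(C²−1))√(−t)]`
      (∀ s₁ : ℝ, ∀ L : ℝ, 0 < L → ∃ ξ ∈ Set.Icc s₁ (s₁ + L),
        2 * (Real.sqrt (∫ y, ‖Literature.Analysis.FluidPDE.curl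
              (Literature.Analysis.FluidPDE.lerayVorticity W ξ) y‖ ^ 2) -
            (1 / 2) * C * Real.sqrt (∫ y, ‖Literature.Analysis.FluidPDE.lerayVorticity W ξ y‖ ^ 2)) ^ 2 ≤
          (1 / 2) * (C ^ 2 - 1) * (∫ y, ‖Literature.Analysis.FluidPDE.lerayVorticity W ξ y‖ ^ 2) +
            ‖Literature.Analysis.FluidPDE.curlCLM‖ ^ 2 * max Kc 0 / L) →
      -- (v45) LOCAL ENSTROPHY-PRODUCTION EXCESS, LAMB FORM, FAST AND CENTRAL (lead g18,
      -- `…LocalBalance/…LocalBalanceCore`): for some `ε > 0`, at some `(t,x)` the Lamb-form production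
      -- exceeds `(1+ε)×`(local dissipation + scaling density), the speed exceeds `(1+ε)/√(−t)` and the
      -- point lies in the parabolic core `(1+ε)(‖x‖+√(−t)) < (max C A)√(−t)`
      (∃ ε : ℝ, 0 < ε ∧ ∃ t : ℝ, t < 0 ∧ ∃ x : EuclideanSpace ℝ (Fin 3),
        (1 + ε) * (‖Literature.Analysis.FluidPDE.curl (Literature.Analysis.FluidPDE.curl (W t)) x‖ ^ 2 +
              ‖Literature.Analysis.FluidPDE.curl (W t) x‖ ^ 2 / (4 * (-t))) <
            ⟪W t x, Literature.Analysis.FluidPDE.cross (Literature.Analysis.FluidPDE.curl (W t) x)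
              (Literature.Analysis.FluidPDE.curl (Literature.Analysis.FluidPDE.curl (W t)) x)⟫ ∧
          1 + ε < Real.sqrt (-t) * ‖W t x‖ ∧
          (1 + ε) * (‖x‖ + Real.sqrt (-t)) < max C A * Real.sqrt (-t)) →
      -- (v46) VORTEX STRETCHING BEATS LOCAL DISSIPATION + SCALING SOMEWHERE, BY `1+ε` (lead g18,
      -- `…LocalBalanceStretching`): `(1+ε)(|∇ω|²_F + ‖ω‖²/(4(−t))) < ⟪ω, ∇W ω⟫` at some point
      (∃ ε : ℝ, 0 < ε ∧ ∃ t : ℝ, t < 0 ∧ ∃ x : EuclideanSpace ℝ (Fin 3),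
        (1 + ε) * (Literature.Analysis.FluidPDE.frobeniusNormSq
              (fderiv ℝ (Literature.Analysis.FluidPDE.curl (W t)) x) +
            ‖Literature.Analysis.FluidPDE.curl (W t) x‖ ^ 2 / (4 * (-t))) <
          ⟪Literature.Analysis.FluidPDE.curl (W t) x,
            fderiv ℝ (W t) x (Literature.Analysis.FluidPDE.curl (W t) x)⟫) →
      -- (v47) THE HARDY-WEIGHTED STRETCHING EXCEEDS THE SHARP QUARTER BY `ε` SOMEWHERE (lead g18,
      -- collar of pub-ns-dss's closed row T38): `(¼+ε)‖ω‖² < ‖x‖²⟪∇W ω, ω⟫` at some point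
      (∃ ε : ℝ, 0 < ε ∧ ∃ t : ℝ, t < 0 ∧ ∃ x : EuclideanSpace ℝ (Fin 3),
        (1 / 4 + ε) * ‖Literature.Analysis.FluidPDE.curl (W t) x‖ ^ 2 <
          ‖x‖ ^ 2 * ⟪fderiv ℝ (W t) x (Literature.Analysis.FluidPDE.curl (W t) x),
            Literature.Analysis.FluidPDE.curl (W t) x⟫) →
      -- (v49) A RECURRENT EXPLICIT PALINSTROPHY FLOOR (lead g18, `…MicroscaleWindowPalinstrophy`): in every
      -- similarity-time window some instant has `√D ≥ ½C√Z − √(¼(C²−1)Z + ‖curlCLM‖²max K_c 0/(2L))`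
      -- together with the every-instant enstrophy floor `(√Z·K_S^{3/2})⁴ ≥ 64/27`
      (∀ s₁ : ℝ, ∀ L : ℝ, 0 < L → ∃ ξ ∈ Set.Icc s₁ (s₁ + L),
        (1 / 2) * C * Real.sqrt (∫ y, ‖Literature.Analysis.FluidPDE.lerayVorticity W ξ y‖ ^ 2) -
            Real.sqrt (((1 / 2) * (C ^ 2 - 1) *
                (∫ y, ‖Literature.Analysis.FluidPDE.lerayVorticity W ξ y‖ ^ 2) +
              ‖Literature.Analysis.FluidPDE.curlCLM‖ ^ 2 * max Kc 0 / L) / 2) ≤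
          Real.sqrt (∫ y, ‖Literature.Analysis.FluidPDE.curl
            (Literature.Analysis.FluidPDE.lerayVorticity W ξ) y‖ ^ 2) ∧
        64 / 27 ≤ (Real.sqrt (∫ y, ‖Literature.Analysis.FluidPDE.lerayVorticity W ξ y‖ ^ 2) *
          Real.sqrt (MeasureTheory.SNormLESNormFDerivOfEqConst (EuclideanSpace ℝ (Fin 3))
            (MeasureTheory.volume : MeasureTheory.Measure (EuclideanSpace ℝ (Fin 3))) 2 : ℝ) ^ 3) ^ 4) →
      -- (v50) THE EXCESS ACCUMULATES AT THE APEX (lead g18, `…LocalBalanceApex`): for every `τ < 0` a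
      -- Lamb-form production excess point with `τ ≤ t < 0`
      (∀ τ : ℝ, τ < 0 → ∃ t : ℝ, τ ≤ t ∧ t < 0 ∧ ∃ x : EuclideanSpace ℝ (Fin 3),
        ‖Literature.Analysis.FluidPDE.curl (Literature.Analysis.FluidPDE.curl (W t)) x‖ ^ 2 +
            ‖Literature.Analysis.FluidPDE.curl (W t) x‖ ^ 2 / (4 * (-t)) <
          ⟪W t x, Literature.Analysis.FluidPDE.cross (Literature.Analysis.FluidPDE.curl (W t) x)
            (Literature.Analysis.FluidPDE.curl (Literature.Analysis.FluidPDE.curl (W t)) x)⟫) →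
      -- (v51) THE SUPER-SELF-SIMILAR SPEED RECEDES TO `−∞` (lead g18, `…LocalBalanceFarPast`): for every
      -- `τ < 0` a point with `t ≤ τ` and `1 < √(−t)‖W(t,x)‖`
      (∀ τ : ℝ, τ < 0 → ∃ t : ℝ, t ≤ τ ∧ t < 0 ∧ ∃ x : EuclideanSpace ℝ (Fin 3),
        1 < Real.sqrt (-t) * ‖W t x‖) →
      -- (v52) THE ENSTROPHY DENSITY `t²‖ω‖²` IS STRICTLY SUPER-CALORIC AT POINTS ACCUMULATING AT THE
      -- APEX (lead g18, `…CriticalProductionLawApex`, crux frame: Type-I + law): for every `τ < 0` a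
      -- point with `τ ≤ s < 0` and `‖ω‖² < (−s)(⟪ω, ∇W ω⟫ − |∇ω|²_F)`
      (∀ τ : ℝ, τ < 0 → ∃ s : ℝ, τ ≤ s ∧ s < 0 ∧ ∃ y : EuclideanSpace ℝ (Fin 3),
        ⟪Literature.Analysis.FluidPDE.curl (W s) y, Literature.Analysis.FluidPDE.curl (W s) y⟫ <
          (-s) * (⟪Literature.Analysis.FluidPDE.curl (W s) y, fderiv ℝ (W s) y (Literature.Analysis.FluidPDE.curl (W s) y)⟫ -
            Literature.Analysis.FluidPDE.frobeniusNormSq (fderiv ℝ (Literature.Analysis.FluidPDE.curl (W s)) y))) →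
      -- (v53) … AND AT POINTS RECEDING TO `−∞` (lead g18, `…CriticalProductionLawFarPast`)
      (∀ τ : ℝ, τ < 0 → ∃ s : ℝ, s ≤ τ ∧ ∃ y : EuclideanSpace ℝ (Fin 3),
        ⟪Literature.Analysis.FluidPDE.curl (W s) y, Literature.Analysis.FluidPDE.curl (W s) y⟫ <
          (-s) * (⟪Literature.Analysis.FluidPDE.curl (W s) y, fderiv ℝ (W s) y (Literature.Analysis.FluidPDE.curl (W s) y)⟫ -
            Literature.Analysis.FluidPDE.frobeniusNormSq (fderiv ℝ (Literature.Analysis.FluidPDE.curl (W s)) y))) →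
      -- (v54) THE SUPER-SELF-SIMILAR SPEED RECURS WITH BOUNDED GAPS AT EVERY SCALE (lead g19,
      -- `…WindowRecurrence`): one `ε ∈ (0,1)` such that EVERY window `[−c², −εc²]` contains a point
      -- with `1 < √(−t)‖W(t,x)‖` — the fast set is never empty for more than `|log ε|` e-folds
      (∃ ε : ℝ, 0 < ε ∧ ε < 1 ∧ ∀ c : ℝ, 0 < c → ∃ t ∈ Set.Icc (-c ^ 2) (-(ε * c ^ 2)),
        ∃ x : EuclideanSpace ℝ (Fin 3), 1 < Real.sqrt (-t) * ‖W t x‖) →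
      -- (v55) THE LAMB-FORM LOCAL PRODUCTION EXCESS RECURS WITH BOUNDED GAPS (lead g19,
      -- `…WindowRecurrence`)
      (∃ ε : ℝ, 0 < ε ∧ ε < 1 ∧ ∀ c : ℝ, 0 < c → ∃ t ∈ Set.Icc (-c ^ 2) (-(ε * c ^ 2)),
        ∃ x : EuclideanSpace ℝ (Fin 3),
        ‖Literature.Analysis.FluidPDE.curl (Literature.Analysis.FluidPDE.curl (W t)) x‖ ^ 2 + ‖Literature.Analysis.FluidPDE.curl (W t) x‖ ^ 2 / (4 * (-t)) <
          ⟪W t x, Literature.Analysis.FluidPDE.cross (Literature.Analysis.FluidPDE.curl (W t) x) (Literature.Analysis.FluidPDE.curl (Literature.Analysis.FluidPDE.curl (W t)) x)⟫) →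
      -- (v56) THE VORTEX-STRETCHING EXCESS RECURS WITH BOUNDED GAPS (lead g19,
      -- `…WindowRecurrenceStretching`)
      (∃ ε : ℝ, 0 < ε ∧ ε < 1 ∧ ∀ c : ℝ, 0 < c → ∃ t ∈ Set.Icc (-c ^ 2) (-(ε * c ^ 2)),
        ∃ x : EuclideanSpace ℝ (Fin 3),
        Literature.Analysis.FluidPDE.frobeniusNormSq (fderiv ℝ (Literature.Analysis.FluidPDE.curl (W t)) x) + ‖Literature.Analysis.FluidPDE.curl (W t) x‖ ^ 2 / (4 * (-t)) <
          ⟪Literature.Analysis.FluidPDE.curl (W t) x, fderiv ℝ (W t) x (Literature.Analysis.FluidPDE.curl (W t) x)⟫) →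
      -- (v57) SUPER-CALORICITY OF `t²‖ω‖²` RECURS WITH BOUNDED GAPS (lead g19,
      -- `…WindowRecurrenceProduction`, crux frame): EVERY window `[−c², −εc²]` contains a point with
      -- `‖ω‖² < (−s)(⟪ω, ∇W ω⟫ − |∇ω|²_F)`
      (∃ ε : ℝ, 0 < ε ∧ ε < 1 ∧ ∀ c : ℝ, 0 < c → ∃ s ∈ Set.Icc (-c ^ 2) (-(ε * c ^ 2)),
        ∃ y : EuclideanSpace ℝ (Fin 3),
        ⟪Literature.Analysis.FluidPDE.curl (W s) y, Literature.Analysis.FluidPDE.curl (W s) y⟫ <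
          (-s) * (⟪Literature.Analysis.FluidPDE.curl (W s) y, fderiv ℝ (W s) y (Literature.Analysis.FluidPDE.curl (W s) y)⟫ -
            Literature.Analysis.FluidPDE.frobeniusNormSq (fderiv ℝ (Literature.Analysis.FluidPDE.curl (W s)) y))) →
      -- (v58) THE FAST SET FILLS A DEFINITE FRACTION OF THE SELF-SIMILAR CORE AT EVERY SCALE (lead
      -- g19, `…WindowVolumeScaling`): `ε ∈ (0,1)`, `η > 0` with, for every `c > 0`: the fast part of the
      -- window `[−c², −εc²] × ℝ³` lies in the parabolic core `‖x‖ < (max C A − 1)√(−t)` and has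
      -- space–time volume `≥ η c⁵`
      (∃ ε : ℝ, 0 < ε ∧ ε < 1 ∧ ∃ η : ℝ, 0 < η ∧ ∀ c : ℝ, 0 < c →
        {p : ℝ × EuclideanSpace ℝ (Fin 3) | p.1 ∈ Set.Icc (-c ^ 2) (-(ε * c ^ 2)) ∧
            1 < Real.sqrt (-p.1) * ‖W p.1 p.2‖} ⊆
          {p : ℝ × EuclideanSpace ℝ (Fin 3) | p.1 ∈ Set.Icc (-c ^ 2) (-(ε * c ^ 2)) ∧
            ‖p.2‖ < (max C A - 1) * Real.sqrt (-p.1)} ∧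
        ENNReal.ofReal (η * c ^ 5) ≤ MeasureTheory.volume {p : ℝ × EuclideanSpace ℝ (Fin 3) |
          p.1 ∈ Set.Icc (-c ^ 2) (-(ε * c ^ 2)) ∧ 1 < Real.sqrt (-p.1) * ‖W p.1 p.2‖}) →
      -- (v59) THE SUPER-SELF-SIMILAR INSTANTS HAVE DEFINITE TEMPORAL DENSITY AT EVERY SCALE (lead g19,
      -- `…WindowFastTimes`): `ε ∈ (0,1)`, `κ > 0` with, for every `c > 0`, the instants
      -- `t ∈ [−c², −εc²]` carrying a point of speed `> 1/√(−t)` of Lebesgue measure `≥ κ c²`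
      (∃ ε : ℝ, 0 < ε ∧ ε < 1 ∧ ∃ κ : ℝ, 0 < κ ∧ ∀ c : ℝ, 0 < c →
        ENNReal.ofReal (κ * c ^ 2) ≤ MeasureTheory.volume {t : ℝ |
          t ∈ Set.Icc (-c ^ 2) (-(ε * c ^ 2)) ∧ ∃ x : EuclideanSpace ℝ (Fin 3), 1 < Real.sqrt (-t) * ‖W t x‖}) →
      -- (v60) THE SPEED EXCEEDS THE SELF-SIMILAR RATE BY A DEFINITE FACTOR ON A SET OF DEFINITE
      -- VOLUME IN EVERY WINDOW (lead g19, `…WindowCollar`): `ε ∈ (0,1)`, `δ, η > 0` with, for every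
      -- `c > 0`, `vol{(t,x) ∈ [−c², −εc²] × ℝ³ : √(−t)‖W(t,x)‖ > 1 + δ} ≥ η c⁵`
      (∃ ε : ℝ, 0 < ε ∧ ε < 1 ∧ ∃ δ : ℝ, 0 < δ ∧ ∃ η : ℝ, 0 < η ∧ ∀ c : ℝ, 0 < c →
        ENNReal.ofReal (η * c ^ 5) ≤ MeasureTheory.volume {p : ℝ × EuclideanSpace ℝ (Fin 3) |
          p.1 ∈ Set.Icc (-c ^ 2) (-(ε * c ^ 2)) ∧ 1 + δ < Real.sqrt (-p.1) * ‖W p.1 p.2‖}) →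
      -- (v61) THE STRETCHING-EXCESS INSTANTS HAVE DEFINITE TEMPORAL DENSITY (lead g19,
      -- `…WindowGradientCore`): `ε ∈ (0,1)`, `κ > 0` with, for every `c > 0`, the instants of
      -- `[−c², −εc²]` carrying a point with `|∇ω|²_F + ‖ω‖²/(4(−t)) < ⟪ω, ∇W ω⟫` of measure `≥ κ c²`
      (∃ ε : ℝ, 0 < ε ∧ ε < 1 ∧ ∃ κ : ℝ, 0 < κ ∧ ∀ c : ℝ, 0 < c →
        ENNReal.ofReal (κ * c ^ 2) ≤ MeasureTheory.volume {t : ℝ | t ∈ Set.Icc (-c ^ 2) (-(ε * c ^ 2)) ∧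
          ∃ x : EuclideanSpace ℝ (Fin 3), Literature.Analysis.FluidPDE.frobeniusNormSq (fderiv ℝ (Literature.Analysis.FluidPDE.curl (W t)) x) +
              ‖Literature.Analysis.FluidPDE.curl (W t) x‖ ^ 2 / (4 * (-t)) <
            ⟪Literature.Analysis.FluidPDE.curl (W t) x, fderiv ℝ (W t) x (Literature.Analysis.FluidPDE.curl (W t) x)⟫}) →
      -- (v62) THE SUPER-CALORIC INSTANTS OF `t²‖ω‖²` HAVE DEFINITE TEMPORAL DENSITY (lead g19,
      -- `…WindowGradientCore`, law + envelope)
      (∃ ε : ℝ, 0 < ε ∧ ε < 1 ∧ ∃ κ : ℝ, 0 < κ ∧ ∀ c : ℝ, 0 < c →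
        ENNReal.ofReal (κ * c ^ 2) ≤ MeasureTheory.volume {t : ℝ | t ∈ Set.Icc (-c ^ 2) (-(ε * c ^ 2)) ∧
          ∃ y : EuclideanSpace ℝ (Fin 3), ⟪Literature.Analysis.FluidPDE.curl (W t) y, Literature.Analysis.FluidPDE.curl (W t) y⟫ <
            (-t) * (⟪Literature.Analysis.FluidPDE.curl (W t) y, fderiv ℝ (W t) y (Literature.Analysis.FluidPDE.curl (W t) y)⟫ -
              Literature.Analysis.FluidPDE.frobeniusNormSq (fderiv ℝ (Literature.Analysis.FluidPDE.curl (W t)) y))}) →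
      -- (v63) A FAST BLOB OF DEFINITE RELATIVE SIZE IN EVERY WINDOW (lead g19, `…WindowFastBlob`):
      -- `ε ∈ (0,1)`, `ρ, δ > 0` with, for every `c > 0`, a parabolic cylinder
      -- `[t₀ − (ρc)², t₀] × B(x₀, ρc)` inside the window `[−c², −εc²]` on which `√(−t)‖W‖ > 1 + δ`
      (∃ ε : ℝ, 0 < ε ∧ ε < 1 ∧ ∃ ρ : ℝ, 0 < ρ ∧ ∃ δ : ℝ, 0 < δ ∧ ∀ c : ℝ, 0 < c →
        ∃ (t₀ : ℝ) (x₀ : EuclideanSpace ℝ (Fin 3)),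
          Set.Icc (t₀ - (ρ * c) ^ 2) t₀ ⊆ Set.Icc (-c ^ 2) (-(ε * c ^ 2)) ∧
          ∀ t ∈ Set.Icc (t₀ - (ρ * c) ^ 2) t₀, ∀ x ∈ Metric.ball x₀ (ρ * c),
            1 + δ < Real.sqrt (-t) * ‖W t x‖) →
      -- (v64) THE LAMB-FORM PRODUCTION EXCESS BY A FACTOR FILLS A BLOB IN EVERY WINDOW (lead g19,
      -- `…WindowBlobJets`): `ε ∈ (0,1)`, `ρ, δ > 0` with, for every `c > 0`, a parabolic cylinder inside the
      -- window `[−c², −εc²]` on which `(1+δ)(‖curl ω‖² + ‖ω‖²/(4(−t))) < ⟪W, ω × curl ω⟫`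
      (∃ ε : ℝ, 0 < ε ∧ ε < 1 ∧ ∃ ρ : ℝ, 0 < ρ ∧ ∃ δ : ℝ, 0 < δ ∧ ∀ c : ℝ, 0 < c →
        ∃ (t₀ : ℝ) (x₀ : EuclideanSpace ℝ (Fin 3)),
          Set.Icc (t₀ - (ρ * c) ^ 2) t₀ ⊆ Set.Icc (-c ^ 2) (-(ε * c ^ 2)) ∧
          ∀ t ∈ Set.Icc (t₀ - (ρ * c) ^ 2) t₀, ∀ x ∈ Metric.ball x₀ (ρ * c),
            (1 + δ) * (‖Literature.Analysis.FluidPDE.curl (Literature.Analysis.FluidPDE.curl (W t)) x‖ ^ 2 + ‖Literature.Analysis.FluidPDE.curl (W t) x‖ ^ 2 / (4 * (-t))) <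
              ⟪W t x, Literature.Analysis.FluidPDE.cross (Literature.Analysis.FluidPDE.curl (W t) x) (Literature.Analysis.FluidPDE.curl (Literature.Analysis.FluidPDE.curl (W t)) x)⟫) →
      -- (v65) THE VORTEX-STRETCHING EXCESS FILLS A BLOB IN EVERY WINDOW (lead g19, `…WindowBlobProduction`)
      (∃ ε : ℝ, 0 < ε ∧ ε < 1 ∧ ∃ ρ : ℝ, 0 < ρ ∧ ∀ c : ℝ, 0 < c →
        ∃ (t₀ : ℝ) (x₀ : EuclideanSpace ℝ (Fin 3)),
          Set.Icc (t₀ - (ρ * c) ^ 2) t₀ ⊆ Set.Icc (-c ^ 2) (-(ε * c ^ 2)) ∧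
          ∀ t ∈ Set.Icc (t₀ - (ρ * c) ^ 2) t₀, ∀ x ∈ Metric.ball x₀ (ρ * c),
            Literature.Analysis.FluidPDE.frobeniusNormSq (fderiv ℝ (Literature.Analysis.FluidPDE.curl (W t)) x) + ‖Literature.Analysis.FluidPDE.curl (W t) x‖ ^ 2 / (4 * (-t)) <
              ⟪Literature.Analysis.FluidPDE.curl (W t) x, fderiv ℝ (W t) x (Literature.Analysis.FluidPDE.curl (W t) x)⟫) →
      -- (v66) SUPER-CALORICITY WITH AN EXTRA PALINSTROPHY CREDIT FILLS A BLOB IN EVERY WINDOW (lead g19,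
      -- `…WindowBlobProduction`, crux frame): `‖ω‖² < (−t)(⟪ω, ∇W ω⟫ − (1+δ)|∇ω|²_F)` on a cylinder
      (∃ ε : ℝ, 0 < ε ∧ ε < 1 ∧ ∃ ρ : ℝ, 0 < ρ ∧ ∃ δ : ℝ, 0 < δ ∧ ∀ c : ℝ, 0 < c →
        ∃ (t₀ : ℝ) (x₀ : EuclideanSpace ℝ (Fin 3)),
          Set.Icc (t₀ - (ρ * c) ^ 2) t₀ ⊆ Set.Icc (-c ^ 2) (-(ε * c ^ 2)) ∧
          ∀ t ∈ Set.Icc (t₀ - (ρ * c) ^ 2) t₀, ∀ x ∈ Metric.ball x₀ (ρ * c),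
            ⟪Literature.Analysis.FluidPDE.curl (W t) x, Literature.Analysis.FluidPDE.curl (W t) x⟫ <
              (-t) * (⟪Literature.Analysis.FluidPDE.curl (W t) x, fderiv ℝ (W t) x (Literature.Analysis.FluidPDE.curl (W t) x)⟫ -
                (1 + δ) * Literature.Analysis.FluidPDE.frobeniusNormSq (fderiv ℝ (Literature.Analysis.FluidPDE.curl (W t)) x))) →
      -- (v67) THE STRETCHING EXCESS BY A DEFINITE FACTOR FILLS A BLOB IN EVERY WINDOW (lead g19,
      -- `…WindowStretchingMargin`): `(1+δ)(|∇ω|²_F + ‖ω‖²/(4(−t))) < ⟪ω, ∇W ω⟫` on a cylinder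
      (∃ ε : ℝ, 0 < ε ∧ ε < 1 ∧ ∃ ρ : ℝ, 0 < ρ ∧ ∃ δ : ℝ, 0 < δ ∧ ∀ c : ℝ, 0 < c →
        ∃ (t₀ : ℝ) (x₀ : EuclideanSpace ℝ (Fin 3)),
          Set.Icc (t₀ - (ρ * c) ^ 2) t₀ ⊆ Set.Icc (-c ^ 2) (-(ε * c ^ 2)) ∧
          ∀ t ∈ Set.Icc (t₀ - (ρ * c) ^ 2) t₀, ∀ x ∈ Metric.ball x₀ (ρ * c),
            (1 + δ) * (Literature.Analysis.FluidPDE.frobeniusNormSq (fderiv ℝ (Literature.Analysis.FluidPDE.curl (W t)) x) + ‖Literature.Analysis.FluidPDE.curl (W t) x‖ ^ 2 / (4 * (-t))) <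
              ⟪Literature.Analysis.FluidPDE.curl (W t) x, fderiv ℝ (W t) x (Literature.Analysis.FluidPDE.curl (W t) x)⟫) →
      -- (v68) THE CALORIC DEFECT — the curl of the Lamb vector `(W·∇)ω − (ω·∇)W = −(∂ₜ − Δ)ω` — FILLS A BLOB IN
      -- EVERY WINDOW (lead g20, `…CaloricDefectWindows`, crux frame): `ε ∈ (0,1)`, `ρ, δ > 0` with, for every `c > 0`,
      -- a parabolic cylinder `[t₀ − (ρc)², t₀] × B(x₀, ρc)` inside `[−c², −εc²]` on which `δ < t²‖D(curl W t)(x)[W t x] − D(W t)(x)[curl W t x]‖`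
      (∃ ε : ℝ, 0 < ε ∧ ε < 1 ∧ ∃ ρ : ℝ, 0 < ρ ∧ ∃ δ : ℝ, 0 < δ ∧ ∀ c : ℝ, 0 < c →
        ∃ (t₀ : ℝ) (x₀ : EuclideanSpace ℝ (Fin 3)),
          Set.Icc (t₀ - (ρ * c) ^ 2) t₀ ⊆ Set.Icc (-c ^ 2) (-(ε * c ^ 2)) ∧
          ∀ t ∈ Set.Icc (t₀ - (ρ * c) ^ 2) t₀, ∀ x ∈ Metric.ball x₀ (ρ * c),
            δ < t ^ 2 * ‖fderiv ℝ (Literature.Analysis.FluidPDE.curl (W t)) x (W t x) -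
              fderiv ℝ (W t) x (Literature.Analysis.FluidPDE.curl (W t) x)‖) →
      -- (v69) THE DENSE CALORIC-DEFECT FLOOR (lead g20, `…CaloricDefectWindows`, crux frame): for all `ρ` and `r > 0`
      -- a `δ > 0` with a point of `t²‖(W·∇)ω − (ω·∇)W‖ > δ` in EVERY cylinder `(−c² − (rc)², −c²) × B(x₀, rc)`,
      -- `‖x₀‖ ≤ ρc`, at every scale `c > 0` — the vorticity is nowhere locally caloric, quantitatively
      (∀ ρ r : ℝ, 0 < r → ∃ δ : ℝ, 0 < δ ∧ ∀ c : ℝ, 0 < c → ∀ x₀ : EuclideanSpace ℝ (Fin 3), ‖x₀‖ ≤ ρ * c →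
        ∃ t ∈ Set.Ioo (-c ^ 2 - (r * c) ^ 2) (-c ^ 2), ∃ x ∈ Metric.ball x₀ (r * c),
          δ < t ^ 2 * ‖fderiv ℝ (Literature.Analysis.FluidPDE.curl (W t)) x (W t x) -
            fderiv ℝ (W t) x (Literature.Analysis.FluidPDE.curl (W t) x)‖) →
      -- (v70) THE EVERY-INSTANT DENSE VORTICITY-GRADIENT FLOOR (lead g20, `…VorticityGradientFloor`, crux frame): for
      -- all `ρ` and `r > 0` a `δ > 0` with a point of `(−t)√(−t)‖D(curl W t)(x)‖ > δ` in EVERY ball `B(x₀, r√(−t))`,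
      -- `‖x₀‖ ≤ ρ√(−t)`, at EVERY instant `t < 0` — the vorticity is nowhere locally uniform
      (∀ ρ r : ℝ, 0 < r → ∃ δ : ℝ, 0 < δ ∧ ∀ t : ℝ, t < 0 → ∀ x₀ : EuclideanSpace ℝ (Fin 3),
        ‖x₀‖ ≤ ρ * Real.sqrt (-t) → ∃ x ∈ Metric.ball x₀ (r * Real.sqrt (-t)),
          δ < (-t) * Real.sqrt (-t) * ‖fderiv ℝ (Literature.Analysis.FluidPDE.curl (W t)) x‖) →
      -- (v71) THE VORTICITY-GRADIENT FLOOR FILLS A BLOB IN EVERY WINDOW (lead g20, `…VorticityGradientFloor`, crux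
      -- frame): `ε ∈ (0,1)`, `ρ, δ > 0` with, for every `c > 0`, a cylinder `[t₀ − (ρc)², t₀] × B(x₀, ρc)` inside
      -- `[−c², −εc²]` on which `δ < (−t)√(−t)‖D(curl W t)(x)‖`
      (∃ ε : ℝ, 0 < ε ∧ ε < 1 ∧ ∃ ρ : ℝ, 0 < ρ ∧ ∃ δ : ℝ, 0 < δ ∧ ∀ c : ℝ, 0 < c →
        ∃ (t₀ : ℝ) (x₀ : EuclideanSpace ℝ (Fin 3)),
          Set.Icc (t₀ - (ρ * c) ^ 2) t₀ ⊆ Set.Icc (-c ^ 2) (-(ε * c ^ 2)) ∧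
          ∀ t ∈ Set.Icc (t₀ - (ρ * c) ^ 2) t₀, ∀ x ∈ Metric.ball x₀ (ρ * c),
            δ < (-t) * Real.sqrt (-t) * ‖fderiv ℝ (Literature.Analysis.FluidPDE.curl (W t)) x‖) →
      -- (v72) THE DENSE EVERY-INSTANT VORTICITY FLOOR (lead g20, `…DenseFloors`, crux frame): for all `ρ` and
      -- `r > 0` a `δ > 0` with a point of `(−t)‖curl W(t,x)‖ > δ` in EVERY ball `B(x₀, r√(−t))`, `‖x₀‖ ≤ ρ√(−t)`,
      -- at every instant (dense form of the v13/v15 vorticity floors)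
      (∀ ρ r : ℝ, 0 < r → ∃ δ : ℝ, 0 < δ ∧ ∀ t : ℝ, t < 0 → ∀ x₀ : EuclideanSpace ℝ (Fin 3),
        ‖x₀‖ ≤ ρ * Real.sqrt (-t) → ∃ x ∈ Metric.ball x₀ (r * Real.sqrt (-t)),
          δ < (-t) * ‖Literature.Analysis.FluidPDE.curl (W t) x‖) →
      -- (v73) THE DENSE EVERY-INSTANT PLANARITY FLOOR, UNIFORM OVER UNIT DIRECTIONS (lead g20, `…DenseFloors`,
      -- crux frame): `(−t)‖D(W t)(x) e‖ > δ` somewhere in every such ball, for every unit `e`, at every instant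
      (∀ ρ r : ℝ, 0 < r → ∃ δ : ℝ, 0 < δ ∧ ∀ t : ℝ, t < 0 → ∀ e : EuclideanSpace ℝ (Fin 3), ‖e‖ = 1 →
        ∀ x₀ : EuclideanSpace ℝ (Fin 3), ‖x₀‖ ≤ ρ * Real.sqrt (-t) →
          ∃ x ∈ Metric.ball x₀ (r * Real.sqrt (-t)), δ < (-t) * ‖fderiv ℝ (W t) x e‖) →
      -- (v74) THE FROZEN-LAW DEFECT — THE VORTICITY IS NOWHERE LOCALLY HARMONIC (lead g20, `…FrozenDefect`, crux
      -- frame): for all `ρ` and `r > 0` a `δ > 0` with a point of `t²‖Δ(curl W t)(x)‖ > δ` in EVERY ball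
      -- `B(x₀, r√(−t))`, `‖x₀‖ ≤ ρ√(−t)`, at every instant
      (∀ ρ r : ℝ, 0 < r → ∃ δ : ℝ, 0 < δ ∧ ∀ t : ℝ, t < 0 → ∀ x₀ : EuclideanSpace ℝ (Fin 3),
        ‖x₀‖ ≤ ρ * Real.sqrt (-t) → ∃ x ∈ Metric.ball x₀ (r * Real.sqrt (-t)),
          δ < t ^ 2 * ‖(Δ (Literature.Analysis.FluidPDE.curl (W t))) x‖) →
      ¬ (∀ r > 0, ∀ M : ℝ, ∃ t ∈ Set.Ioo (-(r ^ 2)) (0 : ℝ),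
          ∃ x ∈ Metric.ball (0 : EuclideanSpace ℝ (Fin 3)) r, M < ‖W t x‖) := by
  sorry

set_option maxHeartbeats 1000000 in
/-- **Composition: the crux `FiniteDissipationLiouville` from the stubs** (by name, no
hypotheses). Small `K`: the gap makes `ū ≡ 0`, which is bounded at the apex. Large `K`: a singular
member yields the recurrent CRITICAL element `w ∈ 𝒟_{C,K_c}` (ns-lqd-p1); the landed portrait
theorems give its envelope (`…Envelope.envelope_of_minimal`), its classical pressure with the
scale-invariant package and tight dissipation (`…EnvelopePackage`), the Pineau–Vicol floor
(`…EnvelopePV`), the sup floor (`…AbsoluteFloors`), the one-point clause (`…CriticalPoint`) and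
the trace clauses (`…FinalTrace`, `…TraceApex`, `…TraceInfinity`), the direction-oscillation floor
and the Giga–Miura exclusion (`…VorticityAlignment`, v13), the planarity floor (`…Planarity`,
v13), the unidirectionality floor and the printed Giga–Miura shape (v14), the local floors and the
Barker–Prange form (v15), the core energy floor / ceiling and the finite-energy remainder (v16,
`…EnergyFloor`, `…TraceMorrey`, `…EnergyRemainder`), the trace-across-the-apex and apex energy
clauses (v17, `…EnergyTrace`, `…EnergyTraceDatum`), the vorticity clauses (v18,
`…FinalDatumVorticity(Minimal)`), the remainder floor (v19, `…EnergyReturn`), the pointwise saturation (v20,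
`…FinalDatumSaturation`), the point group (v21, `…PointGroup`) and the category/minimality clause
(v22/v23, `…HullCategoryCritical`); since v24 the element is the QUASI-REGULAR critical element of
`…ErgodicHullPortrait.exists_quasiRegular_criticalElement` (step `½`, v25) with its mean core energies (`…ErgodicHullObservables`) and the extremal element of its hull (`…Extremal`, v26), and (v27) the return-time floor and the sharp displacement floor of `…ReturnTimes(Sharp)`; the open stub says such a
`w` is not singular — contradiction. -/
theorem FiniteDissipationLiouville_of : Theses.LerayQuarterDissipation.FiniteDissipationLiouville := by
  intro C K ū hū hD hsing
  obtain ⟨K₀, hK₀, hgap⟩ := stub_smallDissipationGap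
  by_cases hK : K ≤ K₀
  · -- small dissipation: `ū ≡ 0` on `t < 0`, contradicting the singular clause at `M = 0`
    have hz := hgap C K ū hK hū hD
    obtain ⟨t, ht, x, -, hM⟩ := hsing 1 one_pos 0
    rw [hz t ht.2 x, norm_zero] at hM
    exact lt_irrefl _ hM
  · -- large dissipation: the recurrent CRITICAL element and its portrait
    -- (v24) the QUASI-REGULAR recurrent critical element (invariant measures + Birkhoff, g12)
    obtain ⟨K₁, -, hce⟩ :=
      Theorems.FiniteDissipationLiouville.ErgodicHull.exists_quasiRegular_criticalElement
    obtain ⟨Kc, w, -, -, hw, hDw, hsw, hrec, hmin, hsat, hq⟩ := hce C K ū hū hD hsing (1 / 2) one_half_pos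
    -- the envelope of the critical element
    obtain ⟨A, -, hA⟩ := Theorems.FiniteDissipationLiouville.Envelope.envelope_of_minimal hmin
    -- the Pineau–Vicol floor (uniform in the class, then specialised to `w`)
    obtain ⟨δ₀, hδ₀, hpv⟩ :=
      Theorems.FiniteDissipationLiouville.Envelope.pv_unsteadiness_floor_of_minimal hmin
    obtain ⟨T₀, hT₀, hpvw⟩ := hpv w hw hDw hsw
    -- the absolute sup floor
    obtain ⟨θ, hθ, hsup⟩ := Theorems.FiniteDissipationLiouville.AbsoluteFloors.sup_floor_absolute
    -- (v10) the weighted floors of the trace and of its vorticity (uniform on `𝒟_{C,K_c}`)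
    obtain ⟨θ₁, hθ₁, hθ₁f⟩ :=
      Theorems.FiniteDissipationLiouville.Birth.Apex.trace_weighted_apex_floor_of_singular C Kc
    obtain ⟨θ₂, hθ₂, hθ₂f⟩ :=
      Theorems.FiniteDissipationLiouville.Birth.Apex.trace_weighted_farField_floor_of_singular C Kc
    obtain ⟨θ₃, hθ₃, hθ₃f⟩ :=
      Theorems.FiniteDissipationLiouville.Birth.Apex.trace_vorticity_apex_floor_of_singular C Kc
    obtain ⟨θ₄, hθ₄, hθ₄f⟩ :=
      Theorems.FiniteDissipationLiouville.Birth.Apex.trace_vorticity_farField_floor_of_singular C Kc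
    -- (v11) the uniform near-one DSS threshold of the stratum `𝒟_{C,K_c}`
    obtain ⟨lam₀, hlam₀, hthr⟩ :=
      Theorems.FiniteDissipationLiouville.Birth.exists_pastDss_threshold_unif C Kc
    -- (v13) the direction-oscillation floor of the stratum `𝒟_{C,K_c}`
    obtain ⟨δ₁, hδ₁, hδ₁f⟩ :=
      Theorems.FiniteDissipationLiouville.VorticityAlignment.directionOscillation_floor_of_singular C Kc
    -- (v13) the planarity floor of the stratum `𝒟_{C,K_c}`
    obtain ⟨δ₂, hδ₂, hδ₂f⟩ :=
      Theorems.FiniteDissipationLiouville.Planarity.planarity_floor_of_singular C Kc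
    -- (v14) the unidirectionality floor of the stratum `𝒟_{C,K_c}`
    obtain ⟨δ₃, hδ₃, hδ₃f⟩ :=
      Theorems.FiniteDissipationLiouville.Unidirectional.unidirectionality_floor_of_singular C Kc
    -- (v12) the scale-invariant package and the final-datum profile built from it
    obtain ⟨Q, hQcl, hSIB⟩ :=
      Theorems.FiniteDissipationLiouville.Envelope.scaleInvariantBounds_of_minimal hmin hw hDw hsw
    obtain ⟨u₀, Du₀, L₀, L₁, Me, -, hL₁nn, -, hrate, henv, hgrate, hgenv, hderiv, hdiv, hener⟩ :=
      Theorems.FiniteDissipationLiouville.EnergyRemainder.exists_finalDatum_profile_energy hw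
        (hA w hw hDw hsw) hSIB
    -- (v16) the core energy ceiling of the stratum `𝒟_{C,K_c}` (no concentration, lead g5)
    obtain ⟨Λ, hΛ⟩ :=
      Theorems.FiniteDissipationLiouville.Birth.Apex.lintegral_ball_sq_le_unif Kc
    -- (v17) the trace is `u₀` across the apex; the apex energy floor of `u₀`
    have hu₀m := Theorems.FiniteDissipationLiouville.EnergyRemainder.aestronglyMeasurable_finalDatum hw hrate
    have htr : ∀ ψ : EuclideanSpace ℝ (Fin 3) → EuclideanSpace ℝ (Fin 3),
        Literature.Analysis.FunctionSpaces.IsTestFunctionOn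
            (⊤ : TopologicalSpace.Opens (EuclideanSpace ℝ (Fin 3))) ψ →
        Filter.Tendsto (fun t => ∫ x, ⟪w t x, ψ x⟫) (𝓝[<] 0) (𝓝 (∫ x, ⟪u₀ x, ψ x⟫)) :=
      fun ψ hψ =>
        Theorems.FiniteDissipationLiouville.EnergyTrace.tendsto_pairing_of_energy hw hu₀m hener hψ
    obtain ⟨ε₀, hε₀, hfl⟩ :=
      Theorems.FiniteDissipationLiouville.EnergyTrace.lintegral_ball_finalDatum_sq_floor C Kc
    -- (v18) the gradient envelope of the package, with one constant for the three bounds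
    obtain ⟨Lg, hLg⟩ := hSIB 1
    have hLv : 0 ≤ max L₁ Lg := hL₁nn.trans (le_max_left _ _)
    have hgradW : ∀ t : ℝ, t < 0 → ∀ x, ‖fderiv ℝ (w t) x‖ ≤ max L₁ Lg / (‖x‖ + Real.sqrt (-t)) ^ 2 := by
      intro t ht x
      have h := (hLg t ht x).1
      rw [← Theorems.FiniteDissipationLiouville.FinalDatumVorticity.norm_fderiv_eq_norm_iteratedFDeriv_one,
        show (1 + 1 : ℕ) = 2 by norm_num] at h
      have hden : 0 < (‖x‖ + Real.sqrt (-t)) ^ 2 :=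
        pow_pos (add_pos_of_nonneg_of_pos (norm_nonneg _) (Real.sqrt_pos.2 (neg_pos.2 ht))) 2
      exact h.trans (div_le_div_of_nonneg_right (le_max_right _ _) hden.le)
    have hgenv' : ∀ x : EuclideanSpace ℝ (Fin 3), x ≠ 0 → ‖Du₀ x‖ ≤ max L₁ Lg / ‖x‖ ^ 2 :=
      fun x hx => (hgenv x hx).trans (div_le_div_of_nonneg_right (le_max_left _ _) (by positivity))
    have hgrate' : ∀ x : EuclideanSpace ℝ (Fin 3), x ≠ 0 → ∀ t : ℝ, t < 0 →
        ‖fderiv ℝ (w t) x - Du₀ x‖ ≤ max L₁ Lg * (-t) / ‖x‖ ^ 4 := fun x hx t ht =>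
      (hgrate x hx t ht).trans (div_le_div_of_nonneg_right
        (mul_le_mul_of_nonneg_right (le_max_left _ _) (neg_nonneg.2 ht.le)) (by positivity))
    have hVnn : (0 : ℝ) ≤ 3 * (MeasureTheory.volume : MeasureTheory.Measure
        (EuclideanSpace ℝ (Fin 3))).real (Metric.ball 0 1) := by positivity
    -- (v19) the remainder energy floor (no early arrival)
    obtain ⟨δr, hδr, hrf⟩ :=
      Theorems.FiniteDissipationLiouville.EnergyReturn.remainderEnergy_floor C Kc
    exact stub_envelopeCriticalLiouville C A Kc w hw (hA w hw hDw hsw) hDw hmin hrec hsat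
      ⟨Q, hQcl, hSIB⟩
      (Theorems.FiniteDissipationLiouville.Envelope.dissipation_tail_of_minimal hmin hw hDw hsw)
      ⟨δ₀, hδ₀, T₀, hT₀, hpvw⟩
      ⟨θ, hθ, hsup C w hw hsw⟩
      (fun x₁ hx₁ =>
        Theorems.FiniteDissipationLiouville.CriticalPoint.not_singular_translate_of_minimal
          hw hDw hsw hmin hx₁)
      (Theorems.FiniteDissipationLiouville.Birth.Apex.exists_trace_ne_zero_of_singular hw hDw hsw)
      (Theorems.FiniteDissipationLiouville.Birth.Apex.trace_L3_concentration_of_singular hw hDw hsw)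
      (Theorems.FiniteDissipationLiouville.Birth.Apex.trace_L3_concentration_atInfinity_of_singular
        hw hDw hsw)
      ⟨θ₁, hθ₁, hθ₁f w hw hDw hsw⟩ ⟨θ₂, hθ₂, hθ₂f w hw hDw hsw⟩
      (fun e he R₁ =>
        Theorems.FiniteDissipationLiouville.Birth.Apex.exists_halfSpace_trace_curl_ne_zero_of_singular
          hw hDw hsw he R₁)
      (fun r hr =>
        Theorems.FiniteDissipationLiouville.Birth.Apex.exists_apex_trace_curl_ne_zero_of_singular
          hw hDw hsw hr)
      ⟨lam₀, hlam₀, fun c hc hcl hpast => hthr w hw hDw c hc hcl hpast hsw⟩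
      ⟨θ₃, hθ₃, hθ₃f w hw hDw hsw⟩ ⟨θ₄, hθ₄, hθ₄f w hw hDw hsw⟩
      (fun c hc hc1 hcW =>
        Theorems.FiniteDissipationLiouville.Birth.exists_least_factor_of_pastDss hw
          (Theorems.FiniteDissipationLiouville.Birth.not_forall_eq_zero_of_singular hsw) hc hc1 hcW)
      ⟨L₀, L₁, Me, u₀, Du₀, hener,
        ⟨δr, hδr, fun t ht => hrf w hw hDw hsw u₀ hu₀m htr t ht
          (ne_top_of_le_ne_top ENNReal.ofReal_ne_top (hener t ht))⟩,
        ⟨min θ₁ θ₂ / 2, by positivity, fun ρ hρ => by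
            obtain ⟨ψ, T, hψ, hsupp, hT, hlt⟩ := hθ₁f w hw hDw hsw ρ hρ
            rw [tendsto_nhds_unique hT (htr ψ hψ)] at hlt
            obtain ⟨x, hx0, hxρ, hx⟩ :=
              Theorems.FiniteDissipationLiouville.FinalDatumSaturation.exists_norm_mul_norm_gt_near_apex
                hu₀m hθ₁ ⟨ψ, hψ, hsupp, hlt⟩
            exact ⟨x, hx0, hxρ, lt_of_le_of_lt
              (div_le_div_of_nonneg_right (min_le_left _ _) (by norm_num)) hx⟩,
          fun R hR => by
            obtain ⟨ψ, T, hψ, hsupp, hT, hlt⟩ := hθ₂f w hw hDw hsw R hR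
            rw [tendsto_nhds_unique hT (htr ψ hψ)] at hlt
            obtain ⟨x, hxR, hx⟩ :=
              Theorems.FiniteDissipationLiouville.FinalDatumSaturation.exists_norm_mul_norm_gt_farField
                hu₀m hθ₂ ⟨ψ, hψ, hsupp, hlt⟩
            exact ⟨x, hxR, lt_of_le_of_lt
              (div_le_div_of_nonneg_right (min_le_right _ _) (by norm_num)) hx⟩⟩,
        htr, ⟨ε₀, hε₀, fun ρ hρ => hfl w hw hDw hsw u₀ hu₀m htr ρ hρ
          (ne_top_of_le_ne_top ENNReal.ofReal_ne_top
            (Theorems.FiniteDissipationLiouville.EnergyTrace.lintegral_ball_finalDatum_sq_le henv hρ))⟩,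
        fun ρ hρ => Theorems.FiniteDissipationLiouville.EnergyTrace.lintegral_ball_finalDatum_sq_le henv hρ,
        Theorems.FiniteDissipationLiouville.FinalDatumVorticity.isWeaklyDivFree_finalDatum hw htr,
        ⟨4 * (3 * (3 * (MeasureTheory.volume : MeasureTheory.Measure
            (EuclideanSpace ℝ (Fin 3))).real (Metric.ball 0 1))) * max L₁ Lg, by positivity,
          fun t ht => (Theorems.FiniteDissipationLiouville.FinalDatumVorticity.lintegral_fderiv_sub_finalDatum_le
              hgradW hgenv' hgrate' ht).trans (ENNReal.ofReal_le_ofReal (by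
            have hs : 0 ≤ Real.sqrt (-t) := Real.sqrt_nonneg _
            nlinarith [mul_nonneg (mul_nonneg hVnn hLv) hs])),
          fun t ht => (Theorems.FiniteDissipationLiouville.FinalDatumVorticity.lintegral_curl_sub_finalDatum_le
              hgradW hgenv' hgrate' ht).trans (ENNReal.ofReal_le_ofReal (le_of_eq (by ring))),
          fun ρ hρ => (Theorems.FiniteDissipationLiouville.FinalDatumVorticity.lintegral_ball_curlDatum_le
              hgenv' hρ).trans (ENNReal.ofReal_le_ofReal (by
            nlinarith [mul_nonneg (mul_nonneg hVnn hLv) hρ.le]))⟩,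
        fun ψ hψ => Theorems.FiniteDissipationLiouville.FinalDatumVorticity.tendsto_pairing_curl_finalDatum
          hw hgradW hgenv' hgrate' hψ,
        hrate, henv, hgrate, hgenv, hderiv, hdiv, fun ψ r hr hψ hsupp =>
        Theorems.FiniteDissipationLiouville.FinalDatum.tendsto_pairing_of_rate hw (hA w hw hDw hsw)
          hrate hψ hr hsupp⟩
      ⟨δ₁, hδ₁, hδ₁f w hw hDw hsw⟩
      (Theorems.FiniteDissipationLiouville.VorticityAlignment.not_continuousAlignment_of_singular
        hw hDw hsw)
      ⟨δ₂, hδ₂, hδ₂f w hw hDw hsw⟩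
      ⟨δ₃, hδ₃, hδ₃f w hw hDw hsw⟩
      (Theorems.FiniteDissipationLiouville.VorticityAlignment.not_gigaMiuraAlignment_of_singular
        hw hDw hsw)
      (fun r hr => by
        obtain ⟨δ, hδ, hf⟩ :=
          Theorems.FiniteDissipationLiouville.VorticityAlignment.directionOscillation_floor_local
            C Kc r hr
        exact ⟨δ, hδ, hf w hw hDw hsw⟩)
      (fun r hr => by
        obtain ⟨δ, hδ, hf⟩ :=
          Theorems.FiniteDissipationLiouville.Planarity.planarity_floor_local C Kc r hr
        exact ⟨δ, hδ, hf w hw hDw hsw⟩)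
      (fun r hr => by
        obtain ⟨δ, hδ, hf⟩ :=
          Theorems.FiniteDissipationLiouville.Unidirectional.unidirectionality_floor_local C Kc r hr
        exact ⟨δ, hδ, hf w hw hDw hsw⟩)
      (Theorems.FiniteDissipationLiouville.VorticityAlignment.not_alignment_concentrating_of_singular
        hw hDw hsw)
      (fun r hr => by
        obtain ⟨δ, hδ, hf⟩ :=
          Theorems.FiniteDissipationLiouville.EnergyFloor.coreEnergy_floor_of_singular C Kc r hr
        exact ⟨δ, hδ, hf w hw hDw hsw⟩)
      ⟨Λ, fun x₀ r hr t ht => hΛ C w hw hDw x₀ r hr t ht⟩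
      (by
        obtain ⟨α₀, hα₀, R, hR, hf⟩ :=
          Theorems.FiniteDissipationLiouville.PointGroup.smallRotation_defect_of_singular C Kc
        exact ⟨α₀, hα₀, R, hR, hf w hw hDw hsw⟩)
      (by
        obtain ⟨N, hN, R, hR, hf⟩ :=
          Theorems.FiniteDissipationLiouville.PointGroup.isometrySymmetry_finiteOrder_of_singular C Kc
        exact ⟨N, hN, R, hR, hf w hw hDw hsw⟩)
      (fun hnd V hV =>
        Theorems.FiniteDissipationLiouville.HullCategory.exists_criticalElement_off_orbits
          hw hDw hsw hrec hnd V hV)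
      hq
      (fun r hr => by
        obtain ⟨δ, hδ, hf⟩ :=
          Theorems.FiniteDissipationLiouville.EnergyFloor.coreEnergy_floor_of_singular C Kc r hr
        obtain ⟨ℓ, hℓ⟩ :=
          Theorems.FiniteDissipationLiouville.ErgodicHull.exists_meanCoreEnergy_of_quasiRegular hw hq r
        exact ⟨δ, hδ, ℓ, Theorems.FiniteDissipationLiouville.ErgodicHull.meanCoreEnergy_floor hr hw hDw
          (hf w hw hDw hsw) hℓ, hf w hw hDw hsw, hℓ⟩)
      (by
        obtain ⟨W', hW', hDW', hsW', hrecW', ⟨l, hl, -, hpt⟩, hgradW', hsat⟩ :=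
          Theorems.FiniteDissipationLiouville.Extremal.exists_extremal_of_minimal hmin hw hDw hsw hrec
            hgradW
        exact ⟨W', max L₁ Lg, hW', hDW', hsW', hrecW', ⟨l, hl, hpt⟩, hgradW', hsat⟩)
      (by
        -- (v27) the return-time floor of the stratum `𝒟_{C,K_c}` (lead g13)
        obtain ⟨lam₁, hlam₁, hf⟩ :=
          Theorems.FiniteDissipationLiouville.ReturnTimes.returnTime_floor_of_singular C Kc
        refine ⟨lam₁, hlam₁, fun μ₁ μ₂ h₁ h₁₂ h₂ R hR => ?_⟩
        obtain ⟨δ, hδ, hδf⟩ := hf μ₁ μ₂ h₁ h₁₂ h₂ R hR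
        exact ⟨δ, hδ, fun μ hμ => hδf w hw hDw hsw μ hμ⟩)
      (by
        -- (v27) the sharp small-lag displacement floor (lead g13)
        obtain ⟨lam₁, hlam₁, hf⟩ :=
          Theorems.FiniteDissipationLiouville.ReturnTimes.displacement_floor_of_singular C Kc
        refine ⟨lam₁, hlam₁, fun μ₂ h₂ h₂l R hR => ?_⟩
        obtain ⟨κ, hκ, hκf⟩ := hf μ₂ h₂ h₂l R hR
        exact ⟨κ, hκ, fun μ h₁ hle => hκf w hw hDw hsw μ h₁ hle⟩)
      (fun ρ r hr => by
        -- (v28) the dense-flicker floor of the stratum `𝒟_{C,K_c}` (lead g14)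
        obtain ⟨δ, hδ, hf⟩ :=
          Theorems.FiniteDissipationLiouville.CalmSliceLocal.localFlicker_floor_of_singular C Kc ρ r hr
        exact ⟨δ, hδ, fun t ht x₀ hx₀ => hf w hw hDw hsw t ht x₀ hx₀⟩)
      (fun ρ r hr => by
        -- (v28) the vorticity-flicker floor of the stratum `𝒟_{C,K_c}` (lead g14)
        obtain ⟨δ, hδ, hf⟩ :=
          Theorems.FiniteDissipationLiouville.CalmSliceLocal.vorticityFlicker_floor_of_singular' C Kc ρ r hr
        exact ⟨δ, hδ, fun t ht x₀ hx₀ => hf w hw hDw hsw t ht x₀ hx₀⟩)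
      (fun ρ r hr => by
        -- (v29) the mean-flicker (`L¹`) floor of the stratum `𝒟_{C,K_c}` (lead g14)
        obtain ⟨δ, hδ, hf⟩ :=
          Theorems.FiniteDissipationLiouville.CalmSliceLocal.meanFlicker_floor_of_singular C Kc ρ r hr
        exact ⟨δ, hδ, fun t ht x₀ hx₀ => hf w hw hDw hsw t ht x₀ hx₀⟩)
      -- (v29) the flicker envelope of the critical element (lead g14)
      (Theorems.FiniteDissipationLiouville.CalmSliceLocal.flickerEnvelope_of_minimal hmin hw hDw hsw)
      (by
        -- (v30) threshold one (lead g14): the gap `ε(K_c)`; below it the crux already kills `w`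
        obtain ⟨ε, hε, hgap⟩ := Theorems.FiniteDissipationLiouville.ThresholdOne.exists_typeI_gap Kc
        refine ⟨ε, hε, hgap, ?_⟩
        by_contra hle
        push Not at hle
        exact hgap C hle w hw hDw hsw)
      -- (v31) stretching saturation (lead g14)
      (Theorems.FiniteDissipationLiouville.ThresholdOne.exists_singular_limit_slack_le hw hDw hsw)
      (by
        -- (v32) the sharper explicit small-dissipation rung (lead g14): below it `w` is not singular
        by_contra hlt
        push Not at hlt
        exact Theorems.SmallDissipationGap.not_singular_of_small_dissipation_sharper hw hDw hlt hsw)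
      (by
        -- (v33) the dissipation threshold (lead g14): the gap `ε'(C)`; below it the crux kills `w`
        obtain ⟨ε', hε', hgap'⟩ := Theorems.FiniteDissipationLiouville.ThresholdK.exists_dissipation_gap C
        refine ⟨ε', hε', hgap', ?_⟩
        by_contra hle
        push Not at hle
        exact hgap' Kc hle w hw hDw hsw)
      (by
        -- (v34a) the vorticity-amplitude floor on long windows (lead g15)
        obtain ⟨ε, hε, hf⟩ :=
          Theorems.FiniteDissipationLiouville.VorticityAmplitude.vorticity_exceeds_windows_of_singular C Kc
        obtain ⟨Λ, hΛ, hwin⟩ := hf w hw hDw hsw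
        exact ⟨ε, hε, Λ, hΛ, hwin⟩)
      (fun lam Cω h0 h1 hj =>
        -- (v34b) the joint velocity / vorticity-amplitude floor (lead g15)
        Theorems.FiniteDissipationLiouville.VorticityAmplitude.vorticity_exceeds_joint_of_singular
          hw hDw hsw h0 h1 hj)
      (fun v hv0 hv =>
        -- (v35a) the `L³`-vorticity floor (lead g16)
        Theorems.FiniteDissipationLiouville.VorticityLThree.vorticityLThree_exceeds_of_singular
          hw hDw hsw hv0 hv)
      (fun Cω hω =>
        -- (v35b) the hyperbola floor (lead g16)
        Theorems.FiniteDissipationLiouville.VorticityLThree.vorticity_mul_dissipation_ge_of_singular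
          hw hDw hsw hω)
      (fun w' hw0 hq =>
        -- (v36) the `L⁶`-velocity floor (lead g16)
        Theorems.FiniteDissipationLiouville.VelocityLSix.velocityLSix_exceeds_of_singular
          hw hDw hsw hw0 hq)
      (fun γ hγc hγ0 hU Γ₂ hΓ₂ => by
        -- (v37) threshold one on average (lead g16)
        by_contra hcon
        push Not at hcon
        exact Theorems.FiniteDissipationLiouville.Averaged.not_singular_of_velocity_avg_lt
          hw hDw hγc hγ0 hU (fun a s has => hcon a s has) hΓ₂ hsw)
      (fun lam μ κ δ h0 h1 hμ hκ hδ H1 =>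
        -- (v38) the mixed-lens floor (lead g17)
        Theorems.FiniteDissipationLiouville.MixedRegion.mixed_ge_one_of_singular
          hw hDw hsw h0 h1 hμ hκ hδ H1)
      (fun t ht =>
        -- (v39) the every-instant enstrophy floor (lead g17)
        Theorems.FiniteDissipationLiouville.EveryInstant.vorticity_floor_of_singular hw hDw hsw ht)
      (fun t ht lam μ κ δ h0 h1 hμ hκ hδ H1 =>
        -- (v40) the lens-shaped every-instant floor (lead g17)
        Theorems.FiniteDissipationLiouville.EveryInstantMixed.vorticity_lens_floor_of_singular
          hw hDw hsw h0 h1 hμ hκ hδ H1 ht)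
      -- (v41) the cross-flow threshold one is not attained (lead g17; constants equalised to `max C A`)
      (Theorems.FiniteDissipationLiouville.CrossFlow.crossFlow_exceeds_of_singular
        (Theorems.FiniteDissipationLiouville.CrossFlow.isTypeIAncientMild_of_le hw (le_max_left C A))
        le_rfl
        (Theorems.FiniteDissipationLiouville.CrossFlow.hasTypeIDecay_of_le (hA w hw hDw hsw)
          (le_max_right C A))
        hsw)
      (by
        -- (v42) the product threshold one is exceeded by a definite amount (lead g18)
        obtain ⟨ε, hε, hf⟩ :=
          Theorems.FiniteDissipationLiouville.LambProduct.lambProduct_exceeds_gap_of_singular (max C A)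
        obtain ⟨t, ht, x, hx⟩ := hf C w hw (le_max_left C A)
          (Theorems.FiniteDissipationLiouville.CrossFlow.hasTypeIDecay_of_le (hA w hw hDw hsw)
            (le_max_right C A)) hsw
        exact ⟨ε, hε, t, ht, x, hx⟩)
      (by
        -- (v43) the space constant exceeds `½` by a definite amount (lead g18)
        obtain ⟨ε, hε, hf⟩ :=
          Theorems.FiniteDissipationLiouville.LambProduct.spaceConstant_exceeds_gap_of_singular (max C A)
        obtain ⟨t, ht, x, hx⟩ := hf C w hw (le_max_left C A)
          (Theorems.FiniteDissipationLiouville.CrossFlow.hasTypeIDecay_of_le (hA w hw hDw hsw)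
            (le_max_right C A)) hsw
        exact ⟨ε, hε, t, ht, x, hx⟩)
      -- (v44) the Taylor-microscale window recurs in every log-time window (lead g18)
      (fun s₁ L hL =>
        Theorems.FiniteDissipationLiouville.MicroscaleWindow.exists_near_window_of_law hw
          (hA w hw hDw hsw) hDw s₁ hL)
      (by
        -- (v45) Lamb-form local production excess, fast and central (lead g18)
        obtain ⟨ε, hε, hf⟩ :=
          Theorems.FiniteDissipationLiouville.LocalBalance.localBalance_excess_in_fastCore_of_singular
            (max C A)
        obtain ⟨t, ht, x, hx⟩ := hf C w hw (le_max_left C A)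
          (Theorems.FiniteDissipationLiouville.CrossFlow.hasTypeIDecay_of_le (hA w hw hDw hsw)
            (le_max_right C A)) hsw
        exact ⟨ε, hε, t, ht, x, hx⟩)
      (by
        -- (v46) vortex stretching beats local dissipation + scaling somewhere (lead g18)
        obtain ⟨ε, hε, hf⟩ :=
          Theorems.FiniteDissipationLiouville.LocalBalance.stretching_excess_of_singular (max C A)
        obtain ⟨t, ht, x, hx⟩ := hf C w hw (le_max_left C A)
          (Theorems.FiniteDissipationLiouville.CrossFlow.hasTypeIDecay_of_le (hA w hw hDw hsw)
            (le_max_right C A)) hsw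
        exact ⟨ε, hε, t, ht, x, hx⟩)
      (by
        -- (v47) the Hardy-weighted stretching exceeds the sharp quarter by `ε` somewhere (lead g18)
        obtain ⟨ε, hε, hf⟩ :=
          Theorems.FiniteDissipationLiouville.LocalBalance.hardyStretching_excess_of_singular (max C A)
        obtain ⟨t, ht, x, hx⟩ := hf C w hw (le_max_left C A)
          (Theorems.FiniteDissipationLiouville.CrossFlow.hasTypeIDecay_of_le (hA w hw hDw hsw)
            (le_max_right C A)) hsw
        exact ⟨ε, hε, t, ht, x, hx⟩)
      -- (v49) the recurrent explicit palinstrophy floor (lead g18)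
      (fun s₁ L hL =>
        Theorems.FiniteDissipationLiouville.MicroscaleWindow.exists_palinstrophy_floor_window hw
          (hA w hw hDw hsw) hDw hsw s₁ hL)
      -- (v50) the excess accumulates at the apex (lead g18)
      (fun τ hτ =>
        Theorems.FiniteDissipationLiouville.LocalBalance.localBalance_excess_accumulates_of_singular hw
          (le_max_left C A)
          (Theorems.FiniteDissipationLiouville.CrossFlow.hasTypeIDecay_of_le (hA w hw hDw hsw)
            (le_max_right C A)) hsw hτ)
      -- (v51) the super-self-similar speed recedes to `−∞` (lead g18)
      (fun τ hτ =>
        Theorems.FiniteDissipationLiouville.LocalBalance.speed_exceeds_one_recedes_of_singular hw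
          (le_max_left C A)
          (Theorems.FiniteDissipationLiouville.CrossFlow.hasTypeIDecay_of_le (hA w hw hDw hsw)
            (le_max_right C A)) hsw hτ)
      -- (v52) super-caloricity accumulates at the apex (lead g18)
      (fun τ hτ =>
        Theorems.FiniteDissipationLiouville.CriticalProduction.subsolution_fails_near_apex_of_singular
          hw hDw hsw hτ)
      (by
        -- (v53) super-caloricity recedes to `−∞` (lead g18)
        intro τ hτ
        have hne : ∃ t : ℝ, t < 0 ∧ ∃ x, w t x ≠ 0 := by
          obtain ⟨t, ht, x, -, hM⟩ := hsw 1 one_pos 0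
          exact ⟨t, ht.2, x, fun h => by rw [h, norm_zero] at hM; exact lt_irrefl _ hM⟩
        obtain ⟨s, hs, y, hy⟩ :=
          Theorems.FiniteDissipationLiouville.CriticalProduction.subsolution_fails_farPast_of_ne_zero
            le_rfl hw hDw hne hτ
        exact ⟨s, hs, y, by rwa [one_mul] at hy⟩)
      (by
        -- (v54) the super-self-similar speed recurs with bounded gaps (lead g19)
        obtain ⟨ε, hε, hε1, hf⟩ :=
          Theorems.FiniteDissipationLiouville.WindowRecurrence.speed_exceeds_one_in_every_window (max C A)
        exact ⟨ε, hε, hε1, fun c hc => hf C w hw (le_max_left C A)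
          (Theorems.FiniteDissipationLiouville.CrossFlow.hasTypeIDecay_of_le (hA w hw hDw hsw)
            (le_max_right C A)) hsw c hc⟩)
      (by
        -- (v55) the Lamb-form production excess recurs with bounded gaps (lead g19)
        obtain ⟨ε, hε, hε1, hf⟩ :=
          Theorems.FiniteDissipationLiouville.WindowRecurrence.localBalance_excess_in_every_window (max C A)
        exact ⟨ε, hε, hε1, fun c hc => hf C w hw (le_max_left C A)
          (Theorems.FiniteDissipationLiouville.CrossFlow.hasTypeIDecay_of_le (hA w hw hDw hsw)
            (le_max_right C A)) hsw c hc⟩)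
      (by
        -- (v56) the vortex-stretching excess recurs with bounded gaps (lead g19)
        obtain ⟨ε, hε, hε1, hf⟩ :=
          Theorems.FiniteDissipationLiouville.WindowRecurrence.stretching_excess_in_every_window (max C A)
        exact ⟨ε, hε, hε1, fun c hc => hf C w hw (le_max_left C A)
          (Theorems.FiniteDissipationLiouville.CrossFlow.hasTypeIDecay_of_le (hA w hw hDw hsw)
            (le_max_right C A)) hsw c hc⟩)
      (by
        -- (v57) super-caloricity recurs with bounded gaps (lead g19, crux frame)
        obtain ⟨ε, hε, hε1, hf⟩ :=
          Theorems.FiniteDissipationLiouville.WindowRecurrence.superCaloric_in_every_window C Kc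
        exact ⟨ε, hε, hε1, fun c hc => hf w hw hDw hsw c hc⟩)
      (by
        -- (v58) the fast set fills a definite fraction of the self-similar core (lead g19)
        obtain ⟨ε, hε, hε1, η, hη, hf⟩ :=
          Theorems.FiniteDissipationLiouville.WindowRecurrence.speed_exceeds_one_volume_core (max C A)
        exact ⟨ε, hε, hε1, η, hη, fun c hc => hf C w hw (le_max_left C A)
          (Theorems.FiniteDissipationLiouville.CrossFlow.hasTypeIDecay_of_le (hA w hw hDw hsw)
            (le_max_right C A)) hsw c hc⟩)
      (by
        -- (v59) the super-self-similar instants have definite temporal density (lead g19)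
        obtain ⟨ε, hε, hε1, κ, hκ, hf⟩ :=
          Theorems.FiniteDissipationLiouville.WindowRecurrence.fastTimes_measure_ge (max C A)
        exact ⟨ε, hε, hε1, κ, hκ, fun c hc => hf C w hw (le_max_left C A)
          (Theorems.FiniteDissipationLiouville.CrossFlow.hasTypeIDecay_of_le (hA w hw hDw hsw)
            (le_max_right C A)) hsw c hc⟩)
      (by
        -- (v60) the speed exceeds the self-similar rate by a definite factor, definite volume (lead g19)
        obtain ⟨ε, hε, hε1, δ, hδ, η, hη, hf⟩ :=
          Theorems.FiniteDissipationLiouville.WindowRecurrence.speed_exceeds_margin_volume_scaled (max C A)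
        exact ⟨ε, hε, hε1, δ, hδ, η, hη, fun c hc => hf C w hw (le_max_left C A)
          (Theorems.FiniteDissipationLiouville.CrossFlow.hasTypeIDecay_of_le (hA w hw hDw hsw)
            (le_max_right C A)) hsw c hc⟩)
      (by
        -- (v61) the stretching-excess instants have definite temporal density (lead g19)
        obtain ⟨ε, hε, hε1, κ, hκ, hf⟩ :=
          Theorems.FiniteDissipationLiouville.WindowRecurrence.stretchingTimes_measure_ge (max C A)
        exact ⟨ε, hε, hε1, κ, hκ, fun c hc => hf C w hw (le_max_left C A)
          (Theorems.FiniteDissipationLiouville.CrossFlow.hasTypeIDecay_of_le (hA w hw hDw hsw)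
            (le_max_right C A)) hsw c hc⟩)
      (by
        -- (v62) the super-caloric instants have definite temporal density (lead g19)
        obtain ⟨ε, hε, hε1, κ, hκ, hf⟩ :=
          Theorems.FiniteDissipationLiouville.WindowRecurrence.superCaloricTimes_measure_ge (max C A) Kc
        exact ⟨ε, hε, hε1, κ, hκ, fun c hc => hf C w hw (le_max_left C A)
          (Theorems.FiniteDissipationLiouville.CrossFlow.hasTypeIDecay_of_le (hA w hw hDw hsw)
            (le_max_right C A)) hDw hsw c hc⟩)
      (by
        -- (v63) a fast blob of definite relative size in every window (lead g19)
        obtain ⟨ε, hε, hε1, ρ, hρ, δ, hδ, hf⟩ :=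
          Theorems.FiniteDissipationLiouville.WindowRecurrence.fastBlob_in_every_window (max C A)
        exact ⟨ε, hε, hε1, ρ, hρ, δ, hδ, fun c hc => hf C w hw (le_max_left C A)
          (Theorems.FiniteDissipationLiouville.CrossFlow.hasTypeIDecay_of_le (hA w hw hDw hsw)
            (le_max_right C A)) hsw c hc⟩)
      (by
        -- (v64) the Lamb-form production excess by a factor fills a blob in every window (lead g19)
        obtain ⟨ε, hε, hε1, ρ, hρ, δ, hδ, hf⟩ :=
          Theorems.FiniteDissipationLiouville.WindowRecurrence.localBalance_excess_blob_in_every_window (max C A)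
        exact ⟨ε, hε, hε1, ρ, hρ, δ, hδ, fun c hc => hf C w hw (le_max_left C A)
          (Theorems.FiniteDissipationLiouville.CrossFlow.hasTypeIDecay_of_le (hA w hw hDw hsw)
            (le_max_right C A)) hsw c hc⟩)
      (by
        -- (v65) the stretching excess fills a blob in every window (lead g19)
        obtain ⟨ε, hε, hε1, ρ, hρ, hf⟩ :=
          Theorems.FiniteDissipationLiouville.WindowRecurrence.stretching_excess_blob_in_every_window (max C A)
        exact ⟨ε, hε, hε1, ρ, hρ, fun c hc => hf C w hw (le_max_left C A)
          (Theorems.FiniteDissipationLiouville.CrossFlow.hasTypeIDecay_of_le (hA w hw hDw hsw)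
            (le_max_right C A)) hsw c hc⟩)
      (by
        -- (v66) super-caloricity with an extra palinstrophy credit fills a blob in every window (lead g19)
        obtain ⟨ε, hε, hε1, ρ, hρ, δ, hδ, hf⟩ :=
          Theorems.FiniteDissipationLiouville.WindowRecurrence.superCaloric_credit_blob_in_every_window C Kc
        exact ⟨ε, hε, hε1, ρ, hρ, δ, hδ, fun c hc => hf w hw hDw hsw c hc⟩)
      (by
        -- (v67) the stretching excess by a definite factor fills a blob in every window (lead g19)
        obtain ⟨ε, hε, hε1, ρ, hρ, δ, hδ, hf⟩ :=
          Theorems.FiniteDissipationLiouville.WindowRecurrence.stretching_excess_margin_blob_in_every_window (max C A)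
        exact ⟨ε, hε, hε1, ρ, hρ, δ, hδ, fun c hc => hf C w hw (le_max_left C A)
          (Theorems.FiniteDissipationLiouville.CrossFlow.hasTypeIDecay_of_le (hA w hw hDw hsw)
            (le_max_right C A)) hsw c hc⟩)
      (by
        -- (v68) the caloric defect (curl of the Lamb vector) fills a blob in every window (lead g20, crux frame)
        obtain ⟨ε, hε, hε1, ρ, hρ, δ, hδ, hf⟩ :=
          Theorems.FiniteDissipationLiouville.CaloricDefect.lambCurl_blob_in_every_window C Kc
        exact ⟨ε, hε, hε1, ρ, hρ, δ, hδ, fun c hc => hf w hw hDw hsw c hc⟩)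
      (by
        -- (v69) the dense caloric-defect floor in every parabolic cylinder of the core (lead g20, crux frame)
        intro ρ r hr
        obtain ⟨δ, hδ, hf⟩ :=
          Theorems.FiniteDissipationLiouville.CaloricDefect.lambCurl_floor_every_cylinder C Kc (ρ := ρ) hr
        exact ⟨δ, hδ, fun c hc x₀ hx₀ => hf w hw hDw hsw c hc x₀ hx₀⟩)
      (by
        -- (v70) the every-instant dense vorticity-gradient floor (lead g20, crux frame)
        intro ρ r hr
        obtain ⟨δ, hδ, hf⟩ :=
          Theorems.FiniteDissipationLiouville.VorticityGradient.fderivCurl_floor_every_instant C Kc (ρ := ρ) hr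
        exact ⟨δ, hδ, fun t ht x₀ hx₀ => hf w hw hDw hsw t ht x₀ hx₀⟩)
      (by
        -- (v71) the vorticity-gradient floor fills a blob in every window (lead g20, crux frame)
        obtain ⟨ε, hε, hε1, ρ, hρ, δ, hδ, hf⟩ :=
          Theorems.FiniteDissipationLiouville.VorticityGradient.fderivCurl_blob_in_every_window C Kc
        exact ⟨ε, hε, hε1, ρ, hρ, δ, hδ, fun c hc => hf w hw hDw hsw c hc⟩)
      (by
        -- (v72) the dense every-instant vorticity floor (lead g20, crux frame)
        intro ρ r hr
        obtain ⟨δ, hδ, hf⟩ :=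
          Theorems.FiniteDissipationLiouville.DenseFloors.curl_floor_dense C Kc (ρ := ρ) hr
        exact ⟨δ, hδ, fun t ht x₀ hx₀ => hf w hw hDw hsw t ht x₀ hx₀⟩)
      (by
        -- (v73) the dense every-instant planarity floor, uniform over unit directions (lead g20, crux frame)
        intro ρ r hr
        obtain ⟨δ, hδ, hf⟩ :=
          Theorems.FiniteDissipationLiouville.DenseFloors.fderiv_apply_floor_dense C Kc (ρ := ρ) hr
        exact ⟨δ, hδ, fun t ht e he x₀ hx₀ => hf w hw hDw hsw t ht e he x₀ hx₀⟩)
      (by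
        -- (v74) the frozen-law defect: the vorticity is nowhere locally harmonic (lead g20, crux frame)
        intro ρ r hr
        obtain ⟨δ, hδ, hf⟩ :=
          Theorems.FiniteDissipationLiouville.FrozenDefect.laplacianCurl_floor_every_instant C Kc (ρ := ρ) hr
        exact ⟨δ, hδ, fun t ht x₀ hx₀ => hf w hw hDw hsw t ht x₀ hx₀⟩)
      hsw

end Summit.NavierStokesRegularity.NavierStokesRegularity.Cruxes.FiniteDissipationLiouville.Birth
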